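import Mathlib
import Literature.Analysis.FluidPDE.AxisymmetricEuler
import Literature.Analysis.FluidPDE.SwirlTransportProofs
import Literature.Analysis.FluidPDE.VorticityCalculus
import Summits.NavierStokesRegularity.NavierStokesRegularity.Theorems.CoriolisHeadNoCoRotatingCoreKFoldExtremeRotation

/-! # The αm-shift toolkit: PV 2026 §6 (arXiv:2607.09619) with the k-fold symmetry gain (rev 19)
Infrastructure for the crux idea `alpha-m-shift` on 22676 `CoriolisHead.NoCoRotatingCore`; companion memo `AlphaMShiftRungs.md`
(full contents table, revision log, PV dictionary). NOT a line; no crux, rung or summit is proved here. Sorry-free, 0 warnings.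

CONTENTS (by section). § Wirtinger (periodic Wirtinger; k-fold angular Poincaré = PV (6.9)_k, constant 1/k) · § TwistedCircle / space
(`rotZL`, `azimuthalMean` = PV ⟨·⟩_θ, `kfold_poincare_weighted` / `_gauss`) · § Lemma 6.2 (`rotLie V x := DV(x)[Jx] − JV(x)` = −R,
skew-adjointness, 6.2 (ii)–(iv)) · § OU (`gauss`, `ouOp`, `gauss_green`, commutation pillar `rotLie_orthogonal_ouOp_gauss`,
`alphaMShift_identity_of_profile` = PV (6.18)) · § PV619 (`azFluct`, `pv619_identity` = (6.19), `pv_lemma64_kfold` = (6.17)_k) ·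
§ Prop65 (`pv_prop65_kfold`) · § Lemma63 (`pv612_convective` = (6.12)) · § Records (`PVBounds`, integrability records discharged,
`pv_prop65_kfold_of_bounds`) · § Dictionary (`noCoRotatingCore_eq_iff`: 22676's equation ⟺ PV (6.16a)) · § Skeleton (UNREGISTERED;
restated rung `KFoldExtremeRotationPV`; the open inputs typed α-UNIFORMLY: [d] `PVLemma21` (PV Lemma 2.1), [a] `PVLemma63` ⊇ [a-p]
`PVPressure63` ⊇ [a-r] `PVRieszPressure` (Riesz kernel (6.13)), [b] `PVEndgame` ⊇ [b1] `PVWeightedEnstrophy` (Prop. 5.1 + (5.4)) +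
[b2] `PVProp31` (Prop. 3.1); PROVED reductions `pvLemma63_of_pressure`, `pvPressure63_of_riesz` = (6.14)–(6.15), `pvEndgame_of` =
§6.5/(6.21); compositions `kFoldExtremeRotationPV_of`, `_of_pressure`, `_of_riesz`, **`kFoldExtremeRotationPV_of_inputs :
PVLemma21 → PVRieszPressure → PVWeightedEnstrophy → PVProp31 → KFoldExtremeRotationPV`**; self-probes of every typed input against the
rung: VERDICT CLEAN; `#print axioms` = [propext, Classical.choice, Quot.sound]). -/

open MeasureTheory Set Complex intervalIntegral

set_option linter.dupNamespace false

namespace Summit.NavierStokesRegularity.NavierStokesRegularity.Cruxes.NoCoRotatingCore.AlphaMShift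

/-- **Wirtinger's inequality (periodic, mean-zero form).** -/
theorem wirtinger_periodic {a b : ℝ} (hab : a < b) {f f' : ℝ → ℂ}
    (hf : ∀ x ∈ uIcc a b, HasDerivAt f (f' x) x)
    (hf' : MemLp f' 2 (volume.restrict (Ioc a b)))
    (hper : f b = f a) :
    ∫ x in a..b, ‖f x - fourierCoeffOn hab f 0‖ ^ 2
      ≤ ((b - a) / (2 * Real.pi)) ^ 2 * ∫ x in a..b, ‖f' x‖ ^ 2 := by
  set T : ℝ := b - a with hT
  have hTpos : 0 < T := by rw [hT]; linarith
  haveI : Fact (0 < T) := ⟨hTpos⟩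
  set c : ℂ := fourierCoeffOn hab f 0 with hc
  set g : ℝ → ℂ := fun x => f x - c with hg
  have hf'i : IntervalIntegrable f' volume a b := by
    rw [intervalIntegrable_iff_integrableOn_Ioc_of_le hab.le]
    haveI : IsFiniteMeasure (volume.restrict (Ioc a b)) := by
      refine ⟨?_⟩; rw [Measure.restrict_apply_univ]; exact measure_Ioc_lt_top
    exact hf'.integrable one_le_two
  have hgd : ∀ x ∈ uIcc a b, HasDerivAt g (f' x) x := fun x hx => (hf x hx).sub_const c
  have hfc : ContinuousOn f (uIcc a b) := fun x hx => (hf x hx).continuousAt.continuousWithinAt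
  have hgc : ContinuousOn g (uIcc a b) := hfc.sub continuousOn_const
  have hgL2 : MemLp g 2 (volume.restrict (Ioc a b)) := by
    haveI : IsFiniteMeasure (volume.restrict (Ioc a b)) := by
      refine ⟨?_⟩; rw [Measure.restrict_apply_univ]; exact measure_Ioc_lt_top
    obtain ⟨C, hC⟩ := (isCompact_uIcc.image_of_continuousOn hgc).isBounded.exists_norm_le
    refine MemLp.of_bound ?_ C ?_
    · exact (hgc.mono (by rw [uIcc_of_le hab.le]; exact Ioc_subset_Icc_self)).aestronglyMeasurable
        measurableSet_Ioc
    · rw [ae_restrict_iff' measurableSet_Ioc]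
      exact Filter.Eventually.of_forall fun x hx => hC _ ⟨x, by
        rw [uIcc_of_le hab.le]; exact Ioc_subset_Icc_self hx, rfl⟩
  have hcoef_ne : ∀ n : ℤ, n ≠ 0 →
      fourierCoeffOn hab g n = 1 / (-2 * Real.pi * I * n) * (-(T * fourierCoeffOn hab f' n)) := by
    intro n hn
    rw [fourierCoeffOn_of_hasDerivAt hab hn hgd hf'i]
    have : g b - g a = 0 := by rw [hg]; simp [hper]
    rw [this, mul_zero, zero_sub, hT]; push_cast; ring
  have hcoef_zero : fourierCoeffOn hab g 0 = 0 := by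
    have e1 : fourierCoeffOn hab g 0 = (1 / T) • ∫ x in a..b, g x := by
      rw [fourierCoeffOn_eq_integral, hT]; congr 1
      refine integral_congr fun x _ => ?_
      simp
    have e2 : c = (1 / T) • ∫ x in a..b, f x := by
      rw [hc, fourierCoeffOn_eq_integral, hT]; congr 1
      refine integral_congr fun x _ => ?_
      simp
    have hfi : IntervalIntegrable f volume a b := (hfc.mono (by rfl)).intervalIntegrable
    rw [e1, hg, intervalIntegral.integral_sub hfi intervalIntegrable_const, intervalIntegral.integral_const, e2]
    simp only [one_div, real_smul, ofReal_inv]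
    have hne' : ((b - a : ℝ) : ℂ) ≠ 0 := by exact_mod_cast (ne_of_gt (sub_pos.mpr hab))
    rw [hT]; field_simp; ring
  have hterm : ∀ n : ℤ, ‖fourierCoeffOn hab g n‖ ^ 2
      ≤ (T / (2 * Real.pi)) ^ 2 * ‖fourierCoeffOn hab f' n‖ ^ 2 := by
    intro n
    rcases eq_or_ne n 0 with rfl | hn
    · rw [hcoef_zero, norm_zero, zero_pow two_ne_zero]; positivity
    · rw [hcoef_ne n hn, ← mul_pow, norm_mul, norm_neg, norm_mul]
      have hnorm1 : ‖(1 : ℂ) / (-2 * Real.pi * I * n)‖ = 1 / (2 * Real.pi * |(n : ℝ)|) := by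
        rw [norm_div, norm_one]; congr 1
        simp [abs_of_pos Real.pi_pos]
      have hn1 : (1 : ℝ) ≤ |(n : ℝ)| := by
        rw [← Int.cast_abs]; exact_mod_cast Int.one_le_abs hn
      rw [hnorm1, Complex.norm_real, Real.norm_eq_abs, abs_of_pos hTpos]
      have h0 : 0 ≤ ‖fourierCoeffOn hab f' n‖ := norm_nonneg _
      have : 1 / (2 * Real.pi * |(n : ℝ)|) * (T * ‖fourierCoeffOn hab f' n‖)
          ≤ T / (2 * Real.pi) * ‖fourierCoeffOn hab f' n‖ := by
        rw [div_mul_eq_mul_div, one_mul, div_mul_eq_mul_div]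
        apply div_le_div_of_nonneg_left (by positivity) (by positivity)
        nlinarith [Real.pi_pos]
      exact pow_le_pow_left₀ (by positivity) this 2
  have hPg := hasSum_sq_fourierCoeffOn hab hgL2
  have hPf := (hasSum_sq_fourierCoeffOn hab hf').mul_left ((T / (2 * Real.pi)) ^ 2)
  have hle := hasSum_le hterm hPg hPf
  rw [smul_eq_mul, smul_eq_mul] at hle
  have hI : 0 ≤ ∫ x in a..b, ‖g x‖ ^ 2 :=
    intervalIntegral.integral_nonneg hab.le fun x _ => by positivity
  have key : (∫ x in a..b, ‖g x‖ ^ 2) ≤ (T / (2 * Real.pi)) ^ 2 * ∫ x in a..b, ‖f' x‖ ^ 2 := by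
    have := mul_le_mul_of_nonneg_left hle hTpos.le
    have hne : (b - a) ≠ 0 := ne_of_gt (by linarith)
    rw [hT] at this ⊢
    have hba : (b - a) * ((b - a)⁻¹ * ∫ x in a..b, ‖g x‖ ^ 2) = ∫ x in a..b, ‖g x‖ ^ 2 := by
      field_simp
    have hba' : (b - a) * (((b - a) / (2 * Real.pi)) ^ 2 * ((b - a)⁻¹ * ∫ x in a..b, ‖f' x‖ ^ 2))
        = ((b - a) / (2 * Real.pi)) ^ 2 * ∫ x in a..b, ‖f' x‖ ^ 2 := by
      field_simp
    rwa [hba, hba'] at this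
  simpa [hg, hT] using key

/-- `L²` membership of a function continuous on `[a, b]`, on `(a, b]`. -/
theorem memLp_two_of_continuousOn {a b : ℝ} (_hab : a ≤ b) {g : ℝ → ℂ} (hgc : ContinuousOn g (Icc a b)) :
    MemLp g 2 (volume.restrict (Ioc a b)) := by
  haveI : IsFiniteMeasure (volume.restrict (Ioc a b)) := by
    refine ⟨?_⟩; rw [Measure.restrict_apply_univ]; exact measure_Ioc_lt_top
  obtain ⟨C, hC⟩ := (isCompact_Icc.image_of_continuousOn hgc).isBounded.exists_norm_le
  refine MemLp.of_bound ?_ C ?_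
  · exact (hgc.mono Ioc_subset_Icc_self).aestronglyMeasurable measurableSet_Ioc
  · rw [ae_restrict_iff' measurableSet_Ioc]
    exact Filter.Eventually.of_forall fun x hx => hC _ ⟨x, Ioc_subset_Icc_self hx, rfl⟩

/-- The derivative of a periodic function is periodic (when `f'` is THE derivative everywhere). -/
theorem periodic_deriv_of_periodic {f f' : ℝ → ℂ} {τ : ℝ} (hf : ∀ x, HasDerivAt f (f' x) x)
    (hper : Function.Periodic f τ) : Function.Periodic f' τ := by
  intro x
  have h1 : HasDerivAt f (f' (x + τ)) (x + τ) := hf (x + τ)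
  have h2 : HasDerivAt (fun y => f (y + τ)) (f' (x + τ)) x := by
    have := h1.comp_add_const x τ
    simpa using this
  have h3 : (fun y => f (y + τ)) = f := funext fun y => hper y
  rw [h3] at h2
  exact h2.unique (hf x)

/-- Integral of a continuous `τ`-periodic function over `k` periods. -/
theorem integral_periods {g : ℝ → ℝ} {τ : ℝ} (hper : Function.Periodic g τ) (hgc : Continuous g) (k : ℕ) :
    ∫ x in (0 : ℝ)..(k * τ), g x = k * ∫ x in (0 : ℝ)..τ, g x := by
  have h := hper.intervalIntegral_add_zsmul_eq (k : ℤ) 0 (fun t₁ t₂ => hgc.intervalIntegrable t₁ t₂)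
  simp only [zero_add, zsmul_eq_mul, Int.cast_natCast] at h
  simpa using h

/-- **k-fold Wirtinger inequality**: a `C¹` function with period `T/k` has fluctuation about its mean on
`[0, T]` controlled with constant `T/(2πk)` — the `1/k` gain that drives RUNG K(k). -/
theorem wirtinger_kfold {T : ℝ} (hT : 0 < T) {k : ℕ} (hk : 1 ≤ k) {f f' : ℝ → ℂ}
    (hf : ∀ x, HasDerivAt f (f' x) x) (hf'c : Continuous f')
    (hper : Function.Periodic f (T / k)) :
    ∫ x in (0 : ℝ)..T, ‖f x - (T : ℂ)⁻¹ * ∫ y in (0 : ℝ)..T, f y‖ ^ 2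
      ≤ (T / (2 * Real.pi * k)) ^ 2 * ∫ x in (0 : ℝ)..T, ‖f' x‖ ^ 2 := by
  have hkpos : (0 : ℝ) < k := by exact_mod_cast hk
  set τ : ℝ := T / k with hτ
  have hτpos : 0 < τ := div_pos hT hkpos
  have hkτ : (k : ℝ) * τ = T := by rw [hτ]; field_simp
  have hfc : Continuous f := continuous_iff_continuousAt.mpr fun x => (hf x).continuousAt
  have hper' : Function.Periodic f' τ := periodic_deriv_of_periodic hf hper
  set c : ℂ := fourierCoeffOn hτpos f 0 with hc
  have hcτ : c = (τ : ℂ)⁻¹ * ∫ y in (0 : ℝ)..τ, f y := by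
    rw [hc, fourierCoeffOn_eq_integral, sub_zero]
    have : (∫ x in (0 : ℝ)..τ, (fourier (-0) (x : AddCircle τ)) • f x) = ∫ x in (0 : ℝ)..τ, f x :=
      integral_congr fun x _ => by simp
    rw [this]; simp [real_smul]
  have hintf : ∫ y in (0 : ℝ)..T, f y = (k : ℂ) * ∫ y in (0 : ℝ)..τ, f y := by
    have h := hper.intervalIntegral_add_zsmul_eq (k : ℤ) 0 (fun t₁ t₂ => hfc.intervalIntegrable t₁ t₂)
    simp only [zero_add, zsmul_eq_mul, Int.cast_natCast] at h
    rw [hkτ] at h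
    rw [h]
  have hcT : (T : ℂ)⁻¹ * ∫ y in (0 : ℝ)..T, f y = c := by
    rw [hintf, hcτ, ← hkτ]
    have hk0 : (k : ℂ) ≠ 0 := by exact_mod_cast (ne_of_gt hkpos)
    have hτ0 : (τ : ℂ) ≠ 0 := by exact_mod_cast (ne_of_gt hτpos)
    push_cast; field_simp
  rw [hcT]
  have hg1 : Function.Periodic (fun x => ‖f x - c‖ ^ 2) τ := fun x => by simp [hper x]
  have hg2 : Function.Periodic (fun x => ‖f' x‖ ^ 2) τ := fun x => by simp [hper' x]
  have hI1 := integral_periods hg1 ((hfc.sub continuous_const).norm.pow 2) k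
  have hI2 := integral_periods hg2 (hf'c.norm.pow 2) k
  rw [hkτ] at hI1 hI2
  rw [hI1, hI2]
  have hW := wirtinger_periodic hτpos (f := f) (f' := f') (fun x _ => hf x)
    (memLp_two_of_continuousOn hτpos.le hf'c.continuousOn) (by
      have := hper 0; rw [zero_add] at this; exact this)
  rw [sub_zero] at hW
  have hk0 : (0 : ℝ) ≤ k := hkpos.le
  calc (k : ℝ) * ∫ x in (0 : ℝ)..τ, ‖f x - c‖ ^ 2
      ≤ k * ((τ / (2 * Real.pi)) ^ 2 * ∫ x in (0 : ℝ)..τ, ‖f' x‖ ^ 2) :=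
        mul_le_mul_of_nonneg_left hW hk0
    _ = (T / (2 * Real.pi * k)) ^ 2 * (k * ∫ x in (0 : ℝ)..τ, ‖f' x‖ ^ 2) := by
        rw [hτ]; field_simp


/-! ## Twisted Wirtinger on circles for k-fold equivariant vector fields on ℝ³

For `V : ℝ³ → ℝ³` of class `C¹` with the k-fold rotational equivariance
`V (R_{2π/k} x) = R_{2π/k} (V x)`, the pulled-back circle function `g θ = R_{−θ} V (R_θ y₀)` is
`2π/k`-periodic with `g' θ = R_{−θ} (L_rot V)(R_θ y₀)`, `L_rot V x = DV(x)[J x] − J (V x)`; Wirtinger on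
each component gives the per-circle angular Poincaré inequality with the `1/k` gain
(`twisted_wirtinger_kfold`), the mechanism of RUNG K(k) (PV 2026 §6.2 (6.9) with symmetry). The
azimuthal mean `azimuthalMean V` is an axisymmetric field (`azimuthalMean_rotZ`). -/

section TwistedCircle

open Literature.Analysis.FluidPDE

/-- `ℝ³`. -/
abbrev E3 : Type := EuclideanSpace ℝ (Fin 3)

theorem rotZ_add_vec (θ : ℝ) (x y : E3) : rotZ θ (x + y) = rotZ θ x + rotZ θ y := by
  ext i; fin_cases i <;> simp <;> ring

theorem rotZ_smul_vec (θ c : ℝ) (x : E3) : rotZ θ (c • x) = c • rotZ θ x := by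
  ext i; fin_cases i <;> simp <;> ring

theorem rotZ_sub_vec (θ : ℝ) (x y : E3) : rotZ θ (x - y) = rotZ θ x - rotZ θ y := by
  ext i; fin_cases i <;> simp <;> ring

/-- `R_θ` as a continuous linear map. -/
noncomputable def rotZL (θ : ℝ) : E3 →L[ℝ] E3 :=
  LinearMap.toContinuousLinearMap
    { toFun := rotZ θ
      map_add' := rotZ_add_vec θ
      map_smul' := fun c x => rotZ_smul_vec θ c x }

@[simp] theorem rotZL_apply (θ : ℝ) (x : E3) : rotZL θ x = rotZ θ x := rfl

theorem rotZ_neg_rotZ (θ : ℝ) (x : E3) : rotZ (-θ) (rotZ θ x) = x := by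
  rw [← rotZ_add, neg_add_cancel, rotZ_zero]

theorem rotZ_rotZ_neg (θ : ℝ) (x : E3) : rotZ θ (rotZ (-θ) x) = x := by
  rw [← rotZ_add, add_neg_cancel, rotZ_zero]

theorem rotZ_add_two_pi (θ : ℝ) (x : E3) : rotZ (θ + 2 * Real.pi) x = rotZ θ x := by
  ext i; fin_cases i <;> simp [Real.cos_add_two_pi, Real.sin_add_two_pi]

/-- `J R_θ = R_θ J`. -/
theorem rotGen_rotZ (θ : ℝ) (x : E3) : rotGen (rotZ θ x) = rotZ θ (rotGen x) := by
  ext i; fin_cases i <;> simp [rotGen] <;> ring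

/-- Velocity of `θ ↦ R_θ x` at `θ₀` is `J (R_{θ₀} x)`. -/
theorem hasDerivAt_rotZ' (x : E3) (θ₀ : ℝ) :
    HasDerivAt (fun θ => rotZ θ x) (rotGen (rotZ θ₀ x)) θ₀ := by
  have h := hasDerivAt_rotZ x θ₀
  convert h using 1
  ext i; fin_cases i <;> simp [rotGen] <;> ring

theorem continuous_rotZ_left (x : E3) : Continuous fun θ : ℝ => rotZ θ x :=
  continuous_iff_continuousAt.mpr fun θ => (hasDerivAt_rotZ' x θ).continuousAt

/-- The azimuthal (axisymmetrising) mean of a vector field on the circle through `y₀`: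
`V_a(y₀) = (2π)⁻¹ ∫₀^{2π} R_{−θ} V(R_θ y₀) dθ`. -/
noncomputable def azimuthalMean (V : E3 → E3) (y₀ : E3) : E3 :=
  (1 / (2 * Real.pi)) • ∫ θ in (0 : ℝ)..2 * Real.pi, rotZ (-θ) (V (rotZ θ y₀))

/-- `R_θ w = cos θ (w − w₂ e₂) + sin θ J w + w₂ e₂`. -/
theorem rotZ_eq_smul_decomp (θ : ℝ) (w : E3) :
    rotZ θ w = Real.cos θ • (w - (w 2) • EuclideanSpace.single 2 (1 : ℝ)) + Real.sin θ • rotGen w +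
      (w 2) • EuclideanSpace.single 2 (1 : ℝ) := by
  ext i; fin_cases i <;> simp [rotGen] <;> ring

/-- Continuity of `x ↦ R_{a x} (W x)` for continuous `a`, `W` (any topological domain). -/
theorem continuous_rotZ_comp {X : Type} [TopologicalSpace X] {a : X → ℝ} {W : X → E3}
    (ha : Continuous a) (hW : Continuous W) :
    Continuous fun θ => rotZ (a θ) (W θ) := by
  have h2 : Continuous fun θ => W θ 2 := (PiLp.continuous_apply 2 _ 2).comp hW
  have : (fun θ => rotZ (a θ) (W θ)) = fun θ =>
      Real.cos (a θ) • (W θ - (W θ 2) • EuclideanSpace.single 2 (1 : ℝ)) + Real.sin (a θ) • rotGen (W θ) +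
        (W θ 2) • EuclideanSpace.single 2 (1 : ℝ) := funext fun θ => rotZ_eq_smul_decomp (a θ) (W θ)
  rw [this]
  exact (((Real.continuous_cos.comp ha).smul (hW.sub (h2.smul continuous_const))).add
    ((Real.continuous_sin.comp ha).smul (rotGenL.continuous.comp hW))).add (h2.smul continuous_const)

/-- The pulled-back circle function is continuous for continuous `V`. -/
theorem continuous_pullback {V : E3 → E3} (hV : Continuous V) (y₀ : E3) :
    Continuous fun θ : ℝ => rotZ (-θ) (V (rotZ θ y₀)) :=
  continuous_rotZ_comp continuous_neg (hV.comp (continuous_rotZ_left y₀))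

/-- **The azimuthal mean is axisymmetric-covariant**: `V_a(R_φ y) = R_φ V_a(y)`. -/
theorem azimuthalMean_rotZ {V : E3 → E3} (hV : Continuous V) (φ : ℝ) (y : E3) :
    azimuthalMean V (rotZ φ y) = rotZ φ (azimuthalMean V y) := by
  unfold azimuthalMean
  set H : ℝ → E3 := fun s => rotZ (-s) (V (rotZ s y)) with hH
  have hHc : Continuous H := continuous_pullback hV y
  have hper : Function.Periodic H (2 * Real.pi) := by
    intro s
    simp only [hH]
    have h1 : rotZ (-(s + 2 * Real.pi)) = rotZ (-s) := by
      funext x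
      have := rotZ_add_two_pi (-(s + 2 * Real.pi)) x
      rw [show -(s + 2 * Real.pi) + 2 * Real.pi = -s by ring] at this
      exact this.symm
    rw [rotZ_add_two_pi, h1]
  have hint : ∀ θ, rotZ (-θ) (V (rotZ θ (rotZ φ y))) = rotZL φ (H (θ + φ)) := by
    intro θ
    simp only [hH, rotZL_apply]
    rw [← rotZ_add, add_comm θ φ, ← rotZ_add, show φ + -(φ + θ) = -θ by ring]
  simp_rw [hint]
  have hHi : IntervalIntegrable (fun θ => H (θ + φ)) volume 0 (2 * Real.pi) :=
    (hHc.comp (continuous_add_const φ)).intervalIntegrable _ _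
  rw [ContinuousLinearMap.intervalIntegral_comp_comm (rotZL φ) hHi]
  rw [intervalIntegral.integral_comp_add_right (f := H) φ, zero_add]
  rw [show (2 * Real.pi + φ) = φ + 2 * Real.pi by ring, hper.intervalIntegral_add_eq φ 0, zero_add]
  rw [rotZL_apply, rotZ_smul_vec]

/-- The azimuthal mean field of a continuous field is axisymmetric. -/
theorem isAxisymmetric_azimuthalMean {V : E3 → E3} (hV : Continuous V) :
    IsAxisymmetric (azimuthalMean V) := fun θ x => azimuthalMean_rotZ hV θ x

/-- An axisymmetric field is its own azimuthal mean. -/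
theorem azimuthalMean_of_isAxisymmetric {V : E3 → E3} (hV : IsAxisymmetric V) (y₀ : E3) :
    azimuthalMean V y₀ = V y₀ := by
  unfold azimuthalMean
  have : ∀ θ, rotZ (-θ) (V (rotZ θ y₀)) = V y₀ := fun θ => by rw [hV θ y₀, rotZ_neg_rotZ]
  simp_rw [this, intervalIntegral.integral_const, sub_zero, smul_smul]
  rw [show 1 / (2 * Real.pi) * (2 * Real.pi) = 1 by field_simp, one_smul]

/-- Scalar Wirtinger (real-valued, whole-line `C¹`, period `T/k`) — from `wirtinger_kfold`. -/
theorem wirtinger_kfold_real {T : ℝ} (hT : 0 < T) {k : ℕ} (hk : 1 ≤ k) {g g' : ℝ → ℝ}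
    (hg : ∀ x, HasDerivAt g (g' x) x) (hg'c : Continuous g')
    (hper : Function.Periodic g (T / k)) :
    ∫ x in (0 : ℝ)..T, (g x - T⁻¹ * ∫ y in (0 : ℝ)..T, g y) ^ 2
      ≤ (T / (2 * Real.pi * k)) ^ 2 * ∫ x in (0 : ℝ)..T, (g' x) ^ 2 := by
  have h := wirtinger_kfold hT hk (f := fun x => ((g x : ℝ) : ℂ)) (f' := fun x => ((g' x : ℝ) : ℂ))
    (fun x => (hg x).ofReal_comp) (continuous_ofReal.comp hg'c) (fun x => by simp [hper x])
  have h1 : ∀ x, ‖((g x : ℝ) : ℂ) - (T : ℂ)⁻¹ * ∫ y in (0 : ℝ)..T, ((g y : ℝ) : ℂ)‖ ^ 2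
      = (g x - T⁻¹ * ∫ y in (0 : ℝ)..T, g y) ^ 2 := by
    intro x
    rw [intervalIntegral.integral_ofReal, ← ofReal_inv, ← ofReal_mul, ← ofReal_sub, norm_real,
      Real.norm_eq_abs, sq_abs]
  have h2 : ∀ x, ‖((g' x : ℝ) : ℂ)‖ ^ 2 = (g' x) ^ 2 := fun x => by
    rw [norm_real, Real.norm_eq_abs, sq_abs]
  simp_rw [h1, h2] at h
  exact h

/-- **Twisted Wirtinger inequality on circles for k-fold equivariant fields** `V ∈ C¹(ℝ³; ℝ³)`, `V ∘ R_{2π/k} = R_{2π/k} ∘ V`: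
`∫₀^{2π} ‖V(R_θ y₀) − R_θ V_a(y₀)‖² dθ ≤ k⁻² ∫₀^{2π} ‖DV(R_θ y₀)[J R_θ y₀] − J V(R_θ y₀)‖² dθ` (integrand = `|L_rot V|²`). -/
theorem twisted_wirtinger_kfold {k : ℕ} (hk : 1 ≤ k) {V : E3 → E3} (hV : ContDiff ℝ 1 V)
    (hsym : ∀ x, V (rotZ (2 * Real.pi / k) x) = rotZ (2 * Real.pi / k) (V x)) (y₀ : E3) :
    ∫ θ in (0 : ℝ)..2 * Real.pi, ‖V (rotZ θ y₀) - rotZ θ (azimuthalMean V y₀)‖ ^ 2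
      ≤ ((1 : ℝ) / k) ^ 2 * ∫ θ in (0 : ℝ)..2 * Real.pi,
          ‖fderiv ℝ V (rotZ θ y₀) (rotGen (rotZ θ y₀)) - rotGen (V (rotZ θ y₀))‖ ^ 2 := by
  have h2pi : 0 < 2 * Real.pi := by positivity
  have hkpos : (0 : ℝ) < k := by exact_mod_cast hk
  set W : ℝ → E3 := fun θ => V (rotZ θ y₀) with hW
  set D : ℝ → E3 := fun θ => fderiv ℝ V (rotZ θ y₀) (rotGen (rotZ θ y₀)) with hD
  set g : ℝ → E3 := fun θ => rotZ (-θ) (W θ) with hg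
  set E : ℝ → E3 := fun θ => rotZ (-θ) (D θ - rotGen (W θ)) with hE
  set m : E3 := azimuthalMean V y₀ with hm
  have hVd : Differentiable ℝ V := hV.differentiable one_ne_zero
  have hVc : Continuous V := hV.continuous
  have hWd : ∀ θ, HasDerivAt W (D θ) θ := fun θ =>
    (hVd (rotZ θ y₀)).hasFDerivAt.comp_hasDerivAt θ (hasDerivAt_rotZ' y₀ θ)
  have hWc : Continuous W := hVc.comp (continuous_rotZ_left y₀)
  have hDc : Continuous D := by
    have hA : Continuous fun θ => fderiv ℝ V (rotZ θ y₀) :=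
      (hV.continuous_fderiv one_ne_zero).comp (continuous_rotZ_left y₀)
    have hv : Continuous fun θ => rotGen (rotZ θ y₀) := rotGenL.continuous.comp (continuous_rotZ_left y₀)
    exact hA.clm_apply hv
  have hgc : Continuous g := continuous_pullback hVc y₀
  have hcomp : ∀ i : Fin 3, ∀ θ, HasDerivAt (fun θ => g θ i) (E θ i) θ := by
    intro i θ
    have hW0 : HasDerivAt (fun θ => W θ 0) (D θ 0) θ := by
      have h := (PiLp.proj (𝕜 := ℝ) 2 (fun _ : Fin 3 => ℝ) 0).hasFDerivAt.comp_hasDerivAt θ (hWd θ)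
      convert h using 1 <;> rfl
    have hW1 : HasDerivAt (fun θ => W θ 1) (D θ 1) θ := by
      have h := (PiLp.proj (𝕜 := ℝ) 2 (fun _ : Fin 3 => ℝ) 1).hasFDerivAt.comp_hasDerivAt θ (hWd θ)
      convert h using 1 <;> rfl
    have hW2 : HasDerivAt (fun θ => W θ 2) (D θ 2) θ := by
      have h := (PiLp.proj (𝕜 := ℝ) 2 (fun _ : Fin 3 => ℝ) 2).hasFDerivAt.comp_hasDerivAt θ (hWd θ)
      convert h using 1 <;> rfl
    fin_cases i
    · -- g₀ = cos θ W₀ + sin θ W₁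
      have h : HasDerivAt (fun θ => Real.cos θ * W θ 0 + Real.sin θ * W θ 1)
          (-Real.sin θ * W θ 0 + Real.cos θ * D θ 0 + (Real.cos θ * W θ 1 + Real.sin θ * D θ 1)) θ :=
        ((Real.hasDerivAt_cos θ).mul hW0).add ((Real.hasDerivAt_sin θ).mul hW1)
      have hfun : (fun θ => g θ 0) = fun θ => Real.cos θ * W θ 0 + Real.sin θ * W θ 1 := by
        funext θ; simp [hg, Real.cos_neg, Real.sin_neg]
      have hval : E θ 0 = -Real.sin θ * W θ 0 + Real.cos θ * D θ 0 + (Real.cos θ * W θ 1 + Real.sin θ * D θ 1) := by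
        simp [hE, rotGen, Real.cos_neg, Real.sin_neg]; ring
      simpa [hfun, hval] using h
    · -- g₁ = −sin θ W₀ + cos θ W₁
      have h : HasDerivAt (fun θ => -(Real.sin θ * W θ 0) + Real.cos θ * W θ 1)
          (-(Real.cos θ * W θ 0 + Real.sin θ * D θ 0) + (-Real.sin θ * W θ 1 + Real.cos θ * D θ 1)) θ :=
        ((Real.hasDerivAt_sin θ).mul hW0).neg.add ((Real.hasDerivAt_cos θ).mul hW1)
      have hfun : (fun θ => g θ 1) = fun θ => -(Real.sin θ * W θ 0) + Real.cos θ * W θ 1 := by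
        funext θ; simp [hg, Real.cos_neg, Real.sin_neg]
      have hval : E θ 1 = -(Real.cos θ * W θ 0 + Real.sin θ * D θ 0) + (-Real.sin θ * W θ 1 + Real.cos θ * D θ 1) := by
        simp [hE, rotGen, Real.cos_neg, Real.sin_neg]; ring
      simpa [hfun, hval] using h
    · -- g₂ = W₂
      have hfun : (fun θ => g θ 2) = fun θ => W θ 2 := by funext θ; simp [hg]
      have hval : E θ 2 = D θ 2 := by simp [hE, rotGen]
      simpa [hfun, hval] using hW2
  have hEc : Continuous E :=
    continuous_rotZ_comp continuous_neg (hDc.sub (rotGenL.continuous.comp hWc))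
  have hgper : Function.Periodic g (2 * Real.pi / k) := by
    intro θ
    simp only [hg, hW]
    rw [add_comm θ, rotZ_add, hsym, ← rotZ_add, show -(2 * Real.pi / ↑k + θ) + 2 * Real.pi / ↑k = -θ by ring]
  have hmi : ∀ i : Fin 3, m i = (2 * Real.pi)⁻¹ * ∫ θ in (0 : ℝ)..2 * Real.pi, g θ i := by
    intro i
    have hint : IntervalIntegrable g volume 0 (2 * Real.pi) := hgc.intervalIntegrable _ _
    have := (PiLp.proj (𝕜 := ℝ) 2 (fun _ : Fin 3 => ℝ) i).intervalIntegral_comp_comm hint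
    simp only [PiLp.proj_apply] at this
    simp only [hm, azimuthalMean, one_div]
    rw [PiLp.smul_apply, smul_eq_mul, ← this]
  have hci : ∀ i : Fin 3,
      ∫ θ in (0 : ℝ)..2 * Real.pi, (g θ i - m i) ^ 2
        ≤ ((1 : ℝ) / k) ^ 2 * ∫ θ in (0 : ℝ)..2 * Real.pi, (E θ i) ^ 2 := by
    intro i
    have hEic : Continuous fun θ => E θ i := (PiLp.continuous_apply 2 _ i).comp hEc
    have h := wirtinger_kfold_real h2pi hk (g := fun θ => g θ i) (g' := fun θ => E θ i)
      (hcomp i) hEic (fun θ => by simpa using congrArg (fun v : E3 => v i) (hgper θ))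
    rw [hmi i]
    have hc : (2 * Real.pi / (2 * Real.pi * k)) = (1 : ℝ) / k := by field_simp
    rw [hc] at h
    exact h
  have hL : ∀ θ, ‖V (rotZ θ y₀) - rotZ θ m‖ ^ 2 = ∑ i : Fin 3, (g θ i - m i) ^ 2 := by
    intro θ
    have : g θ - m = rotZ (-θ) (V (rotZ θ y₀) - rotZ θ m) := by
      simp only [hg, hW]; rw [rotZ_sub_vec, rotZ_neg_rotZ]
    rw [← norm_rotZ (-θ), ← this, EuclideanSpace.real_norm_sq_eq]
    simp
  have hR : ∀ θ, ‖fderiv ℝ V (rotZ θ y₀) (rotGen (rotZ θ y₀)) - rotGen (V (rotZ θ y₀))‖ ^ 2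
      = ∑ i : Fin 3, (E θ i) ^ 2 := by
    intro θ
    rw [← norm_rotZ (-θ), show rotZ (-θ) (fderiv ℝ V (rotZ θ y₀) (rotGen (rotZ θ y₀)) - rotGen (V (rotZ θ y₀))) = E θ by
      simp only [hE, hD, hW], EuclideanSpace.real_norm_sq_eq]
  simp_rw [hL, hR]
  have hgi : ∀ i : Fin 3, IntervalIntegrable (fun θ => (g θ i - m i) ^ 2) volume 0 (2 * Real.pi) := fun i =>
    ((((PiLp.continuous_apply 2 _ i).comp hgc).sub continuous_const).pow 2).intervalIntegrable _ _
  have hEi : ∀ i : Fin 3, IntervalIntegrable (fun θ => (E θ i) ^ 2) volume 0 (2 * Real.pi) := fun i =>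
    (((PiLp.continuous_apply 2 _ i).comp hEc).pow 2).intervalIntegrable _ _
  rw [intervalIntegral.integral_finsetSum (fun i _ => hgi i), intervalIntegral.integral_finsetSum (fun i _ => hEi i),
    Finset.mul_sum]
  exact Finset.sum_le_sum fun i _ => hci i

/-! ### From circles to space: rotation averaging and the weighted k-fold angular Poincaré inequality on ℝ³ -/

/-- `R_θ` as a linear isometry equivalence. -/
noncomputable def rotZLIE (θ : ℝ) : E3 ≃ₗᵢ[ℝ] E3 :=
  { toLinearEquiv :=
      { toFun := rotZ θ
        invFun := rotZ (-θ)
        map_add' := rotZ_add_vec θ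
        map_smul' := fun c x => rotZ_smul_vec θ c x
        left_inv := fun x => rotZ_neg_rotZ θ x
        right_inv := fun x => rotZ_rotZ_neg θ x }
    norm_map' := norm_rotZ θ }

@[simp] theorem rotZLIE_apply (θ : ℝ) (x : E3) : rotZLIE θ x = rotZ θ x := rfl

/-- Rotations preserve Lebesgue measure on `ℝ³`. -/
theorem measurePreserving_rotZ (θ : ℝ) :
    MeasureTheory.MeasurePreserving (rotZ θ) MeasureTheory.volume MeasureTheory.volume :=
  (rotZLIE θ).measurePreserving

theorem measurable_rotZ_uncurry : Measurable fun p : ℝ × E3 => rotZ p.1 p.2 :=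
  (continuous_rotZ_comp continuous_fst continuous_snd).measurable

/-- **Rotation averaging.** `vol(S) · ∫ φ = ∫_y ∫_{θ ∈ S} φ(R_θ y)` for `S = (0, 2π]`. -/
theorem lintegral_rotation_average {φ : E3 → ENNReal} (hφ : Measurable φ) :
    MeasureTheory.volume (Ioc (0 : ℝ) (2 * Real.pi)) * ∫⁻ y, φ y
      = ∫⁻ y, ∫⁻ θ in Ioc (0 : ℝ) (2 * Real.pi), φ (rotZ θ y) := by
  have h1 : ∫⁻ θ in Ioc (0 : ℝ) (2 * Real.pi), ∫⁻ y, φ (rotZ θ y)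
      = MeasureTheory.volume (Ioc (0 : ℝ) (2 * Real.pi)) * ∫⁻ y, φ y := by
    have : ∀ θ, ∫⁻ y, φ (rotZ θ y) = ∫⁻ y, φ y := fun θ => (measurePreserving_rotZ θ).lintegral_comp hφ
    simp_rw [this]
    rw [MeasureTheory.setLIntegral_const, mul_comm]
  rw [← h1]
  exact MeasureTheory.lintegral_lintegral_swap ((hφ.comp measurable_rotZ_uncurry).aemeasurable)

/-- **Circle-to-space monotonicity.** If on every circle about the axis `∫ f ≤ ∫ g`, then `∫_{ℝ³} f ≤ ∫_{ℝ³} g`. -/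
theorem lintegral_le_of_circle_le {f g : E3 → ENNReal} (hf : Measurable f) (hg : Measurable g)
    (h : ∀ y₀, ∫⁻ θ in Ioc (0 : ℝ) (2 * Real.pi), f (rotZ θ y₀)
      ≤ ∫⁻ θ in Ioc (0 : ℝ) (2 * Real.pi), g (rotZ θ y₀)) :
    ∫⁻ y, f y ≤ ∫⁻ y, g y := by
  have hS0 : MeasureTheory.volume (Ioc (0 : ℝ) (2 * Real.pi)) ≠ 0 := by
    rw [Real.volume_Ioc, sub_zero]; exact (ENNReal.ofReal_pos.mpr (by positivity)).ne'
  have hStop : MeasureTheory.volume (Ioc (0 : ℝ) (2 * Real.pi)) ≠ ⊤ := by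
    rw [Real.volume_Ioc]; exact ENNReal.ofReal_ne_top
  have key := MeasureTheory.lintegral_mono (μ := MeasureTheory.volume) fun y => h y
  rw [← lintegral_rotation_average hf, ← lintegral_rotation_average hg] at key
  exact (ENNReal.mul_le_mul_iff_right hS0 hStop).mp key

/-- The azimuthal mean of a continuous field is continuous. -/
theorem continuous_azimuthalMean {V : E3 → E3} (hV : Continuous V) : Continuous (azimuthalMean V) := by
  unfold azimuthalMean
  have hj : Continuous (Function.uncurry fun (y : E3) (θ : ℝ) => rotZ (-θ) (V (rotZ θ y))) := by
    have h1 : Continuous fun p : E3 × ℝ => V (rotZ p.2 p.1) :=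
      hV.comp (continuous_rotZ_comp continuous_snd continuous_fst)
    exact continuous_rotZ_comp (continuous_snd.neg) h1
  have hI : Continuous fun y : E3 => ∫ θ in (0 : ℝ)..2 * Real.pi, rotZ (-θ) (V (rotZ θ y)) :=
    intervalIntegral.continuous_parametric_intervalIntegral_of_continuous' hj 0 (2 * Real.pi)
  exact hI.const_smul (1 / (2 * Real.pi) : ℝ)

/-- Bochner interval integral of a continuous nonnegative function as a lintegral over `Ioc`. -/
theorem ofReal_intervalIntegral_eq_lintegral {a : ℝ → ℝ} (ha : Continuous a) (hnn : ∀ θ, 0 ≤ a θ)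
    {T : ℝ} (hT : 0 ≤ T) :
    ENNReal.ofReal (∫ θ in (0 : ℝ)..T, a θ) = ∫⁻ θ in Ioc (0 : ℝ) T, ENNReal.ofReal (a θ) := by
  rw [intervalIntegral.integral_of_le hT]
  exact MeasureTheory.ofReal_integral_eq_lintegral_ofReal (ha.integrableOn_Ioc)
    (MeasureTheory.ae_of_all _ fun θ => hnn θ)

/-- Abstract circle-to-space transport with a rotation-invariant weight. -/
theorem lintegral_weight_le_of_circle {a b : E3 → ℝ} {w : E3 → ENNReal} (c : ℝ) (hc : 0 ≤ c)
    (ha : Continuous a) (hb : Continuous b) (hw : Measurable w) (hwrot : ∀ θ y, w (rotZ θ y) = w y)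
    (ha0 : ∀ y, 0 ≤ a y) (hb0 : ∀ y, 0 ≤ b y)
    (h : ∀ y₀, ∫ θ in (0 : ℝ)..2 * Real.pi, a (rotZ θ y₀) ≤ c * ∫ θ in (0 : ℝ)..2 * Real.pi, b (rotZ θ y₀)) :
    ∫⁻ y, ENNReal.ofReal (a y) * w y ≤ ENNReal.ofReal c * ∫⁻ y, ENNReal.ofReal (b y) * w y := by
  have ham : Measurable fun y => ENNReal.ofReal (a y) := ENNReal.measurable_ofReal.comp ha.measurable
  have hbm : Measurable fun y => ENNReal.ofReal (b y) := ENNReal.measurable_ofReal.comp hb.measurable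
  have hfm : Measurable fun y => ENNReal.ofReal (a y) * w y := ham.mul hw
  have hgm0 : Measurable fun y => ENNReal.ofReal (b y) * w y := hbm.mul hw
  rw [← MeasureTheory.lintegral_const_mul _ hgm0]
  refine lintegral_le_of_circle_le hfm (hgm0.const_mul _) fun y₀ => ?_
  simp only [hwrot]
  have ham' : Measurable fun θ : ℝ => ENNReal.ofReal (a (rotZ θ y₀)) :=
    ENNReal.measurable_ofReal.comp (ha.comp (continuous_rotZ_left y₀)).measurable
  have hbm' : Measurable fun θ : ℝ => ENNReal.ofReal (b (rotZ θ y₀)) :=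
    ENNReal.measurable_ofReal.comp (hb.comp (continuous_rotZ_left y₀)).measurable
  rw [MeasureTheory.lintegral_mul_const _ ham', MeasureTheory.lintegral_const_mul _ (hbm'.mul_const _),
    MeasureTheory.lintegral_mul_const _ hbm', ← mul_assoc]
  refine mul_le_mul_left ?_ _
  have h2pi : (0 : ℝ) ≤ 2 * Real.pi := by positivity
  have hA := ofReal_intervalIntegral_eq_lintegral (a := fun θ => a (rotZ θ y₀))
    (ha.comp (continuous_rotZ_left y₀)) (fun θ => ha0 _) h2pi
  have hB := ofReal_intervalIntegral_eq_lintegral (a := fun θ => b (rotZ θ y₀))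
    (hb.comp (continuous_rotZ_left y₀)) (fun θ => hb0 _) h2pi
  rw [← hA, ← hB, ← ENNReal.ofReal_mul hc]
  exact ENNReal.ofReal_le_ofReal (h y₀)

/-- **Weighted k-fold angular Poincaré inequality on ℝ³** (PV 2026 (6.9) with the symmetry gain, in
`lintegral` form): for `C¹` k-fold equivariant `V` and any measurable rotation-invariant weight `w`,
`∫ ‖V − V_a‖² w ≤ k⁻² ∫ ‖DV[J·] − J V‖² w`. -/
theorem kfold_poincare_weighted {k : ℕ} (hk : 1 ≤ k) {V : E3 → E3} (hV : ContDiff ℝ 1 V)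
    (hsym : ∀ x, V (rotZ (2 * Real.pi / k) x) = rotZ (2 * Real.pi / k) (V x))
    {w : E3 → ENNReal} (hw : Measurable w) (hwrot : ∀ θ y, w (rotZ θ y) = w y) :
    ∫⁻ y, ENNReal.ofReal (‖V y - azimuthalMean V y‖ ^ 2) * w y
      ≤ ENNReal.ofReal (((1 : ℝ) / k) ^ 2) *
        ∫⁻ y, ENNReal.ofReal (‖fderiv ℝ V y (rotGen y) - rotGen (V y)‖ ^ 2) * w y := by
  have hVc : Continuous V := hV.continuous
  have hVac : Continuous (azimuthalMean V) := continuous_azimuthalMean hVc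
  have hLc : Continuous fun y => fderiv ℝ V y (rotGen y) - rotGen (V y) :=
    ((hV.continuous_fderiv one_ne_zero).clm_apply rotGenL.continuous).sub (rotGenL.continuous.comp hVc)
  refine lintegral_weight_le_of_circle (a := fun y => ‖V y - azimuthalMean V y‖ ^ 2)
    (b := fun y => ‖fderiv ℝ V y (rotGen y) - rotGen (V y)‖ ^ 2) (((1 : ℝ) / k) ^ 2) (by positivity)
    ((hVc.sub hVac).norm.pow 2) (hLc.norm.pow 2) hw hwrot (fun y => by positivity) (fun y => by positivity)
    fun y₀ => ?_
  have hcirc := twisted_wirtinger_kfold hk hV hsym y₀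
  simp_rw [azimuthalMean_rotZ hVc]
  exact hcirc

/-! ### Skew-adjointness of the rotation Lie derivative (PV 2026, Lemma 6.2 (ii), for every rotation-invariant
weight) — the second pillar of the αm-shift identity (6.18): `α‖RU‖² = ⟨N, RU⟩`. -/

/-- The rotation Lie derivative `L_rot V (x) = DV(x)[J x] − J V(x)` (PV's `R = −∂_θ` on cylindrical components
is `−L_rot`). -/
noncomputable def rotLie (V : E3 → E3) (x : E3) : E3 := fderiv ℝ V x (rotGen x) - rotGen (V x)

theorem inner_rotGen_skew (a b : E3) : inner ℝ (rotGen a) b + inner ℝ a (rotGen b) = 0 := by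
  have h1 : inner ℝ (rotGen a) b = a 0 * b 1 - a 1 * b 0 := inner_rotGen_left a b
  have h2 : inner ℝ a (rotGen b) = b 0 * a 1 - b 1 * a 0 := by
    rw [← inner_rotGen_left b a]; exact real_inner_comm _ _
  rw [h1, h2]; ring

/-- **Circle identity.** Along every rotation orbit, `⟨L_rot V, W⟩ + ⟨V, L_rot W⟩` is an exact derivative
(`d/dθ ⟨V(R_θ y₀), W(R_θ y₀)⟩`, the `J`-terms cancelling by skewness of `J`), so its integral over a period
vanishes. No decay or integrability hypothesis. -/
theorem rotLie_pairing_circle {V W : E3 → E3} (hV : ContDiff ℝ 1 V) (hW : ContDiff ℝ 1 W) (y₀ : E3) :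
    ∫ θ in (0 : ℝ)..2 * Real.pi, (inner ℝ (rotLie V (rotZ θ y₀)) (W (rotZ θ y₀))
      + inner ℝ (V (rotZ θ y₀)) (rotLie W (rotZ θ y₀))) = 0 := by
  have hx : Continuous fun θ : ℝ => rotZ θ y₀ := continuous_rotZ_left y₀
  have hVd : ∀ θ : ℝ, HasDerivAt (fun θ : ℝ => V (rotZ θ y₀))
      (fderiv ℝ V (rotZ θ y₀) (rotGen (rotZ θ y₀))) θ := fun θ =>
    ((hV.differentiable one_ne_zero) _).hasFDerivAt.comp_hasDerivAt θ (hasDerivAt_rotZ' y₀ θ)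
  have hWd : ∀ θ : ℝ, HasDerivAt (fun θ : ℝ => W (rotZ θ y₀))
      (fderiv ℝ W (rotZ θ y₀) (rotGen (rotZ θ y₀))) θ := fun θ =>
    ((hW.differentiable one_ne_zero) _).hasFDerivAt.comp_hasDerivAt θ (hasDerivAt_rotZ' y₀ θ)
  have hFd : ∀ θ : ℝ, HasDerivAt (fun θ : ℝ => inner ℝ (V (rotZ θ y₀)) (W (rotZ θ y₀)))
      (inner ℝ (V (rotZ θ y₀)) (fderiv ℝ W (rotZ θ y₀) (rotGen (rotZ θ y₀)))
        + inner ℝ (fderiv ℝ V (rotZ θ y₀) (rotGen (rotZ θ y₀))) (W (rotZ θ y₀))) θ :=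
    fun θ => (hVd θ).inner ℝ (hWd θ)
  have hid : ∀ θ : ℝ, inner ℝ (rotLie V (rotZ θ y₀)) (W (rotZ θ y₀))
      + inner ℝ (V (rotZ θ y₀)) (rotLie W (rotZ θ y₀))
      = inner ℝ (V (rotZ θ y₀)) (fderiv ℝ W (rotZ θ y₀) (rotGen (rotZ θ y₀)))
        + inner ℝ (fderiv ℝ V (rotZ θ y₀) (rotGen (rotZ θ y₀))) (W (rotZ θ y₀)) := by
    intro θ
    have hs := inner_rotGen_skew (V (rotZ θ y₀)) (W (rotZ θ y₀))
    simp only [rotLie, inner_sub_left, inner_sub_right]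
    linarith
  simp_rw [hid]
  have hF'c : Continuous fun θ : ℝ => inner ℝ (V (rotZ θ y₀)) (fderiv ℝ W (rotZ θ y₀) (rotGen (rotZ θ y₀)))
        + inner ℝ (fderiv ℝ V (rotZ θ y₀) (rotGen (rotZ θ y₀))) (W (rotZ θ y₀)) := by
    have hVc : Continuous fun θ : ℝ => V (rotZ θ y₀) := hV.continuous.comp hx
    have hWc : Continuous fun θ : ℝ => W (rotZ θ y₀) := hW.continuous.comp hx
    have hJ : Continuous fun θ : ℝ => rotGen (rotZ θ y₀) := rotGenL.continuous.comp hx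
    have hDV : Continuous fun θ : ℝ => fderiv ℝ V (rotZ θ y₀) (rotGen (rotZ θ y₀)) :=
      ((hV.continuous_fderiv one_ne_zero).comp hx).clm_apply hJ
    have hDW : Continuous fun θ : ℝ => fderiv ℝ W (rotZ θ y₀) (rotGen (rotZ θ y₀)) :=
      ((hW.continuous_fderiv one_ne_zero).comp hx).clm_apply hJ
    exact (hVc.inner hDW).add (hDV.inner hWc)
  rw [intervalIntegral.integral_eq_sub_of_hasDerivAt (fun θ _ => hFd θ) (hF'c.intervalIntegrable _ _)]
  have h2 : rotZ (2 * Real.pi) y₀ = y₀ := by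
    have := rotZ_add_two_pi 0 y₀; rw [zero_add, rotZ_zero] at this; exact this
  rw [h2, rotZ_zero, sub_self]

/-- **Rotation-averaging annihilator.** If an integrable `φ : ℝ³ → ℝ` has zero integral over every rotation
orbit, then `∫ φ = 0` (measure preservation of `R_θ` + Fubini). -/
theorem integral_eq_zero_of_circle_integral_eq_zero {φ : E3 → ℝ} (hφm : Measurable φ) (hint : Integrable φ)
    (hcirc : ∀ y, ∫ θ in (0 : ℝ)..2 * Real.pi, φ (rotZ θ y) = 0) : ∫ y, φ y = 0 := by
  have hemb : ∀ θ : ℝ, MeasurableEmbedding (rotZ θ : E3 → E3) := fun θ =>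
    (rotZLIE θ).toHomeomorph.measurableEmbedding
  have hrot : ∀ θ : ℝ, ∫ y, φ (rotZ θ y) = ∫ y, φ y := fun θ =>
    (measurePreserving_rotZ θ).integral_comp (hemb θ) φ
  have hmeas : Measurable (Function.uncurry fun (θ : ℝ) (y : E3) => φ (rotZ θ y)) :=
    hφm.comp measurable_rotZ_uncurry
  have hprod : Integrable (Function.uncurry fun (θ : ℝ) (y : E3) => φ (rotZ θ y))
      ((MeasureTheory.volume.restrict (Ioc (0 : ℝ) (2 * Real.pi))).prod MeasureTheory.volume) := by
    refine (MeasureTheory.integrable_prod_iff hmeas.aestronglyMeasurable).mpr ⟨?_, ?_⟩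
    · exact ae_of_all _ fun θ =>
        ((measurePreserving_rotZ θ).integrable_comp hint.aestronglyMeasurable).mpr hint
    · have hn : ∀ θ : ℝ, ∫ y, ‖φ (rotZ θ y)‖ = ∫ y, ‖φ y‖ := fun θ =>
        (measurePreserving_rotZ θ).integral_comp (hemb θ) (fun y => ‖φ y‖)
      have : (fun θ : ℝ => ∫ y, ‖(Function.uncurry fun (θ : ℝ) (y : E3) => φ (rotZ θ y)) (θ, y)‖)
          = fun _ => ∫ y, ‖φ y‖ := by
        funext θ; simp only [Function.uncurry_apply_pair]; exact hn θ
      rw [this]; exact MeasureTheory.integrable_const _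
  have h2pi : (0 : ℝ) ≤ 2 * Real.pi := by positivity
  have key : MeasureTheory.volume.real (Ioc (0 : ℝ) (2 * Real.pi)) * ∫ y, φ y = 0 := by
    calc MeasureTheory.volume.real (Ioc (0 : ℝ) (2 * Real.pi)) * ∫ y, φ y
        = ∫ θ in Ioc (0 : ℝ) (2 * Real.pi), ∫ y, φ (rotZ θ y) := by
          simp_rw [hrot]; rw [MeasureTheory.setIntegral_const, smul_eq_mul]
      _ = ∫ y, ∫ θ in Ioc (0 : ℝ) (2 * Real.pi), φ (rotZ θ y) := MeasureTheory.integral_integral_swap hprod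
      _ = ∫ y, (0 : ℝ) := by
          congr 1; funext y
          rw [← intervalIntegral.integral_of_le h2pi]; exact hcirc y
      _ = 0 := by simp
  have hS : MeasureTheory.volume.real (Ioc (0 : ℝ) (2 * Real.pi)) ≠ 0 := by
    rw [MeasureTheory.measureReal_def, Real.volume_Ioc, sub_zero, ENNReal.toReal_ofReal h2pi]; positivity
  exact (mul_eq_zero.mp key).resolve_left hS

/-- **Weighted skew-adjointness of `L_rot`** (PV 2026 Lemma 6.2 (ii), any rotation-invariant weight `w`,
e.g. the Gaussian `e^{-|y|²/4}`): `∫ (⟨L_rot V, W⟩ + ⟨V, L_rot W⟩) w = 0` for `C¹` fields, provided the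
integrand is integrable. In particular `⟨L_rot V, V⟩_{L²_w} = 0` and `⟨L_rot V, W⟩_{L²_w} = −⟨V, L_rot W⟩_{L²_w}`. -/
theorem rotLie_skewAdjoint_weighted {V W : E3 → E3} (hV : ContDiff ℝ 1 V) (hW : ContDiff ℝ 1 W)
    {w : E3 → ℝ} (hw : Measurable w) (hwrot : ∀ θ y, w (rotZ θ y) = w y)
    (hint : Integrable fun y => (inner ℝ (rotLie V y) (W y) + inner ℝ (V y) (rotLie W y)) * w y) :
    ∫ y, (inner ℝ (rotLie V y) (W y) + inner ℝ (V y) (rotLie W y)) * w y = 0 := by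
  have hVc : Continuous V := hV.continuous
  have hWc : Continuous W := hW.continuous
  have hLV : Continuous (rotLie V) :=
    ((hV.continuous_fderiv one_ne_zero).clm_apply rotGenL.continuous).sub (rotGenL.continuous.comp hVc)
  have hLW : Continuous (rotLie W) :=
    ((hW.continuous_fderiv one_ne_zero).clm_apply rotGenL.continuous).sub (rotGenL.continuous.comp hWc)
  have hpc : Continuous fun y => inner ℝ (rotLie V y) (W y) + inner ℝ (V y) (rotLie W y) :=
    (hLV.inner hWc).add (hVc.inner hLW)
  refine integral_eq_zero_of_circle_integral_eq_zero (hpc.measurable.mul hw) hint fun y => ?_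
  simp only [hwrot]
  rw [intervalIntegral.integral_mul_const, rotLie_pairing_circle hV hW y, zero_mul]

/-- Corollary: `⟨L_rot V, V⟩_{L²_w} = 0`. -/
theorem rotLie_inner_self_weighted {V : E3 → E3} (hV : ContDiff ℝ 1 V)
    {w : E3 → ℝ} (hw : Measurable w) (hwrot : ∀ θ y, w (rotZ θ y) = w y)
    (hint : Integrable fun y => inner ℝ (rotLie V y) (V y) * w y) :
    ∫ y, inner ℝ (rotLie V y) (V y) * w y = 0 := by
  have hsym : ∀ y, inner ℝ (V y) (rotLie V y) = inner ℝ (rotLie V y) (V y) := fun y => real_inner_comm _ _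
  have h2 : Integrable fun y => (inner ℝ (rotLie V y) (V y) + inner ℝ (V y) (rotLie V y)) * w y := by
    have : (fun y => (inner ℝ (rotLie V y) (V y) + inner ℝ (V y) (rotLie V y)) * w y)
        = fun y => (2 : ℝ) * (inner ℝ (rotLie V y) (V y) * w y) := by
      funext y; rw [hsym]; ring
    rw [this]; exact hint.const_mul _
  have h := rotLie_skewAdjoint_weighted hV hV hw hwrot h2
  have : (fun y => (inner ℝ (rotLie V y) (V y) + inner ℝ (V y) (rotLie V y)) * w y)
      = fun y => (2 : ℝ) * (inner ℝ (rotLie V y) (V y) * w y) := by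
    funext y; rw [hsym]; ring
  rw [this, MeasureTheory.integral_const_mul] at h
  linarith

/-! ### The commutation pillar (PV 2026, proof of Lemma 6.4, first display):
`⟨L_rot U, (−Δ + ½ y·∇) U⟩_{L²_μ} = 0` for the Gaussian weight `μ = e^{−|y|²/4} dy`.
Route (no cylindrical coordinates, no operator theory): Gaussian Green identity by coordinatewise integration by
parts on ℝ³, the commutator `∂_i (L_rot U) = L_rot (∂_i U) + DU[J e_i]`, the pointwise cancellation
`Σ_i ⟨DU[J e_i], ∂_i U⟩ = 0` (J skew), and `⟨L_rot V, V⟩_{L²_μ} = 0` applied to `V = ∂_i U`. -/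

section OU

/-- Coordinate vector `e_i`. -/
noncomputable def eI (i : Fin 3) : E3 := EuclideanSpace.single i 1

/-- Coordinate partial derivative of a vector field, `∂_i U (y) = DU(y)[e_i]`. -/
noncomputable def pd (i : Fin 3) (U : E3 → E3) (y : E3) : E3 := fderiv ℝ U y (eI i)

/-- The Gaussian weight `γ(y) = exp(−|y|²/4)` of PV 2026 §6.2. -/
noncomputable def gauss (y : E3) : ℝ := Real.exp (-(1 / 4 : ℝ) * ‖y‖ ^ 2)

/-- `A U = −ΔU + ½ DU[y]` (coordinate Laplacian). -/
noncomputable def ouOp (U : E3 → E3) (y : E3) : E3 :=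
  -(∑ i, pd i (pd i U) y) + (1 / 2 : ℝ) • fderiv ℝ U y y

theorem gauss_pos (y : E3) : 0 < gauss y := Real.exp_pos _

theorem gauss_rotZ (θ : ℝ) (y : E3) : gauss (rotZ θ y) = gauss y := by
  simp [gauss, norm_rotZ]

theorem continuous_gauss : Continuous gauss :=
  Real.continuous_exp.comp (continuous_const.mul (continuous_norm.pow 2))

theorem measurable_gauss : Measurable gauss := continuous_gauss.measurable

theorem inner_eI_right (y : E3) (i : Fin 3) : inner ℝ y (eI i) = y i := by
  simp [eI, EuclideanSpace.inner_single_right]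

theorem hasFDerivAt_gauss (y : E3) :
    HasFDerivAt gauss (Real.exp (-(1 / 4 : ℝ) * ‖y‖ ^ 2) • ((-(1 / 4 : ℝ)) • (2 • innerSL ℝ y))) y := by
  have h1 : HasFDerivAt (fun x : E3 => ‖x‖ ^ 2) (2 • innerSL ℝ y) y :=
    (hasStrictFDerivAt_norm_sq y).hasFDerivAt
  have h2 : HasFDerivAt (fun x : E3 => -(1 / 4 : ℝ) * ‖x‖ ^ 2) ((-(1 / 4 : ℝ)) • (2 • innerSL ℝ y)) y :=
    h1.const_mul _
  exact (Real.hasDerivAt_exp _).comp_hasFDerivAt y h2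

theorem fderiv_gauss_apply (y v : E3) : fderiv ℝ gauss y v = -(gauss y / 2) * inner ℝ y v := by
  rw [(hasFDerivAt_gauss y).fderiv]
  simp only [smul_apply, innerSL_apply_apply, smul_eq_mul, gauss]
  ring

theorem differentiable_gauss : Differentiable ℝ gauss := fun y => (hasFDerivAt_gauss y).differentiableAt

/-- `DU(y)[y] = Σ_i y_i ∂_i U(y)`. -/
theorem fderiv_self_eq_sum_pd (U : E3 → E3) (y : E3) : fderiv ℝ U y y = ∑ i, y i • pd i U y := by
  have hy : ∑ i, y i • eI i = y := by
    simpa [eI, EuclideanSpace.basisFun_apply, EuclideanSpace.basisFun_repr] using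
      (EuclideanSpace.basisFun (Fin 3) ℝ).sum_repr y
  calc fderiv ℝ U y y = fderiv ℝ U y (∑ i, y i • eI i) := by rw [hy]
    _ = ∑ i, y i • pd i U y := by simp [pd, map_sum, map_smul]

/-- `∂_i U` is `C¹` when `U` is `C²`. -/
theorem contDiff_pd {U : E3 → E3} (hU : ContDiff ℝ 2 U) (i : Fin 3) : ContDiff ℝ 1 (pd i U) := by
  have h : ContDiff ℝ 1 (fderiv ℝ U) := hU.fderiv_right (m := 1) (by norm_num)
  exact h.clm_apply contDiff_const

/-- `L_rot U` is `C¹` when `U` is `C²`. -/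
theorem contDiff_rotLie {U : E3 → E3} (hU : ContDiff ℝ 2 U) : ContDiff ℝ 1 (rotLie U) := by
  have h : ContDiff ℝ 1 (fderiv ℝ U) := hU.fderiv_right (m := 1) (by norm_num)
  have h1 : ContDiff ℝ 1 fun x => fderiv ℝ U x (rotGen x) := h.clm_apply rotGenL.contDiff
  have h2 : ContDiff ℝ 1 fun x => rotGen (U x) := rotGenL.contDiff.comp (hU.of_le (by norm_num))
  exact h1.sub h2

/-- **Divergence form.** `Σ_i ∂_i (γ ∂_i U) = −γ · A U`. -/
theorem sum_pd_gauss_smul_pd {U : E3 → E3} (hU : ContDiff ℝ 2 U) (y : E3) :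
    ∑ i, fderiv ℝ (fun x => gauss x • pd i U x) y (eI i) = -(gauss y) • ouOp U y := by
  have hterm : ∀ i, fderiv ℝ (fun x => gauss x • pd i U x) y (eI i)
      = gauss y • pd i (pd i U) y + (-(gauss y / 2) * y i) • pd i U y := by
    intro i
    have hp : HasFDerivAt (pd i U) (fderiv ℝ (pd i U) y) y :=
      (((contDiff_pd hU i).differentiable one_ne_zero) y).hasFDerivAt
    have h := (hasFDerivAt_gauss y).smul hp
    rw [show (fun x => gauss x • pd i U x) = gauss • pd i U from rfl, h.fderiv]
    simp only [add_apply, smul_apply,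
      ContinuousLinearMap.smulRight_apply, innerSL_apply_apply, smul_eq_mul, inner_eI_right]
    simp only [pd, gauss]
    congr 1
    ring_nf
  simp_rw [hterm]
  have h2 : ∑ i, (-(gauss y / 2) * y i) • pd i U y = (-(gauss y / 2)) • ∑ i, y i • pd i U y := by
    rw [Finset.smul_sum]
    exact Finset.sum_congr rfl fun i _ => by rw [smul_smul]
  rw [Finset.sum_add_distrib, ← Finset.smul_sum, h2, ouOp, fderiv_self_eq_sum_pd]
  module

/-- **Commutator.** `∂_i (L_rot U) = L_rot (∂_i U) + DU[J e_i]` for `C²` fields. -/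
theorem pd_rotLie {U : E3 → E3} (hU : ContDiff ℝ 2 U) (i : Fin 3) (y : E3) :
    pd i (rotLie U) y = rotLie (pd i U) y + fderiv ℝ U y (rotGen (eI i)) := by
  have hD : ContDiff ℝ 1 (fderiv ℝ U) := hU.fderiv_right (m := 1) (by norm_num)
  have hc : HasFDerivAt (fun x => fderiv ℝ U x) (fderiv ℝ (fderiv ℝ U) y) y :=
    ((hD.differentiable one_ne_zero) y).hasFDerivAt
  have hUd : HasFDerivAt U (fderiv ℝ U y) y := ((hU.differentiable (by norm_num)) y).hasFDerivAt
  have hT1 : HasFDerivAt (fun x => (fderiv ℝ U x) (rotGenL x))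
      ((fderiv ℝ U y).comp rotGenL + (fderiv ℝ (fderiv ℝ U) y).flip (rotGenL y)) y :=
    hc.clm_apply rotGenL.hasFDerivAt
  have hT2 : HasFDerivAt (fun x => rotGenL (U x)) (rotGenL.comp (fderiv ℝ U y)) y :=
    rotGenL.hasFDerivAt.comp y hUd
  have hL : HasFDerivAt (rotLie U)
      ((fderiv ℝ U y).comp rotGenL + (fderiv ℝ (fderiv ℝ U) y).flip (rotGenL y) - rotGenL.comp (fderiv ℝ U y)) y :=
    hT1.sub hT2
  have hP : HasFDerivAt (pd i U) ((fderiv ℝ U y).comp (0 : E3 →L[ℝ] E3) + (fderiv ℝ (fderiv ℝ U) y).flip (eI i)) y :=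
    hc.clm_apply (hasFDerivAt_const (eI i) y)
  have hsym : (fderiv ℝ (fderiv ℝ U) y (rotGen y)) (eI i) = (fderiv ℝ (fderiv ℝ U) y (eI i)) (rotGen y) :=
    hU.contDiffAt.isSymmSndFDerivAt (by simp) (rotGen y) (eI i)
  rw [pd, hL.fderiv, rotLie, hP.fderiv]
  simp only [sub_apply, add_apply, ContinuousLinearMap.comp_apply,
    ContinuousLinearMap.flip_apply, rotGenL_apply, zero_apply, map_zero, zero_add, hsym, pd]
  abel

/-- **Pointwise cancellation.** `Σ_i ⟨DU[J e_i], ∂_i U⟩ = 0` (J e₀ = e₁, J e₁ = −e₀, J e₂ = 0). -/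
theorem sum_inner_fderiv_rotGen_eI_pd (U : E3 → E3) (y : E3) :
    ∑ i, inner ℝ (fderiv ℝ U y (rotGen (eI i))) (pd i U y) = 0 := by
  simp only [Fin.sum_univ_three, pd, eI, rotGen_single_zero, rotGen_single_one, rotGen_single_two, map_neg,
    map_zero, inner_neg_left, inner_zero_left, add_zero]
  rw [real_inner_comm]; ring

/-- `L_rot` is orthogonal to axisymmetric fields in every rotation-invariant weighted `L²`
(PV Lemma 6.2 (ii), second identity: `⟨RV, G⟩ = ⟨RV, (G)_a⟩`). -/
theorem rotLie_of_isAxisymmetric {G : E3 → E3} (hG : IsAxisymmetric G) {x : E3} (hd : DifferentiableAt ℝ G x) :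
    rotLie G x = 0 := by
  simp [rotLie, hG.fderiv_rotGen hd]

theorem rotLie_orthogonal_axisymmetric_weighted {V G : E3 → E3} (hV : ContDiff ℝ 1 V) (hG : ContDiff ℝ 1 G)
    (hGa : IsAxisymmetric G) {w : E3 → ℝ} (hw : Measurable w) (hwrot : ∀ θ y, w (rotZ θ y) = w y)
    (hint : Integrable fun y => inner ℝ (rotLie V y) (G y) * w y) :
    ∫ y, inner ℝ (rotLie V y) (G y) * w y = 0 := by
  have hz : ∀ y, rotLie G y = 0 := fun y => rotLie_of_isAxisymmetric hGa ((hG.differentiable one_ne_zero) y)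
  have heq : (fun y => (inner ℝ (rotLie V y) (G y) + inner ℝ (V y) (rotLie G y)) * w y)
      = fun y => inner ℝ (rotLie V y) (G y) * w y := by
    funext y; simp [hz y]
  have h := rotLie_skewAdjoint_weighted hV hG hw hwrot (by rw [heq]; exact hint)
  rwa [heq] at h


/-- **Gaussian Green identity** (the form of PV Lemma 6.2 (i) used in Lemma 6.4): for `W ∈ C¹`, `U ∈ C²`,
`∫ ⟨W, A U⟩ γ = Σ_i ∫ ⟨∂_i W, ∂_i U⟩ γ`, by coordinatewise integration by parts on ℝ³ (Mathlib's
`integral_bilinear_hasLineDerivAt_right_eq_neg_left_of_integrable`), provided the three products are integrable. -/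
theorem gauss_green {W U : E3 → E3} (hW : ContDiff ℝ 1 W) (hU : ContDiff ℝ 2 U)
    (hI1 : ∀ i, Integrable fun y => inner ℝ (pd i W y) (gauss y • pd i U y))
    (hI2 : ∀ i, Integrable fun y => inner ℝ (W y) (fderiv ℝ (fun x => gauss x • pd i U x) y (eI i)))
    (hI3 : ∀ i, Integrable fun y => inner ℝ (W y) (gauss y • pd i U y)) :
    ∫ y, inner ℝ (W y) (ouOp U y) * gauss y = ∑ i, ∫ y, inner ℝ (pd i W y) (pd i U y) * gauss y := by
  have hpt : ∀ y, inner ℝ (W y) (ouOp U y) * gauss y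
      = -∑ i, inner ℝ (W y) (fderiv ℝ (fun x => gauss x • pd i U x) y (eI i)) := by
    intro y
    rw [← inner_sum, sum_pd_gauss_smul_pd hU y, inner_smul_right]
    ring
  have hGd : ∀ i, Differentiable ℝ fun x => gauss x • pd i U x := fun i =>
    differentiable_gauss.smul ((contDiff_pd hU i).differentiable one_ne_zero)
  have hIBP : ∀ i, ∫ y, inner ℝ (W y) (fderiv ℝ (fun x => gauss x • pd i U x) y (eI i))
      = -∫ y, inner ℝ (pd i W y) (gauss y • pd i U y) := by
    intro i
    have h := integral_bilinear_hasLineDerivAt_right_eq_neg_left_of_integrable (μ := MeasureTheory.volume)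
      (B := (innerSL ℝ : E3 →L[ℝ] E3 →L[ℝ] ℝ)) (f := W) (f' := pd i W) (g := fun x => gauss x • pd i U x)
      (g' := fun y => fderiv ℝ (fun x => gauss x • pd i U x) y (eI i)) (v := eI i)
      (hI1 i) (hI2 i) (hI3 i)
      (fun x _ => ((hW.differentiable one_ne_zero) x).hasFDerivAt.hasLineDerivAt (eI i))
      (fun x _ => ((hGd i) x).hasFDerivAt.hasLineDerivAt (eI i))
    exact h
  calc ∫ y, inner ℝ (W y) (ouOp U y) * gauss y
      = ∫ y, -∑ i, inner ℝ (W y) (fderiv ℝ (fun x => gauss x • pd i U x) y (eI i)) := by simp_rw [hpt]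
    _ = -∑ i, ∫ y, inner ℝ (W y) (fderiv ℝ (fun x => gauss x • pd i U x) y (eI i)) := by
        rw [MeasureTheory.integral_neg, MeasureTheory.integral_finsetSum _ (fun i _ => hI2 i)]
    _ = ∑ i, ∫ y, inner ℝ (pd i W y) (pd i U y) * gauss y := by
        rw [← Finset.sum_neg_distrib]
        refine Finset.sum_congr rfl fun i _ => ?_
        rw [hIBP i, neg_neg]
        congr 1; funext y; rw [inner_smul_right, mul_comm]

/-- **Commutation pillar** (PV 2026, proof of Lemma 6.4): for `U ∈ C²`, `∫ ⟨L_rot U, A U⟩ γ = 0` given the integrability records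
(Green with `W = L_rot U`, the commutator `∂_i L_rot U = L_rot ∂_i U + DU[J e_i]`, skewness, and `Σ_i ⟨DU[J e_i], ∂_i U⟩ = 0`). -/
theorem rotLie_orthogonal_ouOp_gauss {U : E3 → E3} (hU : ContDiff ℝ 2 U)
    (hI1 : ∀ i, Integrable fun y => inner ℝ (pd i (rotLie U) y) (gauss y • pd i U y))
    (hI2 : ∀ i, Integrable fun y => inner ℝ (rotLie U y) (fderiv ℝ (fun x => gauss x • pd i U x) y (eI i)))
    (hI3 : ∀ i, Integrable fun y => inner ℝ (rotLie U y) (gauss y • pd i U y))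
    (hI4 : ∀ i, Integrable fun y => inner ℝ (rotLie (pd i U) y) (pd i U y) * gauss y) :
    ∫ y, inner ℝ (rotLie U y) (ouOp U y) * gauss y = 0 := by
  rw [gauss_green (contDiff_rotLie hU) hU hI1 hI2 hI3]
  have ha : ∀ i, ∫ y, inner ℝ (rotLie (pd i U) y) (pd i U y) * gauss y = 0 := fun i =>
    rotLie_inner_self_weighted (contDiff_pd hU i) measurable_gauss gauss_rotZ (hI4 i)
  have htot : ∀ i, Integrable fun y => inner ℝ (pd i (rotLie U) y) (pd i U y) * gauss y := by
    intro i
    refine (hI1 i).congr (ae_of_all _ fun y => ?_)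
    simp only [inner_smul_right]; ring
  have hsplit : ∀ i y, inner ℝ (pd i (rotLie U) y) (pd i U y) * gauss y
      = inner ℝ (rotLie (pd i U) y) (pd i U y) * gauss y
        + inner ℝ (fderiv ℝ U y (rotGen (eI i))) (pd i U y) * gauss y := by
    intro i y; rw [pd_rotLie hU i y, inner_add_left]; ring
  have hb : ∀ i, Integrable fun y => inner ℝ (fderiv ℝ U y (rotGen (eI i))) (pd i U y) * gauss y := by
    intro i
    refine ((htot i).sub (hI4 i)).congr (ae_of_all _ fun y => ?_)
    simp only [Pi.sub_apply, hsplit i y]; ring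
  calc ∑ i, ∫ y, inner ℝ (pd i (rotLie U) y) (pd i U y) * gauss y
      = ∑ i, ((∫ y, inner ℝ (rotLie (pd i U) y) (pd i U y) * gauss y)
          + (∫ y, inner ℝ (fderiv ℝ U y (rotGen (eI i))) (pd i U y) * gauss y)) := by
        refine Finset.sum_congr rfl fun i _ => ?_
        rw [← MeasureTheory.integral_add (hI4 i) (hb i)]
        congr 1; funext y; exact hsplit i y
    _ = ∑ i, ∫ y, inner ℝ (fderiv ℝ U y (rotGen (eI i))) (pd i U y) * gauss y := by
        refine Finset.sum_congr rfl fun i _ => ?_; rw [ha i, zero_add]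
    _ = ∫ y, ∑ i, inner ℝ (fderiv ℝ U y (rotGen (eI i))) (pd i U y) * gauss y :=
        (MeasureTheory.integral_finsetSum _ (fun i _ => hb i)).symm
    _ = 0 := by
        have h0 : ∀ y, ∑ i, inner ℝ (fderiv ℝ U y (rotGen (eI i))) (pd i U y) * gauss y = 0 := fun y => by
          rw [← Finset.sum_mul, sum_inner_fderiv_rotGen_eI_pd, zero_mul]
        simp_rw [h0]; simp


/-- Integrability side conditions against the Gaussian (all hold for PV-class profiles, `|U| ≲ (1+|y|)⁻¹` with
bounded first and second derivatives; not derived here). -/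
structure GaussAdmissible (U : E3 → E3) : Prop where
  i1 : ∀ i, Integrable fun y => inner ℝ (pd i (rotLie U) y) (gauss y • pd i U y)
  i2 : ∀ i, Integrable fun y => inner ℝ (rotLie U y) (fderiv ℝ (fun x => gauss x • pd i U x) y (eI i))
  i3 : ∀ i, Integrable fun y => inner ℝ (rotLie U y) (gauss y • pd i U y)
  i4 : ∀ i, Integrable fun y => inner ℝ (rotLie (pd i U) y) (pd i U y) * gauss y
  i5 : Integrable fun y => inner ℝ (rotLie U y) (U y) * gauss y
  i6 : Integrable fun y => ‖rotLie U y‖ ^ 2 * gauss y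

/-- **The αm-shift identity, linear form** (PV 2026 (6.18) before Cauchy–Schwarz): for every `C²` field `U`
and every `α`, `⟨−α L_rot U + ½ U + A U, L_rot U⟩_{L²_γ} = −α ‖L_rot U‖²_{L²_γ}` — the rotation rate is seen
ONLY through the pairing with `L_rot U`; the symmetric part `½ + A` of the linearised profile operator drops out. -/
theorem alphaMShift_linear_identity {U : E3 → E3} (hU : ContDiff ℝ 2 U) (hA : GaussAdmissible U) (α : ℝ) :
    ∫ y, inner ℝ (-α • rotLie U y + (1 / 2 : ℝ) • U y + ouOp U y) (rotLie U y) * gauss y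
      = -α * ∫ y, ‖rotLie U y‖ ^ 2 * gauss y := by
  have ha : ∫ y, inner ℝ (rotLie U y) (U y) * gauss y = 0 :=
    rotLie_inner_self_weighted (hU.of_le (by norm_num)) measurable_gauss gauss_rotZ hA.i5
  have hb : ∫ y, inner ℝ (rotLie U y) (ouOp U y) * gauss y = 0 :=
    rotLie_orthogonal_ouOp_gauss hU hA.i1 hA.i2 hA.i3 hA.i4
  have hbI : Integrable fun y => inner ℝ (rotLie U y) (ouOp U y) * gauss y := by
    have h := (MeasureTheory.integrable_finsetSum Finset.univ (fun i _ => hA.i2 i)).neg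
    refine h.congr (ae_of_all _ fun y => ?_)
    simp only [Pi.neg_apply]
    rw [← inner_sum, sum_pd_gauss_smul_pd hU y, inner_smul_right]
    ring
  have hpt : ∀ y, inner ℝ (-α • rotLie U y + (1 / 2 : ℝ) • U y + ouOp U y) (rotLie U y) * gauss y
      = -α * (‖rotLie U y‖ ^ 2 * gauss y) + (1 / 2 : ℝ) * (inner ℝ (rotLie U y) (U y) * gauss y)
        + inner ℝ (rotLie U y) (ouOp U y) * gauss y := by
    intro y
    rw [inner_add_left, inner_add_left, inner_smul_left, inner_smul_left,
      real_inner_self_eq_norm_sq, real_inner_comm (U y), real_inner_comm (ouOp U y)]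
    simp only [conj_trivial]
    ring
  simp_rw [hpt]
  have hI6 : Integrable fun y => -α * (‖rotLie U y‖ ^ 2 * gauss y) := hA.i6.const_mul _
  have hI5 : Integrable fun y => (1 / 2 : ℝ) * (inner ℝ (rotLie U y) (U y) * gauss y) := hA.i5.const_mul _
  have hstep1 : ∫ y, (-α * (‖rotLie U y‖ ^ 2 * gauss y) + (1 / 2 : ℝ) * (inner ℝ (rotLie U y) (U y) * gauss y)
      + inner ℝ (rotLie U y) (ouOp U y) * gauss y)
      = (∫ y, (-α * (‖rotLie U y‖ ^ 2 * gauss y) + (1 / 2 : ℝ) * (inner ℝ (rotLie U y) (U y) * gauss y)))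
        + ∫ y, inner ℝ (rotLie U y) (ouOp U y) * gauss y :=
    MeasureTheory.integral_add (hI6.add hI5) hbI
  have hstep2 : ∫ y, (-α * (‖rotLie U y‖ ^ 2 * gauss y) + (1 / 2 : ℝ) * (inner ℝ (rotLie U y) (U y) * gauss y))
      = (∫ y, -α * (‖rotLie U y‖ ^ 2 * gauss y)) + ∫ y, (1 / 2 : ℝ) * (inner ℝ (rotLie U y) (U y) * gauss y) :=
    MeasureTheory.integral_add hI6 hI5
  rw [hstep1, hstep2, MeasureTheory.integral_const_mul, MeasureTheory.integral_const_mul, ha, hb]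
  ring

/-- **The αm-shift identity for profiles** (PV 2026 (6.18)): if `U ∈ C²` solves `−α L_rot U + ½ U + (−Δ + ½ y·∇) U = N`, then
`α ‖L_rot U‖²_{L²_γ} = −⟨N, L_rot U⟩_{L²_γ}`. -/
theorem alphaMShift_identity_of_profile {U N : E3 → E3} (hU : ContDiff ℝ 2 U) (hA : GaussAdmissible U) {α : ℝ}
    (hEq : ∀ y, -α • rotLie U y + (1 / 2 : ℝ) • U y + ouOp U y = N y) :
    α * ∫ y, ‖rotLie U y‖ ^ 2 * gauss y = -∫ y, inner ℝ (N y) (rotLie U y) * gauss y := by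
  have h := alphaMShift_linear_identity hU hA α
  simp_rw [hEq] at h
  linarith

end OU

/-! ### Calculus of the azimuthal projection: `V ∈ C¹ ⇒ V_a ∈ C¹`, with the derivative obtained by
differentiating under the integral (the regularity input of PV Lemma 6.1 / (6.19)). -/

section AzimuthalMeanCalculus

/-- The vertical projection `w ↦ w₂ e₂` as a CLM. -/
noncomputable def vertProjL : E3 →L[ℝ] E3 :=
  (PiLp.proj 2 (fun _ : Fin 3 => ℝ) (2 : Fin 3)).smulRight (EuclideanSpace.single (2 : Fin 3) (1 : ℝ))

@[simp] theorem vertProjL_apply (w : E3) : vertProjL w = (w 2) • EuclideanSpace.single (2 : Fin 3) (1 : ℝ) := rfl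

/-- `R_θ = cos θ · (1 − E) + sin θ · J + E` as continuous linear maps. -/
theorem rotZL_eq_decomp (θ : ℝ) :
    rotZL θ = Real.cos θ • (ContinuousLinearMap.id ℝ E3 - vertProjL) + Real.sin θ • rotGenL + vertProjL := by
  ext1 w
  simp only [rotZL_apply, add_apply, smul_apply,
    sub_apply, ContinuousLinearMap.id_apply, vertProjL_apply, rotGenL_apply]
  exact rotZ_eq_smul_decomp θ w

/-- Operator-norm continuity of `θ ↦ R_θ`. -/
theorem continuous_rotZL : Continuous fun θ : ℝ => rotZL θ := by
  have : (fun θ : ℝ => rotZL θ) = fun θ =>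
      Real.cos θ • (ContinuousLinearMap.id ℝ E3 - vertProjL) + Real.sin θ • rotGenL + vertProjL :=
    funext rotZL_eq_decomp
  rw [this]
  exact ((Real.continuous_cos.smul continuous_const).add (Real.continuous_sin.smul continuous_const)).add
    continuous_const

theorem norm_rotZL_le (θ : ℝ) : ‖rotZL θ‖ ≤ 1 :=
  ContinuousLinearMap.opNorm_le_bound _ zero_le_one fun x => by
    rw [one_mul, rotZL_apply, norm_rotZ]

/-- The integrand of the derivative of the azimuthal mean: `R_{−θ} ∘ DV(R_θ y) ∘ R_θ`. -/
noncomputable def azDer (V : E3 → E3) (y : E3) (θ : ℝ) : E3 →L[ℝ] E3 :=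
  (rotZL (-θ)).comp ((fderiv ℝ V (rotZ θ y)).comp (rotZL θ))

theorem continuous_azDer_uncurry {V : E3 → E3} (hV : ContDiff ℝ 1 V) :
    Continuous (Function.uncurry (azDer V)) := by
  have hDc : Continuous (fderiv ℝ V) := hV.continuous_fderiv one_ne_zero
  have h1 : Continuous fun p : E3 × ℝ => rotZL (-p.2) := continuous_rotZL.comp continuous_snd.neg
  have h2 : Continuous fun p : E3 × ℝ => fderiv ℝ V (rotZ p.2 p.1) :=
    hDc.comp (continuous_rotZ_comp continuous_snd continuous_fst)
  have h3 : Continuous fun p : E3 × ℝ => rotZL p.2 := continuous_rotZL.comp continuous_snd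
  exact h1.clm_comp (h2.clm_comp h3)

theorem continuous_azDer {V : E3 → E3} (hV : ContDiff ℝ 1 V) (y : E3) : Continuous (azDer V y) :=
  (continuous_azDer_uncurry hV).uncurry_left y

theorem norm_azDer_le {V : E3 → E3} (y : E3) (θ : ℝ) : ‖azDer V y θ‖ ≤ ‖fderiv ℝ V (rotZ θ y)‖ := by
  unfold azDer
  calc ‖(rotZL (-θ)).comp ((fderiv ℝ V (rotZ θ y)).comp (rotZL θ))‖
      ≤ ‖rotZL (-θ)‖ * ‖(fderiv ℝ V (rotZ θ y)).comp (rotZL θ)‖ := ContinuousLinearMap.opNorm_comp_le _ _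
    _ ≤ ‖rotZL (-θ)‖ * (‖fderiv ℝ V (rotZ θ y)‖ * ‖rotZL θ‖) := by
        gcongr; exact ContinuousLinearMap.opNorm_comp_le _ _
    _ ≤ 1 * (‖fderiv ℝ V (rotZ θ y)‖ * 1) := by
        gcongr
        · exact norm_rotZL_le _
        · exact norm_rotZL_le _
    _ = ‖fderiv ℝ V (rotZ θ y)‖ := by ring

/-- **Differentiation under the azimuthal integral.** For `V ∈ C¹`,
`D(V_a)(y₀) = (2π)⁻¹ ∫₀^{2π} R_{−θ} ∘ DV(R_θ y₀) ∘ R_θ dθ`. -/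
theorem hasFDerivAt_azimuthalMean {V : E3 → E3} (hV : ContDiff ℝ 1 V) (y₀ : E3) :
    HasFDerivAt (azimuthalMean V)
      ((1 / (2 * Real.pi)) • ∫ θ in (0 : ℝ)..2 * Real.pi, azDer V y₀ θ) y₀ := by
  have hVd : Differentiable ℝ V := hV.differentiable one_ne_zero
  have hVc : Continuous V := hV.continuous
  have hDc : Continuous (fderiv ℝ V) := hV.continuous_fderiv one_ne_zero
  obtain ⟨M, hM⟩ := (isCompact_closedBall (0 : E3) (‖y₀‖ + 1)).exists_bound_of_continuousOn hDc.continuousOn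
  have key : HasFDerivAt (fun x => ∫ θ in (0 : ℝ)..2 * Real.pi, rotZ (-θ) (V (rotZ θ x)))
      (∫ θ in (0 : ℝ)..2 * Real.pi, azDer V y₀ θ) y₀ := by
    refine intervalIntegral.hasFDerivAt_integral_of_dominated_of_fderiv_le
      (F := fun x θ => rotZ (-θ) (V (rotZ θ x))) (F' := fun x θ => azDer V x θ)
      (bound := fun _ => M) (Metric.ball_mem_nhds y₀ zero_lt_one) ?_ ?_ ?_ ?_ ?_ ?_
    · exact Filter.Eventually.of_forall fun x => (continuous_pullback hVc x).aestronglyMeasurable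
    · exact (continuous_pullback hVc y₀).intervalIntegrable _ _
    · exact (continuous_azDer hV y₀).aestronglyMeasurable
    · refine ae_of_all _ fun θ _ x hx => ?_
      refine (norm_azDer_le x θ).trans (hM _ ?_)
      rw [Metric.mem_closedBall, dist_zero_right, norm_rotZ]
      have hx' : dist x y₀ < 1 := hx
      rw [dist_eq_norm] at hx'
      calc ‖x‖ = ‖(x - y₀) + y₀‖ := by rw [sub_add_cancel]
        _ ≤ ‖x - y₀‖ + ‖y₀‖ := norm_add_le _ _
        _ ≤ ‖y₀‖ + 1 := by linarith
    · exact intervalIntegrable_const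
    · refine ae_of_all _ fun θ _ x _ => ?_
      have h := (rotZL (-θ)).hasFDerivAt.comp x (((hVd (rotZ θ x)).hasFDerivAt).comp x (rotZL θ).hasFDerivAt)
      exact h
  exact key.const_smul (1 / (2 * Real.pi))

theorem differentiable_azimuthalMean {V : E3 → E3} (hV : ContDiff ℝ 1 V) : Differentiable ℝ (azimuthalMean V) :=
  fun y => (hasFDerivAt_azimuthalMean hV y).differentiableAt

/-- **`V ∈ C¹ ⇒ V_a ∈ C¹`.** -/
theorem contDiff_one_azimuthalMean {V : E3 → E3} (hV : ContDiff ℝ 1 V) : ContDiff ℝ 1 (azimuthalMean V) := by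
  refine contDiff_one_iff_hasFDerivAt.mpr ⟨fun y => (1 / (2 * Real.pi)) • ∫ θ in (0 : ℝ)..2 * Real.pi, azDer V y θ,
    ?_, fun y => hasFDerivAt_azimuthalMean hV y⟩
  have hI : Continuous fun y : E3 => ∫ θ in (0 : ℝ)..2 * Real.pi, azDer V y θ :=
    intervalIntegral.continuous_parametric_intervalIntegral_of_continuous' (continuous_azDer_uncurry hV) 0
      (2 * Real.pi)
  exact hI.const_smul (1 / (2 * Real.pi) : ℝ)

/-- `L_rot (V_a) = 0`: the azimuthal mean is infinitesimally axisymmetric. -/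
theorem rotLie_azimuthalMean {V : E3 → E3} (hV : ContDiff ℝ 1 V) (y : E3) : rotLie (azimuthalMean V) y = 0 :=
  rotLie_of_isAxisymmetric (isAxisymmetric_azimuthalMean hV.continuous) (differentiable_azimuthalMean hV y)

/-- **PV Lemma 6.2 (ii), second identity, unconditionally in the fields:** for `V, W ∈ C¹` and any rotation-
invariant weight, `⟨L_rot V, W_a⟩_{L²_w} = 0`, i.e. `⟨L_rot V, W⟩_{L²_w} = ⟨L_rot V, W − W_a⟩_{L²_w}`. -/
theorem rotLie_orthogonal_azimuthalMean_weighted {V W : E3 → E3} (hV : ContDiff ℝ 1 V) (hW : ContDiff ℝ 1 W)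
    {w : E3 → ℝ} (hw : Measurable w) (hwrot : ∀ θ y, w (rotZ θ y) = w y)
    (hint : Integrable fun y => inner ℝ (rotLie V y) (azimuthalMean W y) * w y) :
    ∫ y, inner ℝ (rotLie V y) (azimuthalMean W y) * w y = 0 :=
  rotLie_orthogonal_axisymmetric_weighted hV (contDiff_one_azimuthalMean hW)
    (isAxisymmetric_azimuthalMean hW.continuous) hw hwrot hint


/-! #### Orthogonality of axisymmetric fields and azimuthal fluctuations (PV Lemma 6.2 (iii)). -/

theorem inner_rotZ_rotZ (θ : ℝ) (a b : E3) : inner ℝ (rotZ θ a) (rotZ θ b) = inner ℝ a b := by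
  have h := (rotZLIE θ).inner_map_map a b
  simpa using h

theorem inner_rotZ_left (θ : ℝ) (a b : E3) : inner ℝ (rotZ θ a) b = inner ℝ a (rotZ (-θ) b) := by
  conv_lhs => rw [← rotZ_rotZ_neg θ b]
  exact inner_rotZ_rotZ θ a (rotZ (-θ) b)

theorem intervalIntegral_pullback_eq (W : E3 → E3) (y : E3) :
    ∫ θ in (0 : ℝ)..2 * Real.pi, rotZ (-θ) (W (rotZ θ y)) = (2 * Real.pi) • azimuthalMean W y := by
  unfold azimuthalMean
  rw [smul_smul, mul_one_div_cancel (by positivity : (2 * Real.pi : ℝ) ≠ 0), one_smul]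

/-- **Circle orthogonality.** For axisymmetric continuous `G` and continuous `W`, on every rotation orbit
`∫₀^{2π} ⟨G, W − W_a⟩(R_θ y) dθ = 0`. -/
theorem circle_inner_axisymmetric_fluctuation {G W : E3 → E3} (hGa : IsAxisymmetric G) (hW : Continuous W)
    (y : E3) :
    ∫ θ in (0 : ℝ)..2 * Real.pi, inner ℝ (G (rotZ θ y)) (W (rotZ θ y) - azimuthalMean W (rotZ θ y)) = 0 := by
  have hpt : ∀ θ : ℝ, inner ℝ (G (rotZ θ y)) (W (rotZ θ y) - azimuthalMean W (rotZ θ y))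
      = inner ℝ (G y) (rotZ (-θ) (W (rotZ θ y)) - azimuthalMean W y) := by
    intro θ
    rw [hGa θ y, azimuthalMean_rotZ hW, inner_rotZ_left, rotZ_sub_vec, rotZ_neg_rotZ]
  simp_rw [hpt]
  have hHc : Continuous fun θ : ℝ => rotZ (-θ) (W (rotZ θ y)) := continuous_pullback hW y
  have hHi : IntervalIntegrable (fun θ : ℝ => rotZ (-θ) (W (rotZ θ y)) - azimuthalMean W y)
      MeasureTheory.volume 0 (2 * Real.pi) := (hHc.sub continuous_const).intervalIntegrable _ _
  have h1 : ∫ θ in (0 : ℝ)..2 * Real.pi, inner ℝ (G y) (rotZ (-θ) (W (rotZ θ y)) - azimuthalMean W y)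
      = inner ℝ (G y) (∫ θ in (0 : ℝ)..2 * Real.pi, (rotZ (-θ) (W (rotZ θ y)) - azimuthalMean W y)) := by
    have := ((innerSL ℝ (G y) : E3 →L[ℝ] ℝ)).intervalIntegral_comp_comm hHi
    simpa [innerSL_apply_apply] using this
  rw [h1, intervalIntegral.integral_sub (hHc.intervalIntegrable _ _) intervalIntegrable_const,
    intervalIntegral_pullback_eq, intervalIntegral.integral_const, sub_zero]
  simp

/-- **PV Lemma 6.2 (iii):** axisymmetric fields are orthogonal to azimuthal fluctuations in every rotation-
invariant weighted `L²`: `⟨G, W − W_a⟩_{L²_w} = 0`. -/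
theorem axisymmetric_orthogonal_fluctuation_weighted {G W : E3 → E3} (hG : Continuous G) (hGa : IsAxisymmetric G)
    (hW : Continuous W) {w : E3 → ℝ} (hw : Measurable w) (hwrot : ∀ θ y, w (rotZ θ y) = w y)
    (hint : Integrable fun y => inner ℝ (G y) (W y - azimuthalMean W y) * w y) :
    ∫ y, inner ℝ (G y) (W y - azimuthalMean W y) * w y = 0 := by
  have hWa : Continuous (azimuthalMean W) := continuous_azimuthalMean hW
  have hm : Measurable fun y => inner ℝ (G y) (W y - azimuthalMean W y) * w y :=
    ((hG.inner (hW.sub hWa)).measurable).mul hw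
  refine integral_eq_zero_of_circle_integral_eq_zero hm hint fun y => ?_
  simp only [hwrot]
  rw [intervalIntegral.integral_mul_const, circle_inner_axisymmetric_fluctuation hGa hW y, zero_mul]

/-- **Weighted Pythagoras** `‖W‖²_{L²_w} = ‖W_a‖²_{L²_w} + ‖W − W_a‖²_{L²_w}` (PV Lemma 6.2 (iii)); in particular
`‖W − W_a‖_{L²_w} ≤ ‖W‖_{L²_w}` and `‖W_a‖_{L²_w} ≤ ‖W‖_{L²_w}`. -/
theorem weighted_pythagoras_azimuthal {W : E3 → E3} (hW : Continuous W) {w : E3 → ℝ} (hw : Measurable w)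
    (hwrot : ∀ θ y, w (rotZ θ y) = w y)
    (ia : Integrable fun y => ‖azimuthalMean W y‖ ^ 2 * w y)
    (ifl : Integrable fun y => ‖W y - azimuthalMean W y‖ ^ 2 * w y)
    (ix : Integrable fun y => inner ℝ (azimuthalMean W y) (W y - azimuthalMean W y) * w y) :
    ∫ y, ‖W y‖ ^ 2 * w y = (∫ y, ‖azimuthalMean W y‖ ^ 2 * w y) + ∫ y, ‖W y - azimuthalMean W y‖ ^ 2 * w y := by
  have hWa : Continuous (azimuthalMean W) := continuous_azimuthalMean hW
  have hx : ∫ y, inner ℝ (azimuthalMean W y) (W y - azimuthalMean W y) * w y = 0 :=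
    axisymmetric_orthogonal_fluctuation_weighted hWa (isAxisymmetric_azimuthalMean hW) hW hw hwrot ix
  have hpt : ∀ y, ‖W y‖ ^ 2 * w y = ‖azimuthalMean W y‖ ^ 2 * w y
      + (2 : ℝ) * (inner ℝ (azimuthalMean W y) (W y - azimuthalMean W y) * w y)
      + ‖W y - azimuthalMean W y‖ ^ 2 * w y := by
    intro y
    have : W y = azimuthalMean W y + (W y - azimuthalMean W y) := by abel
    conv_lhs => rw [this]
    rw [norm_add_sq_real]
    ring
  simp_rw [hpt]
  have ix2 : Integrable fun y => (2 : ℝ) * (inner ℝ (azimuthalMean W y) (W y - azimuthalMean W y) * w y) :=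
    ix.const_mul _
  have hs1 : ∫ y, (‖azimuthalMean W y‖ ^ 2 * w y
      + (2 : ℝ) * (inner ℝ (azimuthalMean W y) (W y - azimuthalMean W y) * w y)
      + ‖W y - azimuthalMean W y‖ ^ 2 * w y)
      = (∫ y, (‖azimuthalMean W y‖ ^ 2 * w y
          + (2 : ℝ) * (inner ℝ (azimuthalMean W y) (W y - azimuthalMean W y) * w y)))
        + ∫ y, ‖W y - azimuthalMean W y‖ ^ 2 * w y := MeasureTheory.integral_add (ia.add ix2) ifl
  have hs2 : ∫ y, (‖azimuthalMean W y‖ ^ 2 * w y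
      + (2 : ℝ) * (inner ℝ (azimuthalMean W y) (W y - azimuthalMean W y) * w y))
      = (∫ y, ‖azimuthalMean W y‖ ^ 2 * w y)
        + ∫ y, (2 : ℝ) * (inner ℝ (azimuthalMean W y) (W y - azimuthalMean W y) * w y) :=
    MeasureTheory.integral_add ia ix2
  rw [hs1, hs2, MeasureTheory.integral_const_mul, hx, mul_zero, add_zero]

end AzimuthalMeanCalculus

/-! ### PV (6.19): the energy identity for the azimuthal fluctuation `U_n = U − ⟨U⟩_θ`.

Notation: PV write `⟨V⟩_θ` for the azimuthal mean (our `azimuthalMean V`) and `(V)_a` for the fluctuation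
`V − ⟨V⟩_θ` (our `azFluct V`). -/

section PV619

/-- The azimuthal fluctuation `(U)_a = U − ⟨U⟩_θ` of PV. -/
noncomputable def azFluct (U : E3 → E3) : E3 → E3 := fun y => U y - azimuthalMean U y

theorem azFluct_apply (U : E3 → E3) (y : E3) : azFluct U y = U y - azimuthalMean U y := rfl

theorem rotZ_eI_zero (θ : ℝ) : rotZ θ (eI 0) = Real.cos θ • eI 0 + Real.sin θ • eI 1 := by
  ext i; fin_cases i <;> simp [eI]

theorem rotZ_eI_one (θ : ℝ) : rotZ θ (eI 1) = -(Real.sin θ) • eI 0 + Real.cos θ • eI 1 := by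
  ext i; fin_cases i <;> simp [eI]

theorem rotZ_eI_two (θ : ℝ) : rotZ θ (eI 2) = eI 2 := by
  ext i; fin_cases i <;> simp [eI]

/-- Invariance of the Hilbert–Schmidt pairing `Σ_i ⟨A e_i, B e_i⟩` under the rotated basis `R_θ e_i`. -/
theorem hs_sum_rotZ (A B : E3 →L[ℝ] E3) (θ : ℝ) :
    ∑ i, inner ℝ (A (rotZ θ (eI i))) (B (rotZ θ (eI i))) = ∑ i, inner ℝ (A (eI i)) (B (eI i)) := by
  simp only [Fin.sum_univ_three]
  rw [rotZ_eI_zero, rotZ_eI_one, rotZ_eI_two]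
  simp only [map_add, map_smul, inner_add_left, inner_add_right, real_inner_smul_left,
    real_inner_smul_right]
  have hcs := Real.cos_sq_add_sin_sq θ
  linear_combination (inner ℝ (A (eI 0)) (B (eI 0)) + inner ℝ (A (eI 1)) (B (eI 1))) * hcs

theorem inner_rotZ_right (θ : ℝ) (a b : E3) : inner ℝ a (rotZ θ b) = inner ℝ (rotZ (-θ) a) b := by
  rw [inner_rotZ_left, neg_neg]

/-- The derivative of an axisymmetric field is rotation-equivariant: `DF(R_θ y)[R_θ v] = R_θ DF(y)[v]`. -/
theorem fderiv_rotZ_of_isAxisymmetric {F : E3 → E3} (hFa : IsAxisymmetric F) (hFd : Differentiable ℝ F)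
    (θ : ℝ) (y v : E3) : fderiv ℝ F (rotZ θ y) (rotZ θ v) = rotZ θ (fderiv ℝ F y v) := by
  have h1 : HasFDerivAt (fun x => F (rotZ θ x)) ((fderiv ℝ F (rotZ θ y)).comp (rotZL θ)) y :=
    ((hFd (rotZ θ y)).hasFDerivAt).comp y (rotZL θ).hasFDerivAt
  have h2 : HasFDerivAt (fun x => rotZ θ (F x)) ((rotZL θ).comp (fderiv ℝ F y)) y :=
    (rotZL θ).hasFDerivAt.comp y (hFd y).hasFDerivAt
  have hfun : (fun x => F (rotZ θ x)) = fun x => rotZ θ (F x) := funext fun x => hFa θ x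
  rw [hfun] at h1
  have h := congrArg (fun T : E3 →L[ℝ] E3 => T v) (h1.unique h2)
  simpa using h

/-- Pointwise Hilbert–Schmidt identity on a rotation orbit: for axisymmetric `F`,
`Σ_i ⟨∂_i G, ∂_i F⟩(R_θ y) = Σ_i ⟨(R_{−θ} ∘ DG(R_θ y) ∘ R_θ) e_i, DF(y) e_i⟩`. -/
theorem hs_pd_rotZ {F G : E3 → E3} (hFa : IsAxisymmetric F) (hFd : Differentiable ℝ F) (θ : ℝ) (y : E3) :
    ∑ i, inner ℝ (pd i G (rotZ θ y)) (pd i F (rotZ θ y))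
      = ∑ i, inner ℝ (azDer G y θ (eI i)) (fderiv ℝ F y (eI i)) := by
  have key : ∀ u : E3, inner ℝ (fderiv ℝ G (rotZ θ y) (rotZ θ u)) (fderiv ℝ F (rotZ θ y) (rotZ θ u))
      = inner ℝ (azDer G y θ u) (fderiv ℝ F y u) := by
    intro u
    rw [fderiv_rotZ_of_isAxisymmetric hFa hFd θ y u, inner_rotZ_right]
    simp [azDer]
  have h2 : ∀ i, pd i G (rotZ θ y) = fderiv ℝ G (rotZ θ y) (rotZ θ (rotZ (-θ) (eI i))) := fun i => by
    rw [rotZ_rotZ_neg]; rfl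
  have h3 : ∀ i, pd i F (rotZ θ y) = fderiv ℝ F (rotZ θ y) (rotZ θ (rotZ (-θ) (eI i))) := fun i => by
    rw [rotZ_rotZ_neg]; rfl
  simp_rw [h2, h3, key]
  exact hs_sum_rotZ (azDer G y θ) (fderiv ℝ F y) (-θ)

theorem azimuthalMean_sub {V W : E3 → E3} (hV : Continuous V) (hW : Continuous W) (y : E3) :
    azimuthalMean (fun x => V x - W x) y = azimuthalMean V y - azimuthalMean W y := by
  unfold azimuthalMean
  simp_rw [rotZ_sub_vec]
  rw [intervalIntegral.integral_sub ((continuous_pullback hV y).intervalIntegrable _ _)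
    ((continuous_pullback hW y).intervalIntegrable _ _), smul_sub]

/-- `⟨(U)_a⟩_θ = 0`: the fluctuation has vanishing azimuthal mean. -/
theorem azimuthalMean_azFluct {U : E3 → E3} (hU : Continuous U) (y : E3) : azimuthalMean (azFluct U) y = 0 := by
  unfold azFluct
  rw [azimuthalMean_sub hU (continuous_azimuthalMean hU),
    azimuthalMean_of_isAxisymmetric (isAxisymmetric_azimuthalMean hU), sub_self]

theorem contDiff_one_azFluct {U : E3 → E3} (hU : ContDiff ℝ 1 U) : ContDiff ℝ 1 (azFluct U) :=
  hU.sub (contDiff_one_azimuthalMean hU)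

/-- A mean-zero `C¹` field has `∫₀^{2π} R_{−θ} ∘ DG(R_θ y) ∘ R_θ dθ = 0`. -/
theorem intervalIntegral_azDer_eq_zero {G : E3 → E3} (hG : ContDiff ℝ 1 G) (hG0 : ∀ y, azimuthalMean G y = 0)
    (y : E3) : ∫ θ in (0 : ℝ)..2 * Real.pi, azDer G y θ = 0 := by
  have h1 := hasFDerivAt_azimuthalMean hG y
  have h0 : HasFDerivAt (azimuthalMean G) (0 : E3 →L[ℝ] E3) y := by
    have : azimuthalMean G = fun _ => 0 := funext hG0
    rw [this]; exact hasFDerivAt_const 0 y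
  have h := h1.unique h0
  have hpi : (1 / (2 * Real.pi) : ℝ) ≠ 0 := by positivity
  ext v i
  have hv := congrArg (fun S : E3 →L[ℝ] E3 => S v i) h
  simp only [FunLike.coe_smul, Pi.smul_apply, zero_apply,
    PiLp.zero_apply, PiLp.smul_apply, smul_eq_mul, mul_eq_zero, hpi, false_or] at hv
  simpa using hv

/-- **Hilbert–Schmidt orthogonality** `Σ_i ⟨∂_i G, ∂_i F⟩_{L²_w} = 0` for `F` axisymmetric `C¹`, `G` mean-zero `C¹`
and any rotation-invariant weight: the gradient of the mean and the gradient of the fluctuation are orthogonal,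
although `∂_i` does not commute with rotations. -/
theorem hs_orthogonal_weighted {F G : E3 → E3} (hF : ContDiff ℝ 1 F) (hFa : IsAxisymmetric F)
    (hG : ContDiff ℝ 1 G) (hG0 : ∀ y, azimuthalMean G y = 0) {w : E3 → ℝ} (hw : Measurable w)
    (hwrot : ∀ θ y, w (rotZ θ y) = w y)
    (hint : Integrable fun y => (∑ i, inner ℝ (pd i G y) (pd i F y)) * w y) :
    ∫ y, (∑ i, inner ℝ (pd i G y) (pd i F y)) * w y = 0 := by
  have hFd : Differentiable ℝ F := hF.differentiable one_ne_zero
  have hcF : ∀ i, Continuous (pd i F) := fun i =>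
    (hF.continuous_fderiv one_ne_zero).clm_apply continuous_const
  have hcG : ∀ i, Continuous (pd i G) := fun i =>
    (hG.continuous_fderiv one_ne_zero).clm_apply continuous_const
  have hm : Measurable fun y => (∑ i, inner ℝ (pd i G y) (pd i F y)) * w y :=
    (continuous_finsetSum _ fun i _ => (hcG i).inner (hcF i)).measurable.mul hw
  refine integral_eq_zero_of_circle_integral_eq_zero hm hint fun y => ?_
  simp only [hwrot]
  rw [intervalIntegral.integral_mul_const]
  simp_rw [hs_pd_rotZ hFa hFd]
  have hcont : ∀ i, Continuous fun θ : ℝ => azDer G y θ (eI i) := fun i =>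
    (continuous_azDer hG y).clm_apply continuous_const
  have hii : ∀ i ∈ (Finset.univ : Finset (Fin 3)), IntervalIntegrable
      (fun θ : ℝ => inner ℝ (azDer G y θ (eI i)) (fderiv ℝ F y (eI i))) MeasureTheory.volume 0 (2 * Real.pi) :=
    fun i _ => ((hcont i).inner continuous_const).intervalIntegrable _ _
  rw [intervalIntegral.integral_finsetSum hii]
  have hi : ∀ i, ∫ θ in (0 : ℝ)..2 * Real.pi, inner ℝ (azDer G y θ (eI i)) (fderiv ℝ F y (eI i))
      = inner ℝ ((∫ θ in (0 : ℝ)..2 * Real.pi, azDer G y θ) (eI i)) (fderiv ℝ F y (eI i)) := by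
    intro i
    have h := ((innerSL ℝ (fderiv ℝ F y (eI i))).intervalIntegral_comp_comm
      ((hcont i).intervalIntegrable (μ := MeasureTheory.volume) 0 (2 * Real.pi)))
    simp only [innerSL_apply_apply] at h
    rw [ContinuousLinearMap.intervalIntegral_apply
      ((continuous_azDer hG y).intervalIntegrable (μ := MeasureTheory.volume) 0 (2 * Real.pi)) (eI i),
      real_inner_comm, ← h]
    exact intervalIntegral.integral_congr fun θ _ => real_inner_comm _ _
  rw [Finset.sum_congr rfl fun i _ => hi i, intervalIntegral_azDer_eq_zero hG hG0 y]
  simp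

/-- Integrability side conditions for the (6.19) pairing (true for PV-class profiles; carried, not derived). -/
structure FluctAdmissible (U N : E3 → E3) : Prop where
  j1 : Integrable fun y => inner ℝ (rotLie U y) (U y) * gauss y
  j2 : Integrable fun y => inner ℝ (rotLie U y) (azimuthalMean U y) * gauss y
  j3 : Integrable fun y => inner ℝ (azimuthalMean U y) (U y - azimuthalMean U y) * gauss y
  j4 : Integrable fun y => ‖azFluct U y‖ ^ 2 * gauss y
  a1 : Integrable fun y => inner ℝ (ouOp U y) (azFluct U y) * gauss y
  g1 : ∀ i, Integrable fun y => inner ℝ (pd i (azFluct U) y) (gauss y • pd i U y)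
  g2 : ∀ i, Integrable fun y => inner ℝ (azFluct U y) (fderiv ℝ (fun x => gauss x • pd i U x) y (eI i))
  g3 : ∀ i, Integrable fun y => inner ℝ (azFluct U y) (gauss y • pd i U y)
  h1 : ∀ i, Integrable fun y => inner ℝ (pd i (azFluct U) y) (pd i (azimuthalMean U) y) * gauss y
  h2 : ∀ i, Integrable fun y => ‖pd i (azFluct U) y‖ ^ 2 * gauss y

/-- **PV (6.19), the identity:** for a `C²` solution of `−α L_rot U + ½U + (−Δ + ½ y·∇)U = N`,
`½‖(U)_a‖²_{L²_γ} + ‖∇(U)_a‖²_{L²_γ} = ⟨N, (U)_a⟩_{L²_γ}` (pair the equation with `(U)_a`; Lemma 6.2 (ii)–(iv)). -/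
theorem pv619_identity {U : E3 → E3} (hU : ContDiff ℝ 2 U) {α : ℝ} {N : E3 → E3}
    (hEq : ∀ y, -α • rotLie U y + (1 / 2 : ℝ) • U y + ouOp U y = N y) (hA : FluctAdmissible U N) :
    (1 / 2 : ℝ) * (∫ y, ‖azFluct U y‖ ^ 2 * gauss y) + ∑ i, ∫ y, ‖pd i (azFluct U) y‖ ^ 2 * gauss y
      = ∫ y, inner ℝ (N y) (azFluct U y) * gauss y := by
  have hU1 : ContDiff ℝ 1 U := hU.of_le one_le_two
  have hUc : Continuous U := hU.continuous
  have hUd : Differentiable ℝ U := hU1.differentiable one_ne_zero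
  have hUa1 : ContDiff ℝ 1 (azimuthalMean U) := contDiff_one_azimuthalMean hU1
  have hUad : Differentiable ℝ (azimuthalMean U) := hUa1.differentiable one_ne_zero
  have hUn1 : ContDiff ℝ 1 (azFluct U) := contDiff_one_azFluct hU1
  have hL : ∫ y, inner ℝ (rotLie U y) (azFluct U y) * gauss y = 0 := by
    have hpt : ∀ y, inner ℝ (rotLie U y) (azFluct U y) * gauss y
        = inner ℝ (rotLie U y) (U y) * gauss y - inner ℝ (rotLie U y) (azimuthalMean U y) * gauss y := by
      intro y; rw [azFluct_apply, inner_sub_right]; ring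
    simp_rw [hpt]
    rw [MeasureTheory.integral_sub hA.j1 hA.j2, rotLie_inner_self_weighted hU1 measurable_gauss gauss_rotZ hA.j1,
      rotLie_orthogonal_azimuthalMean_weighted hU1 hU1 measurable_gauss gauss_rotZ hA.j2, sub_zero]
  have hH : ∫ y, inner ℝ (U y) (azFluct U y) * gauss y = ∫ y, ‖azFluct U y‖ ^ 2 * gauss y := by
    have hpt : ∀ y, inner ℝ (U y) (azFluct U y) * gauss y
        = inner ℝ (azimuthalMean U y) (U y - azimuthalMean U y) * gauss y + ‖azFluct U y‖ ^ 2 * gauss y := by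
      intro y
      have hsplit : U y = azimuthalMean U y + azFluct U y := by rw [azFluct_apply, add_sub_cancel]
      conv_lhs => rw [hsplit]
      rw [inner_add_left, real_inner_self_eq_norm_sq, azFluct_apply]; ring
    simp_rw [hpt]
    rw [MeasureTheory.integral_add hA.j3 hA.j4,
      axisymmetric_orthogonal_fluctuation_weighted (continuous_azimuthalMean hUc) (isAxisymmetric_azimuthalMean hUc)
        hUc measurable_gauss gauss_rotZ hA.j3, zero_add]
  have hAterm : ∫ y, inner ℝ (ouOp U y) (azFluct U y) * gauss y = ∑ i, ∫ y, ‖pd i (azFluct U) y‖ ^ 2 * gauss y := by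
    have hcomm : ∫ y, inner ℝ (ouOp U y) (azFluct U y) * gauss y = ∫ y, inner ℝ (azFluct U y) (ouOp U y) * gauss y :=
      integral_congr_ae (ae_of_all _ fun y => by beta_reduce; rw [real_inner_comm])
    rw [hcomm, gauss_green hUn1 hU hA.g1 hA.g2 hA.g3]
    have hpd : ∀ i y, pd i U y = pd i (azimuthalMean U) y + pd i (azFluct U) y := by
      intro i y
      have hf : fderiv ℝ (azFluct U) y = fderiv ℝ U y - fderiv ℝ (azimuthalMean U) y :=
        ((hUd y).hasFDerivAt.sub (hUad y).hasFDerivAt).fderiv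
      simp only [pd, hf, sub_apply]
      abel
    have hper : ∀ i, ∫ y, inner ℝ (pd i (azFluct U) y) (pd i U y) * gauss y
        = (∫ y, inner ℝ (pd i (azFluct U) y) (pd i (azimuthalMean U) y) * gauss y)
          + ∫ y, ‖pd i (azFluct U) y‖ ^ 2 * gauss y := by
      intro i
      have hpt : ∀ y, inner ℝ (pd i (azFluct U) y) (pd i U y) * gauss y
          = inner ℝ (pd i (azFluct U) y) (pd i (azimuthalMean U) y) * gauss y + ‖pd i (azFluct U) y‖ ^ 2 * gauss y := by
        intro y; rw [hpd i y, inner_add_right, real_inner_self_eq_norm_sq]; ring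
      simp_rw [hpt]
      exact MeasureTheory.integral_add (hA.h1 i) (hA.h2 i)
    rw [Finset.sum_congr rfl fun i _ => hper i, Finset.sum_add_distrib]
    have hcross : ∑ i, ∫ y, inner ℝ (pd i (azFluct U) y) (pd i (azimuthalMean U) y) * gauss y = 0 := by
      rw [← MeasureTheory.integral_finsetSum _ (fun i _ => hA.h1 i)]
      have hint : Integrable fun y => (∑ i, inner ℝ (pd i (azFluct U) y) (pd i (azimuthalMean U) y)) * gauss y := by
        refine (MeasureTheory.integrable_finsetSum Finset.univ fun i _ => hA.h1 i).congr (ae_of_all _ fun y => ?_)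
        simp only [Finset.sum_mul]
      have h := hs_orthogonal_weighted hUa1 (isAxisymmetric_azimuthalMean hUc) hUn1 (azimuthalMean_azFluct hUc)
        measurable_gauss gauss_rotZ hint
      simpa [Finset.sum_mul] using h
    rw [hcross, zero_add]
  have hN : ∫ y, inner ℝ (N y) (azFluct U y) * gauss y
      = ∫ y, (-α * (inner ℝ (rotLie U y) (azFluct U y) * gauss y)
          + (1 / 2 : ℝ) * (inner ℝ (U y) (azFluct U y) * gauss y)
          + inner ℝ (ouOp U y) (azFluct U y) * gauss y) := by
    refine integral_congr_ae (ae_of_all _ fun y => ?_)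
    beta_reduce
    rw [← hEq y]
    simp only [inner_add_left, real_inner_smul_left, inner_neg_left, neg_smul]
    ring
  have iL : Integrable fun y => inner ℝ (rotLie U y) (azFluct U y) * gauss y := by
    refine (hA.j1.sub hA.j2).congr (ae_of_all _ fun y => ?_)
    simp only [Pi.sub_apply, azFluct_apply, inner_sub_right]; ring
  have iH : Integrable fun y => inner ℝ (U y) (azFluct U y) * gauss y := by
    refine (hA.j3.add hA.j4).congr (ae_of_all _ fun y => ?_)
    have hsplit : U y = azimuthalMean U y + azFluct U y := by rw [azFluct_apply, add_sub_cancel]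
    simp only [Pi.add_apply]
    conv_rhs => rw [hsplit]
    rw [inner_add_left, real_inner_self_eq_norm_sq, azFluct_apply]
    ring
  have iAB : Integrable fun y => -α * (inner ℝ (rotLie U y) (azFluct U y) * gauss y)
      + (1 / 2 : ℝ) * (inner ℝ (U y) (azFluct U y) * gauss y) := (iL.const_mul _).add (iH.const_mul _)
  have hs1 : ∫ y, (-α * (inner ℝ (rotLie U y) (azFluct U y) * gauss y)
          + (1 / 2 : ℝ) * (inner ℝ (U y) (azFluct U y) * gauss y)
          + inner ℝ (ouOp U y) (azFluct U y) * gauss y)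
      = (∫ y, (-α * (inner ℝ (rotLie U y) (azFluct U y) * gauss y)
          + (1 / 2 : ℝ) * (inner ℝ (U y) (azFluct U y) * gauss y)))
        + ∫ y, inner ℝ (ouOp U y) (azFluct U y) * gauss y := MeasureTheory.integral_add iAB hA.a1
  have hs2 : ∫ y, (-α * (inner ℝ (rotLie U y) (azFluct U y) * gauss y)
          + (1 / 2 : ℝ) * (inner ℝ (U y) (azFluct U y) * gauss y))
      = (∫ y, -α * (inner ℝ (rotLie U y) (azFluct U y) * gauss y))
        + ∫ y, (1 / 2 : ℝ) * (inner ℝ (U y) (azFluct U y) * gauss y) :=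
    MeasureTheory.integral_add (iL.const_mul _) (iH.const_mul _)
  rw [hN, hs1, hs2, MeasureTheory.integral_const_mul, MeasureTheory.integral_const_mul, hL, hH, hAterm]
  ring


/-- **(6.18) against the fluctuation of `N` only:** `α‖L_rot U‖²_γ = −⟨(N)_a, L_rot U⟩_γ`
(PV: `|α|‖RU‖² = sgn(α)⟨RU, (N)_a⟩`), by `⟨L_rot U, ⟨N⟩_θ⟩_γ = 0`. -/
theorem alphaMShift_identity_fluct {U N : E3 → E3} (hU : ContDiff ℝ 2 U) (hA : GaussAdmissible U)
    (hN : ContDiff ℝ 1 N) {α : ℝ} (hEq : ∀ y, -α • rotLie U y + (1 / 2 : ℝ) • U y + ouOp U y = N y)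
    (iNa : Integrable fun y => inner ℝ (rotLie U y) (azimuthalMean N y) * gauss y)
    (iNn : Integrable fun y => inner ℝ (azFluct N y) (rotLie U y) * gauss y) :
    α * ∫ y, ‖rotLie U y‖ ^ 2 * gauss y = -∫ y, inner ℝ (azFluct N y) (rotLie U y) * gauss y := by
  have hU1 : ContDiff ℝ 1 U := hU.of_le one_le_two
  rw [alphaMShift_identity_of_profile hU hA hEq]
  congr 1
  have hpt : ∀ y, inner ℝ (N y) (rotLie U y) * gauss y
      = inner ℝ (rotLie U y) (azimuthalMean N y) * gauss y + inner ℝ (azFluct N y) (rotLie U y) * gauss y := by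
    intro y
    have hsplit : N y = azimuthalMean N y + azFluct N y := by rw [azFluct_apply, add_sub_cancel]
    conv_lhs => rw [hsplit]
    rw [inner_add_left, real_inner_comm (rotLie U y)]
    ring
  simp_rw [hpt]
  rw [MeasureTheory.integral_add iNa iNn, rotLie_orthogonal_azimuthalMean_weighted hU1 hN measurable_gauss
    gauss_rotZ iNa, zero_add]

/-- **(6.19) against the fluctuation of `N` only:** `½‖(U)_a‖²_γ + ‖∇(U)_a‖²_γ = ⟨(N)_a, (U)_a⟩_γ`,
by Lemma 6.2 (iii). Together with `alphaMShift_identity_fluct`, Cauchy–Schwarz and `kfold_poincare_weighted`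
this is PV Lemma 6.4 / (6.17) with the constant improved by the fold number `k`. -/
theorem pv619_identity_fluct {U N : E3 → E3} (hU : ContDiff ℝ 2 U) (hNc : Continuous N) {α : ℝ}
    (hEq : ∀ y, -α • rotLie U y + (1 / 2 : ℝ) • U y + ouOp U y = N y) (hA : FluctAdmissible U N)
    (iNa : Integrable fun y => inner ℝ (azimuthalMean N y) (U y - azimuthalMean U y) * gauss y)
    (iNn : Integrable fun y => inner ℝ (azFluct N y) (azFluct U y) * gauss y) :
    (1 / 2 : ℝ) * (∫ y, ‖azFluct U y‖ ^ 2 * gauss y) + ∑ i, ∫ y, ‖pd i (azFluct U) y‖ ^ 2 * gauss y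
      = ∫ y, inner ℝ (azFluct N y) (azFluct U y) * gauss y := by
  have hUc : Continuous U := hU.continuous
  rw [pv619_identity hU hEq hA]
  have hpt : ∀ y, inner ℝ (N y) (azFluct U y) * gauss y
      = inner ℝ (azimuthalMean N y) (U y - azimuthalMean U y) * gauss y
        + inner ℝ (azFluct N y) (azFluct U y) * gauss y := by
    intro y
    have hsplit : N y = azimuthalMean N y + azFluct N y := by rw [azFluct_apply, add_sub_cancel]
    conv_lhs => rw [hsplit]
    rw [inner_add_left, azFluct_apply U]
    ring
  simp_rw [hpt]
  rw [MeasureTheory.integral_add iNa iNn, axisymmetric_orthogonal_fluctuation_weighted (continuous_azimuthalMean hNc)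
    (isAxisymmetric_azimuthalMean hNc) hUc measurable_gauss gauss_rotZ iNa, zero_add]


/-! #### Cauchy–Schwarz in weighted `L²` and PV Lemma 6.4 with the fold number. -/

/-- Weighted Cauchy–Schwarz `|⟨f, g⟩_{L²_w}| ≤ ‖f‖_{L²_w} ‖g‖_{L²_w}`. -/
theorem weighted_cauchy_schwarz {f g : E3 → E3} (hf : Continuous f) (hg : Continuous g) {w : E3 → ℝ}
    (hwm : Measurable w) (hw0 : ∀ y, 0 ≤ w y)
    (iF : Integrable fun y => ‖f y‖ ^ 2 * w y) (iG : Integrable fun y => ‖g y‖ ^ 2 * w y) :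
    |∫ y, inner ℝ (f y) (g y) * w y|
      ≤ Real.sqrt (∫ y, ‖f y‖ ^ 2 * w y) * Real.sqrt (∫ y, ‖g y‖ ^ 2 * w y) := by
  have hnF : ∀ y, ‖Real.sqrt (w y) • f y‖ = Real.sqrt (w y) * ‖f y‖ := fun y => by
    rw [norm_smul, Real.norm_of_nonneg (Real.sqrt_nonneg _)]
  have hnG : ∀ y, ‖Real.sqrt (w y) • g y‖ = Real.sqrt (w y) * ‖g y‖ := fun y => by
    rw [norm_smul, Real.norm_of_nonneg (Real.sqrt_nonneg _)]
  have hsqF : ∀ y, ‖Real.sqrt (w y) • f y‖ ^ 2 = ‖f y‖ ^ 2 * w y := fun y => by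
    rw [hnF, mul_pow, Real.sq_sqrt (hw0 y)]; ring
  have hsqG : ∀ y, ‖Real.sqrt (w y) • g y‖ ^ 2 = ‖g y‖ ^ 2 * w y := fun y => by
    rw [hnG, mul_pow, Real.sq_sqrt (hw0 y)]; ring
  have hprod : ∀ y, ‖Real.sqrt (w y) • f y‖ * ‖Real.sqrt (w y) • g y‖ = ‖f y‖ * ‖g y‖ * w y := fun y => by
    rw [hnF, hnG]
    have := Real.mul_self_sqrt (hw0 y)
    calc Real.sqrt (w y) * ‖f y‖ * (Real.sqrt (w y) * ‖g y‖)
        = ‖f y‖ * ‖g y‖ * (Real.sqrt (w y) * Real.sqrt (w y)) := by ring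
      _ = ‖f y‖ * ‖g y‖ * w y := by rw [this]
  have hmF : AEStronglyMeasurable (fun y => Real.sqrt (w y) • f y) MeasureTheory.volume :=
    (hwm.sqrt.smul hf.measurable).aestronglyMeasurable
  have hmG : AEStronglyMeasurable (fun y => Real.sqrt (w y) • g y) MeasureTheory.volume :=
    (hwm.sqrt.smul hg.measurable).aestronglyMeasurable
  have hpF : MemLp (fun y => Real.sqrt (w y) • f y) (ENNReal.ofReal 2) MeasureTheory.volume := by
    rw [ENNReal.ofReal_ofNat]
    refine (memLp_two_iff_integrable_sq_norm hmF).mpr ?_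
    simp_rw [hsqF]; exact iF
  have hpG : MemLp (fun y => Real.sqrt (w y) • g y) (ENNReal.ofReal 2) MeasureTheory.volume := by
    rw [ENNReal.ofReal_ofNat]
    refine (memLp_two_iff_integrable_sq_norm hmG).mpr ?_
    simp_rw [hsqG]; exact iG
  have hH := integral_mul_norm_le_Lp_mul_Lq (μ := MeasureTheory.volume) Real.HolderConjugate.two_two hpF hpG
  simp_rw [Real.rpow_two, hsqF, hsqG, ← Real.sqrt_eq_rpow, hprod] at hH
  have hInt : Integrable fun y => ‖f y‖ * ‖g y‖ * w y := by
    refine ((iF.add iG).div_const 2).mono' (((hf.norm.mul hg.norm).measurable.mul hwm).aestronglyMeasurable)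
      (ae_of_all _ fun y => ?_)
    rw [Real.norm_of_nonneg (by have := hw0 y; positivity)]
    have h2 : 2 * ‖f y‖ * ‖g y‖ ≤ ‖f y‖ ^ 2 + ‖g y‖ ^ 2 := two_mul_le_add_sq _ _
    have := hw0 y
    simp only [Pi.add_apply]
    nlinarith
  calc |∫ y, inner ℝ (f y) (g y) * w y|
      ≤ ∫ y, |inner ℝ (f y) (g y) * w y| := MeasureTheory.abs_integral_le_integral_abs
    _ ≤ ∫ y, ‖f y‖ * ‖g y‖ * w y := by
        refine integral_mono_of_nonneg (ae_of_all _ fun y => abs_nonneg _) hInt (ae_of_all _ fun y => ?_)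
        beta_reduce
        rw [abs_mul, abs_of_nonneg (hw0 y)]
        exact mul_le_mul_of_nonneg_right (abs_real_inner_le_norm _ _) (hw0 y)
    _ ≤ _ := hH

/-- Real form of `kfold_poincare_weighted` with the Gaussian weight: `‖(U)_a‖²_γ ≤ k⁻² ‖L_rot U‖²_γ`. -/
theorem kfold_poincare_gauss {k : ℕ} (hk : 1 ≤ k) {U : E3 → E3} (hU : ContDiff ℝ 1 U)
    (hsym : ∀ x, U (rotZ (2 * Real.pi / k) x) = rotZ (2 * Real.pi / k) (U x))
    (iB : Integrable fun y => ‖azFluct U y‖ ^ 2 * gauss y) (iA : Integrable fun y => ‖rotLie U y‖ ^ 2 * gauss y) :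
    ∫ y, ‖azFluct U y‖ ^ 2 * gauss y ≤ ((1 : ℝ) / k) ^ 2 * ∫ y, ‖rotLie U y‖ ^ 2 * gauss y := by
  have h := kfold_poincare_weighted hk hU hsym (w := fun y => ENNReal.ofReal (gauss y))
    (measurable_gauss.ennreal_ofReal) (fun θ y => by simp only [gauss_rotZ])
  have hL : ∫⁻ y, ENNReal.ofReal (‖U y - azimuthalMean U y‖ ^ 2) * ENNReal.ofReal (gauss y)
      = ENNReal.ofReal (∫ y, ‖azFluct U y‖ ^ 2 * gauss y) := by
    rw [MeasureTheory.ofReal_integral_eq_lintegral_ofReal iB (ae_of_all _ fun y => by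
      have := (gauss_pos y).le; positivity)]
    refine lintegral_congr fun y => ?_
    rw [← ENNReal.ofReal_mul (sq_nonneg _), azFluct_apply]
  have hR : ∫⁻ y, ENNReal.ofReal (‖fderiv ℝ U y (rotGen y) - rotGen (U y)‖ ^ 2) * ENNReal.ofReal (gauss y)
      = ENNReal.ofReal (∫ y, ‖rotLie U y‖ ^ 2 * gauss y) := by
    rw [MeasureTheory.ofReal_integral_eq_lintegral_ofReal iA (ae_of_all _ fun y => by
      have := (gauss_pos y).le; positivity)]
    refine lintegral_congr fun y => ?_
    rw [← ENNReal.ofReal_mul (sq_nonneg _)]; rfl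
  rw [hL, hR, ← ENNReal.ofReal_mul (sq_nonneg _)] at h
  exact (ENNReal.ofReal_le_ofReal_iff (by
    have : 0 ≤ ∫ y, ‖rotLie U y‖ ^ 2 * gauss y :=
      integral_nonneg fun y => by have := (gauss_pos y).le; positivity
    positivity)).mp h

/-- **PV Lemma 6.4 with the fold number, `(6.17)_k`:** for a `k`-fold symmetric `C²` solution (pairings admissible),
`|α| ‖L_rot U‖²_γ + ½‖(U)_a‖²_γ + ‖∇(U)_a‖²_γ ≤ (1 + 1/k) ‖(N)_a‖_γ ‖L_rot U‖_γ` (PV: constant 3 at k = 1). -/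
theorem pv_lemma64_kfold {k : ℕ} (hk : 1 ≤ k) {U N : E3 → E3} (hU : ContDiff ℝ 2 U) (hN : ContDiff ℝ 1 N)
    (hsym : ∀ x, U (rotZ (2 * Real.pi / k) x) = rotZ (2 * Real.pi / k) (U x)) {α : ℝ}
    (hEq : ∀ y, -α • rotLie U y + (1 / 2 : ℝ) • U y + ouOp U y = N y)
    (hA : GaussAdmissible U) (hB : FluctAdmissible U N)
    (iNa : Integrable fun y => inner ℝ (rotLie U y) (azimuthalMean N y) * gauss y)
    (iNn : Integrable fun y => inner ℝ (azFluct N y) (rotLie U y) * gauss y)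
    (iNa' : Integrable fun y => inner ℝ (azimuthalMean N y) (U y - azimuthalMean U y) * gauss y)
    (iNn' : Integrable fun y => inner ℝ (azFluct N y) (azFluct U y) * gauss y)
    (iM : Integrable fun y => ‖azFluct N y‖ ^ 2 * gauss y) :
    |α| * (∫ y, ‖rotLie U y‖ ^ 2 * gauss y) + (1 / 2 : ℝ) * (∫ y, ‖azFluct U y‖ ^ 2 * gauss y)
        + ∑ i, ∫ y, ‖pd i (azFluct U) y‖ ^ 2 * gauss y
      ≤ (1 + (1 : ℝ) / k) * Real.sqrt (∫ y, ‖azFluct N y‖ ^ 2 * gauss y)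
          * Real.sqrt (∫ y, ‖rotLie U y‖ ^ 2 * gauss y) := by
  have hU1 : ContDiff ℝ 1 U := hU.of_le one_le_two
  have hUc : Continuous U := hU.continuous
  have hNc : Continuous N := hN.continuous
  have hLc : Continuous (rotLie U) := (contDiff_rotLie hU).continuous
  have hNnc : Continuous (azFluct N) := hNc.sub (continuous_azimuthalMean hNc)
  have hUnc : Continuous (azFluct U) := hUc.sub (continuous_azimuthalMean hUc)
  have g0 : ∀ y, 0 ≤ gauss y := fun y => (gauss_pos y).le
  have hApos : 0 ≤ ∫ y, ‖rotLie U y‖ ^ 2 * gauss y :=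
    integral_nonneg fun y => by have := g0 y; positivity
  have h18 := alphaMShift_identity_fluct hU hA hN hEq iNa iNn
  have h19 := pv619_identity_fluct hU hNc hEq hB iNa' iNn'
  have cs1 := weighted_cauchy_schwarz hNnc hLc measurable_gauss g0 iM hA.i6
  have cs2 := weighted_cauchy_schwarz hNnc hUnc measurable_gauss g0 iM hB.j4
  have hP := kfold_poincare_gauss hk hU1 hsym hB.j4 hA.i6
  have hkpos : (0 : ℝ) < k := by exact_mod_cast hk
  have hsqrtB : Real.sqrt (∫ y, ‖azFluct U y‖ ^ 2 * gauss y)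
      ≤ (1 / k) * Real.sqrt (∫ y, ‖rotLie U y‖ ^ 2 * gauss y) := by
    have h1 := Real.sqrt_le_sqrt hP
    rwa [Real.sqrt_mul (sq_nonneg _), Real.sqrt_sq (by positivity)] at h1
  have e1 : |α| * (∫ y, ‖rotLie U y‖ ^ 2 * gauss y)
      ≤ Real.sqrt (∫ y, ‖azFluct N y‖ ^ 2 * gauss y) * Real.sqrt (∫ y, ‖rotLie U y‖ ^ 2 * gauss y) := by
    have : |α| * (∫ y, ‖rotLie U y‖ ^ 2 * gauss y) = |∫ y, inner ℝ (azFluct N y) (rotLie U y) * gauss y| := by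
      rw [← abs_of_nonneg hApos, ← abs_mul, h18, abs_neg]
    rw [this]; exact cs1
  have e2 : (1 / 2 : ℝ) * (∫ y, ‖azFluct U y‖ ^ 2 * gauss y) + ∑ i, ∫ y, ‖pd i (azFluct U) y‖ ^ 2 * gauss y
      ≤ Real.sqrt (∫ y, ‖azFluct N y‖ ^ 2 * gauss y) * Real.sqrt (∫ y, ‖azFluct U y‖ ^ 2 * gauss y) := by
    rw [h19]; exact (le_abs_self _).trans cs2
  have hM0 : 0 ≤ Real.sqrt (∫ y, ‖azFluct N y‖ ^ 2 * gauss y) := Real.sqrt_nonneg _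
  have e3 := mul_le_mul_of_nonneg_left hsqrtB hM0
  nlinarith [e1, e2, e3]

end PV619


/-! ### PV Proposition 6.5 with the fold number: the ε-bookkeeping (pure algebra) and its instantiation.
With `a = ‖L_rot U‖_γ`, `b = ‖(U)_a‖_γ`, `c = ‖∇(U)_a‖_γ`, `x = ‖(N)_a‖_γ`: (6.18) `|α| a² ≤ x a`, (6.19) `½ b² + c² ≤ x b`,
k-fold Poincaré `b ≤ a / k`, and Lemma 6.3 / (6.11) `x ≤ ε + C_ε b + C_ε c` give `(|α| − (2C_ε + C_ε²)/k) a ≤ 2ε`; hence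
`|α| a ≤ 4ε` as soon as `k|α| ≥ 2(2C_ε + C_ε²)` — the threshold of PV Prop. 6.5 divided by `k` (RUNG K(k) of the αm-shift idea,
conditional on (6.11)). -/

section Prop65

/-- The real-number bookkeeping behind PV Prop. 6.5, with the fold number `k`. -/
theorem prop65_algebra {α a b c x ε C k : ℝ} (ha : 0 ≤ a) (hx : 0 ≤ x) (hC : 0 ≤ C) (hk : 0 < k)
    (h18 : |α| * a ^ 2 ≤ x * a) (h19 : (1 / 2 : ℝ) * b ^ 2 + c ^ 2 ≤ x * b) (hP : b ≤ a / k)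
    (h611 : x ≤ ε + C * b + C * c) : (|α| - (2 * C + C ^ 2) / k) * a ≤ 2 * ε := by
  have hc2 : c ^ 2 ≤ x * (a / k) := by nlinarith [sq_nonneg b]
  have hak : 0 ≤ a / k := div_nonneg ha hk.le
  have hCc : 2 * (C * c) ≤ x + C ^ 2 * (a / k) := by
    by_contra hlt
    rw [not_le] at hlt
    have h1 : (x + C ^ 2 * (a / k)) ^ 2 < (2 * (C * c)) ^ 2 := by
      have h0 : 0 ≤ x + C ^ 2 * (a / k) := by positivity
      exact pow_lt_pow_left₀ hlt h0 two_ne_zero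
    have h2 : (2 * (C * c)) ^ 2 ≤ 4 * C ^ 2 * (x * (a / k)) := by nlinarith [sq_nonneg C]
    have h3 : 4 * (x * (C ^ 2 * (a / k))) ≤ (x + C ^ 2 * (a / k)) ^ 2 := by
      nlinarith [sq_nonneg (x - C ^ 2 * (a / k))]
    nlinarith
  have hxb : x ≤ 2 * ε + (2 * C + C ^ 2) * (a / k) := by
    have := mul_le_mul_of_nonneg_left hP hC
    nlinarith
  have hαa : |α| * a ≤ x := by
    rcases ha.eq_or_lt with h0 | hpos
    · rw [← h0, mul_zero]; exact hx
    · exact le_of_mul_le_mul_right (by nlinarith) hpos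
  have : (2 * C + C ^ 2) / k * a = (2 * C + C ^ 2) * (a / k) := by ring
  rw [sub_mul, this]
  linarith

/-- Corollary: above the threshold `2(2C_ε + C_ε²)/k` one has `|α| a ≤ 4ε`. -/
theorem prop65_algebra_threshold {α a b c x ε C k : ℝ} (ha : 0 ≤ a) (hx : 0 ≤ x) (hC : 0 ≤ C) (hk : 0 < k)
    (h18 : |α| * a ^ 2 ≤ x * a) (h19 : (1 / 2 : ℝ) * b ^ 2 + c ^ 2 ≤ x * b)
    (hP : b ≤ a / k) (h611 : x ≤ ε + C * b + C * c) (hα : 2 * (2 * C + C ^ 2) / k ≤ |α|) :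
    |α| * a ≤ 4 * ε := by
  have h := prop65_algebra ha hx hC hk h18 h19 hP h611
  have h1 : (2 * C + C ^ 2) / k * a ≤ (|α| / 2) * a := by
    refine mul_le_mul_of_nonneg_right ?_ ha
    have : (2 * C + C ^ 2) / k = (2 * (2 * C + C ^ 2) / k) / 2 := by ring
    rw [this]; linarith
  nlinarith

/-- **PV Proposition 6.5 with the fold number (conditional on (6.11)):** for a `k`-fold symmetric `C²` solution of
`−α L_rot U + ½U + (−Δ + ½y·∇)U = N` with `‖(N)_a‖_γ ≤ ε + C_ε (‖(U)_a‖_γ + ‖∇(U)_a‖_γ)`: `k|α| ≥ 2(2C_ε + C_ε²) ⇒ |α| ‖L_rot U‖_γ ≤ 4ε`. -/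
theorem pv_prop65_kfold {k : ℕ} (hk : 1 ≤ k) {U N : E3 → E3} (hU : ContDiff ℝ 2 U) (hN : ContDiff ℝ 1 N)
    (hsym : ∀ x, U (rotZ (2 * Real.pi / k) x) = rotZ (2 * Real.pi / k) (U x)) {α : ℝ}
    (hEq : ∀ y, -α • rotLie U y + (1 / 2 : ℝ) • U y + ouOp U y = N y)
    (hA : GaussAdmissible U) (hB : FluctAdmissible U N)
    (iNa : Integrable fun y => inner ℝ (rotLie U y) (azimuthalMean N y) * gauss y)
    (iNn : Integrable fun y => inner ℝ (azFluct N y) (rotLie U y) * gauss y)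
    (iNa' : Integrable fun y => inner ℝ (azimuthalMean N y) (U y - azimuthalMean U y) * gauss y)
    (iNn' : Integrable fun y => inner ℝ (azFluct N y) (azFluct U y) * gauss y)
    (iM : Integrable fun y => ‖azFluct N y‖ ^ 2 * gauss y) {ε C : ℝ} (hC : 0 ≤ C)
    (h611 : Real.sqrt (∫ y, ‖azFluct N y‖ ^ 2 * gauss y)
      ≤ ε + C * Real.sqrt (∫ y, ‖azFluct U y‖ ^ 2 * gauss y)
          + C * Real.sqrt (∑ i, ∫ y, ‖pd i (azFluct U) y‖ ^ 2 * gauss y))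
    (hα : 2 * (2 * C + C ^ 2) / k ≤ |α|) :
    |α| * Real.sqrt (∫ y, ‖rotLie U y‖ ^ 2 * gauss y) ≤ 4 * ε := by
  have hU1 : ContDiff ℝ 1 U := hU.of_le one_le_two
  have hUc : Continuous U := hU.continuous
  have hNc : Continuous N := hN.continuous
  have hLc : Continuous (rotLie U) := (contDiff_rotLie hU).continuous
  have hNnc : Continuous (azFluct N) := hNc.sub (continuous_azimuthalMean hNc)
  have hUnc : Continuous (azFluct U) := hUc.sub (continuous_azimuthalMean hUc)
  have g0 : ∀ y, 0 ≤ gauss y := fun y => (gauss_pos y).le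
  set A := ∫ y, ‖rotLie U y‖ ^ 2 * gauss y with hAdef
  set B := ∫ y, ‖azFluct U y‖ ^ 2 * gauss y with hBdef
  set C' := ∑ i, ∫ y, ‖pd i (azFluct U) y‖ ^ 2 * gauss y with hC'def
  set M := ∫ y, ‖azFluct N y‖ ^ 2 * gauss y with hMdef
  have hA0 : 0 ≤ A := integral_nonneg fun y => by have := g0 y; positivity
  have hB0 : 0 ≤ B := integral_nonneg fun y => by have := g0 y; positivity
  have hC'0 : 0 ≤ C' := Finset.sum_nonneg fun i _ => integral_nonneg fun y => by have := g0 y; positivity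
  have hM0 : 0 ≤ M := integral_nonneg fun y => by have := g0 y; positivity
  have h18 := alphaMShift_identity_fluct hU hA hN hEq iNa iNn
  have h19 := pv619_identity_fluct hU hNc hEq hB iNa' iNn'
  have cs1 := weighted_cauchy_schwarz hNnc hLc measurable_gauss g0 iM hA.i6
  have cs2 := weighted_cauchy_schwarz hNnc hUnc measurable_gauss g0 iM hB.j4
  have hP := kfold_poincare_gauss hk hU1 hsym hB.j4 hA.i6
  have hkpos : (0 : ℝ) < k := by exact_mod_cast hk
  have ea : Real.sqrt A ^ 2 = A := Real.sq_sqrt hA0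
  have eb : Real.sqrt B ^ 2 = B := Real.sq_sqrt hB0
  have ec : Real.sqrt C' ^ 2 = C' := Real.sq_sqrt hC'0
  have hPb : Real.sqrt B ≤ Real.sqrt A / k := by
    have h1 := Real.sqrt_le_sqrt hP
    rw [Real.sqrt_mul (sq_nonneg _), Real.sqrt_sq (by positivity)] at h1
    rw [le_div_iff₀ hkpos]
    calc Real.sqrt B * k = k * Real.sqrt B := mul_comm _ _
      _ ≤ k * (1 / k * Real.sqrt A) := mul_le_mul_of_nonneg_left h1 hkpos.le
      _ = Real.sqrt A := by field_simp
  have e1 : |α| * Real.sqrt A ^ 2 ≤ Real.sqrt M * Real.sqrt A := by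
    rw [ea]
    have : |α| * A = |∫ y, inner ℝ (azFluct N y) (rotLie U y) * gauss y| := by
      rw [← abs_of_nonneg hA0, ← abs_mul, h18, abs_neg]
    rw [this]; exact cs1
  have e2 : (1 / 2 : ℝ) * Real.sqrt B ^ 2 + Real.sqrt C' ^ 2 ≤ Real.sqrt M * Real.sqrt B := by
    rw [eb, ec, h19]; exact (le_abs_self _).trans cs2
  exact prop65_algebra_threshold (Real.sqrt_nonneg A) (Real.sqrt_nonneg M) hC hkpos e1 e2 hPb h611 hα

end Prop65


/-! ### PV Lemma 6.3, convective half ((6.12)): `‖((U·∇)U)_a‖_γ ≤ C₁‖(U)_a‖_γ + 3C₀‖∇(U)_a‖_γ` for a bounded `C¹`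
field with bounded gradient (`‖U‖_∞ ≤ C₀`, `‖DU‖_∞ ≤ C₁`). All integrability side conditions are DISCHARGED here
(bounded × Gaussian), so this half of (6.11) carries no records. -/

section Lemma63

/-- The Gaussian weight is integrable on `ℝ³`. -/
theorem integrable_gauss : Integrable gauss := by
  have h := (GaussianFourier.integrable_cexp_neg_mul_sq_norm_add_of_euclideanSpace
    (b := ((1 / 4 : ℝ) : ℂ)) (by rw [Complex.ofReal_re]; norm_num) 0 (0 : E3)).norm
  refine h.congr (ae_of_all _ fun v => ?_)
  simp only [zero_mul, add_zero]
  have : -((1 / 4 : ℝ) : ℂ) * (‖v‖ : ℂ) ^ 2 = ((-(1 / 4 : ℝ) * ‖v‖ ^ 2 : ℝ) : ℂ) := by push_cast; ring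
  rw [this, Complex.norm_exp_ofReal, gauss]

/-- A continuous bounded function is integrable against the Gaussian weight. -/
theorem integrable_mul_gauss_of_le {F : E3 → ℝ} (hF : Continuous F) {K : ℝ} (hK : ∀ y, |F y| ≤ K) :
    Integrable fun y => F y * gauss y := by
  refine (integrable_gauss.const_mul K).mono' ((hF.mul continuous_gauss).aestronglyMeasurable)
    (ae_of_all _ fun y => ?_)
  rw [Real.norm_eq_abs, abs_mul, abs_of_pos (gauss_pos y)]
  exact mul_le_mul_of_nonneg_right (hK y) (gauss_pos y).le

/-- `‖⟨U⟩_θ‖_∞ ≤ ‖U‖_∞`. -/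
theorem norm_azimuthalMean_le {U : E3 → E3} {K : ℝ} (hK : ∀ y, ‖U y‖ ≤ K) (y : E3) :
    ‖azimuthalMean U y‖ ≤ K := by
  have hK0 : 0 ≤ K := (norm_nonneg _).trans (hK 0)
  unfold azimuthalMean
  rw [norm_smul]
  have h1 : ‖∫ θ in (0:ℝ)..2 * Real.pi, rotZ (-θ) (U (rotZ θ y))‖ ≤ K * |2 * Real.pi - 0| :=
    intervalIntegral.norm_integral_le_of_norm_le_const fun θ _ => by rw [norm_rotZ]; exact hK _
  rw [sub_zero, abs_of_pos Real.two_pi_pos] at h1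
  rw [Real.norm_of_nonneg (by positivity)]
  calc 1 / (2 * Real.pi) * ‖∫ θ in (0:ℝ)..2 * Real.pi, rotZ (-θ) (U (rotZ θ y))‖
      ≤ 1 / (2 * Real.pi) * (K * (2 * Real.pi)) := by gcongr
    _ = K := by field_simp

/-- `‖D⟨U⟩_θ‖_∞ ≤ ‖DU‖_∞`. -/
theorem norm_fderiv_azimuthalMean_le {U : E3 → E3} (hU : ContDiff ℝ 1 U) {K : ℝ}
    (hD : ∀ y, ‖fderiv ℝ U y‖ ≤ K) (y : E3) : ‖fderiv ℝ (azimuthalMean U) y‖ ≤ K := by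
  rw [(hasFDerivAt_azimuthalMean hU y).fderiv, norm_smul]
  have hK0 : 0 ≤ K := (norm_nonneg _).trans (hD 0)
  have h1 : ‖∫ θ in (0:ℝ)..2 * Real.pi, azDer U y θ‖ ≤ K * |2 * Real.pi - 0| :=
    intervalIntegral.norm_integral_le_of_norm_le_const fun θ _ => (norm_azDer_le y θ).trans (hD _)
  rw [sub_zero, abs_of_pos Real.two_pi_pos] at h1
  rw [Real.norm_of_nonneg (by positivity)]
  calc 1 / (2 * Real.pi) * ‖∫ θ in (0:ℝ)..2 * Real.pi, azDer U y θ‖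
      ≤ 1 / (2 * Real.pi) * (K * (2 * Real.pi)) := by gcongr
    _ = K := by field_simp

/-- `DU(y)[v] = Σ_i v_i ∂_i U(y)`. -/
theorem fderiv_apply_eq_sum_pd (U : E3 → E3) (y v : E3) : fderiv ℝ U y v = ∑ i, v i • pd i U y := by
  have hv : ∑ i, v i • eI i = v := by
    simpa [eI, EuclideanSpace.basisFun_apply, EuclideanSpace.basisFun_repr] using
      (EuclideanSpace.basisFun (Fin 3) ℝ).sum_repr v
  calc fderiv ℝ U y v = fderiv ℝ U y (∑ i, v i • eI i) := by rw [hv]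
    _ = ∑ i, v i • pd i U y := by simp [pd, map_sum, map_smul]

/-- Operator-vs-Frobenius: `‖DU(y)[v]‖² ≤ ‖v‖² Σ_i ‖∂_i U(y)‖²`. -/
theorem norm_fderiv_apply_sq_le (U : E3 → E3) (y v : E3) :
    ‖fderiv ℝ U y v‖ ^ 2 ≤ ‖v‖ ^ 2 * ∑ i, ‖pd i U y‖ ^ 2 := by
  rw [fderiv_apply_eq_sum_pd, EuclideanSpace.norm_sq_eq v]
  have h1 : ‖∑ i, v i • pd i U y‖ ≤ ∑ i, ‖v i‖ * ‖pd i U y‖ :=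
    (norm_sum_le _ _).trans (le_of_eq (Finset.sum_congr rfl fun i _ => norm_smul _ _))
  have h2 : (∑ i, ‖v i‖ * ‖pd i U y‖) ^ 2 ≤ (∑ i, ‖v i‖ ^ 2) * ∑ i, ‖pd i U y‖ ^ 2 :=
    Finset.sum_mul_sq_le_sq_mul_sq _ _ _
  exact (pow_le_pow_left₀ (norm_nonneg _) h1 2).trans h2

/-- `‖∂_i U(y)‖ ≤ ‖DU(y)‖`. -/
theorem norm_pd_le (U : E3 → E3) (i : Fin 3) (y : E3) : ‖pd i U y‖ ≤ ‖fderiv ℝ U y‖ := by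
  have h1 : ‖eI i‖ = 1 := by simp [eI]
  calc ‖pd i U y‖ = ‖fderiv ℝ U y (eI i)‖ := rfl
    _ ≤ ‖fderiv ℝ U y‖ * ‖eI i‖ := ContinuousLinearMap.le_opNorm _ _
    _ = ‖fderiv ℝ U y‖ := by rw [h1, mul_one]

theorem fderiv_azFluct {U : E3 → E3} (hU : ContDiff ℝ 1 U) (y : E3) :
    fderiv ℝ (azFluct U) y = fderiv ℝ U y - fderiv ℝ (azimuthalMean U) y :=
  (((hU.differentiable one_ne_zero) y).hasFDerivAt.sub
    ((differentiable_azimuthalMean hU) y).hasFDerivAt).fderiv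

/-- `‖(U)_a‖_∞ ≤ 2‖U‖_∞`. -/
theorem norm_azFluct_le {U : E3 → E3} {K : ℝ} (hK : ∀ y, ‖U y‖ ≤ K) (y : E3) : ‖azFluct U y‖ ≤ 2 * K :=
  (norm_sub_le _ _).trans (by linarith [hK y, norm_azimuthalMean_le hK y])

/-- `‖D(U)_a‖_∞ ≤ 2‖DU‖_∞`. -/
theorem norm_fderiv_azFluct_le {U : E3 → E3} (hU : ContDiff ℝ 1 U) {K : ℝ} (hD : ∀ y, ‖fderiv ℝ U y‖ ≤ K)
    (y : E3) : ‖fderiv ℝ (azFluct U) y‖ ≤ 2 * K := by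
  rw [fderiv_azFluct hU]
  exact (norm_sub_le _ _).trans (by linarith [hD y, norm_fderiv_azimuthalMean_le hU hD y])


theorem integrable_norm_sq_mul_gauss {f : E3 → E3} (hf : Continuous f) {K : ℝ} (hK : ∀ y, ‖f y‖ ≤ K) :
    Integrable fun y => ‖f y‖ ^ 2 * gauss y :=
  integrable_mul_gauss_of_le (hf.norm.pow 2) (K := K ^ 2) fun y => by
    rw [abs_of_nonneg (sq_nonneg _)]; exact pow_le_pow_left₀ (norm_nonneg _) (hK y) 2

theorem integrable_inner_mul_gauss {f g : E3 → E3} (hf : Continuous f) (hg : Continuous g) {Kf Kg : ℝ}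
    (hKf : ∀ y, ‖f y‖ ≤ Kf) (hKg : ∀ y, ‖g y‖ ≤ Kg) :
    Integrable fun y => inner ℝ (f y) (g y) * gauss y :=
  integrable_mul_gauss_of_le (hf.inner hg) (K := Kf * Kg) fun y =>
    (abs_real_inner_le_norm _ _).trans
      (mul_le_mul (hKf y) (hKg y) (norm_nonneg _) ((norm_nonneg _).trans (hKf y)))

/-- Minkowski in weighted `L²`: `‖f + g‖_{L²_w} ≤ ‖f‖_{L²_w} + ‖g‖_{L²_w}`. -/
theorem weighted_L2_triangle {f g : E3 → E3} (hf : Continuous f) (hg : Continuous g) {w : E3 → ℝ}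
    (hwm : Measurable w) (hw0 : ∀ y, 0 ≤ w y)
    (iF : Integrable fun y => ‖f y‖ ^ 2 * w y) (iG : Integrable fun y => ‖g y‖ ^ 2 * w y) :
    Real.sqrt (∫ y, ‖f y + g y‖ ^ 2 * w y)
      ≤ Real.sqrt (∫ y, ‖f y‖ ^ 2 * w y) + Real.sqrt (∫ y, ‖g y‖ ^ 2 * w y) := by
  have cs := weighted_cauchy_schwarz hf hg hwm hw0 iF iG
  have iX : Integrable fun y => inner ℝ (f y) (g y) * w y := by
    refine ((iF.add iG).div_const 2).mono' (((hf.inner hg).measurable.mul hwm).aestronglyMeasurable)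
      (ae_of_all _ fun y => ?_)
    rw [Real.norm_eq_abs, abs_mul, abs_of_nonneg (hw0 y)]
    have h1 : |inner ℝ (f y) (g y)| ≤ ‖f y‖ * ‖g y‖ := abs_real_inner_le_norm _ _
    have h2 : 2 * ‖f y‖ * ‖g y‖ ≤ ‖f y‖ ^ 2 + ‖g y‖ ^ 2 := two_mul_le_add_sq _ _
    have := hw0 y
    simp only [Pi.add_apply]
    nlinarith [abs_nonneg (inner ℝ (f y) (g y))]
  have hpt : ∀ y, ‖f y + g y‖ ^ 2 * w y
      = (‖f y‖ ^ 2 * w y + 2 * (inner ℝ (f y) (g y) * w y)) + ‖g y‖ ^ 2 * w y := by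
    intro y; rw [norm_add_sq_real]; ring
  have hs1 : ∫ y, ((‖f y‖ ^ 2 * w y + 2 * (inner ℝ (f y) (g y) * w y)) + ‖g y‖ ^ 2 * w y)
      = (∫ y, (‖f y‖ ^ 2 * w y + 2 * (inner ℝ (f y) (g y) * w y))) + ∫ y, ‖g y‖ ^ 2 * w y :=
    MeasureTheory.integral_add (iF.add (iX.const_mul 2)) iG
  have hs2 : ∫ y, (‖f y‖ ^ 2 * w y + 2 * (inner ℝ (f y) (g y) * w y))
      = (∫ y, ‖f y‖ ^ 2 * w y) + ∫ y, 2 * (inner ℝ (f y) (g y) * w y) :=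
    MeasureTheory.integral_add iF (iX.const_mul 2)
  have hI : ∫ y, ‖f y + g y‖ ^ 2 * w y = (∫ y, ‖f y‖ ^ 2 * w y)
      + 2 * (∫ y, inner ℝ (f y) (g y) * w y) + ∫ y, ‖g y‖ ^ 2 * w y := by
    simp_rw [hpt]; rw [hs1, hs2, MeasureTheory.integral_const_mul]
  have hF0 : 0 ≤ ∫ y, ‖f y‖ ^ 2 * w y := integral_nonneg fun y => by have := hw0 y; positivity
  have hG0 : 0 ≤ ∫ y, ‖g y‖ ^ 2 * w y := integral_nonneg fun y => by have := hw0 y; positivity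
  have hX : ∫ y, inner ℝ (f y) (g y) * w y
      ≤ Real.sqrt (∫ y, ‖f y‖ ^ 2 * w y) * Real.sqrt (∫ y, ‖g y‖ ^ 2 * w y) := (le_abs_self _).trans cs
  rw [hI]
  calc Real.sqrt ((∫ y, ‖f y‖ ^ 2 * w y) + 2 * (∫ y, inner ℝ (f y) (g y) * w y) + ∫ y, ‖g y‖ ^ 2 * w y)
      ≤ Real.sqrt ((Real.sqrt (∫ y, ‖f y‖ ^ 2 * w y) + Real.sqrt (∫ y, ‖g y‖ ^ 2 * w y)) ^ 2) :=
        Real.sqrt_le_sqrt (by nlinarith [Real.sq_sqrt hF0, Real.sq_sqrt hG0, hX])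
    _ = _ := Real.sqrt_sq (by positivity)

/-- The non-axisymmetric generator of `((U·∇)U)_a`: `D(U)_a[⟨U⟩_θ] + D⟨U⟩_θ[(U)_a] + D(U)_a[(U)_a]`. -/
noncomputable def convFluctGen (U : E3 → E3) (y : E3) : E3 :=
  fderiv ℝ (azFluct U) y (azimuthalMean U y) + fderiv ℝ (azimuthalMean U) y (azFluct U y)
    + fderiv ℝ (azFluct U) y (azFluct U y)

/-- `(U·∇)U = (⟨U⟩·∇)⟨U⟩ + [D(U)_a[⟨U⟩] + D⟨U⟩[(U)_a] + D(U)_a[(U)_a]]`. -/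
theorem convect_decomp {U : E3 → E3} (hU : ContDiff ℝ 1 U) (y : E3) :
    convect U U y = convect (azimuthalMean U) (azimuthalMean U) y + convFluctGen U y := by
  have hD : fderiv ℝ U y = fderiv ℝ (azimuthalMean U) y + fderiv ℝ (azFluct U) y := by
    rw [fderiv_azFluct hU]; abel
  have hy : U y = azimuthalMean U y + azFluct U y := by rw [azFluct_apply]; abel
  simp only [convect, convFluctGen]
  rw [hD, hy]
  simp only [add_apply, map_add]
  abel

/-- `(G·∇)G` is axisymmetric when `G` is. -/
theorem isAxisymmetric_convect_self {G : E3 → E3} (hGa : IsAxisymmetric G) (hGd : Differentiable ℝ G) :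
    IsAxisymmetric (convect G G) := fun θ x => by
  simp only [convect]
  rw [hGa θ x]
  exact fderiv_rotZ_of_isAxisymmetric hGa hGd θ x (G x)

theorem continuous_convect_of_contDiff {V W : E3 → E3} (hV : Continuous V) (hW : ContDiff ℝ 1 W) :
    Continuous (convect V W) :=
  (hW.continuous_fderiv one_ne_zero).clm_apply hV

theorem continuous_convFluctGen {U : E3 → E3} (hU : ContDiff ℝ 1 U) : Continuous (convFluctGen U) := by
  have h1 := contDiff_one_azFluct hU
  have h2 := contDiff_one_azimuthalMean hU
  unfold convFluctGen
  exact (((h1.continuous_fderiv one_ne_zero).clm_apply h2.continuous).add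
    ((h2.continuous_fderiv one_ne_zero).clm_apply h1.continuous)).add
    ((h1.continuous_fderiv one_ne_zero).clm_apply h1.continuous)

theorem azimuthalMean_add {V W : E3 → E3} (hV : Continuous V) (hW : Continuous W) (y : E3) :
    azimuthalMean (fun x => V x + W x) y = azimuthalMean V y + azimuthalMean W y := by
  unfold azimuthalMean
  simp_rw [rotZ_add_vec]
  rw [intervalIntegral.integral_add ((continuous_pullback hV y).intervalIntegrable _ _)
    ((continuous_pullback hW y).intervalIntegrable _ _), smul_add]

/-- `((U·∇)U)_a = (convFluctGen U)_a`: the projection kills the axisymmetric part `(⟨U⟩·∇)⟨U⟩`. -/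
theorem azFluct_convect {U : E3 → E3} (hU : ContDiff ℝ 1 U) :
    azFluct (convect U U) = azFluct (convFluctGen U) := by
  have hUa := contDiff_one_azimuthalMean hU
  have hGa : IsAxisymmetric (convect (azimuthalMean U) (azimuthalMean U)) :=
    isAxisymmetric_convect_self (isAxisymmetric_azimuthalMean hU.continuous) (hUa.differentiable one_ne_zero)
  have hGc : Continuous (convect (azimuthalMean U) (azimuthalMean U)) :=
    continuous_convect_of_contDiff hUa.continuous hUa
  have hVc := continuous_convFluctGen hU
  have hsum : convect U U = fun y => convect (azimuthalMean U) (azimuthalMean U) y + convFluctGen U y :=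
    funext (convect_decomp hU)
  funext y
  rw [azFluct_apply, azFluct_apply, hsum, azimuthalMean_add hGc hVc, azimuthalMean_of_isAxisymmetric hGa]
  beta_reduce
  abel

/-- **PV (6.12), the convective half of Lemma 6.3.** For a `C¹` field with `‖U‖_∞ ≤ K₀`, `‖DU‖_∞ ≤ K₁`:
`‖((U·∇)U)_a‖_γ ≤ K₁ ‖(U)_a‖_γ + 3K₀ ‖∇(U)_a‖_γ` (no integrability records: bounded × Gaussian). -/
theorem pv612_convective {U : E3 → E3} (hU : ContDiff ℝ 1 U) {K0 K1 : ℝ} (h0 : ∀ y, ‖U y‖ ≤ K0)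
    (h1 : ∀ y, ‖fderiv ℝ U y‖ ≤ K1) :
    Real.sqrt (∫ y, ‖azFluct (convect U U) y‖ ^ 2 * gauss y)
      ≤ K1 * Real.sqrt (∫ y, ‖azFluct U y‖ ^ 2 * gauss y)
        + 3 * K0 * Real.sqrt (∑ i, ∫ y, ‖pd i (azFluct U) y‖ ^ 2 * gauss y) := by
  have hK0 : 0 ≤ K0 := (norm_nonneg _).trans (h0 0)
  have hK1 : 0 ≤ K1 := (norm_nonneg _).trans (h1 0)
  have g0 : ∀ y, 0 ≤ gauss y := fun y => (gauss_pos y).le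
  have hUa1 := contDiff_one_azimuthalMean hU
  have hUn1 := contDiff_one_azFluct hU
  have hUac : Continuous (azimuthalMean U) := hUa1.continuous
  have hUnc : Continuous (azFluct U) := hUn1.continuous
  have hDnc : Continuous (fderiv ℝ (azFluct U)) := hUn1.continuous_fderiv one_ne_zero
  have hDac : Continuous (fderiv ℝ (azimuthalMean U)) := hUa1.continuous_fderiv one_ne_zero
  have bUa : ∀ y, ‖azimuthalMean U y‖ ≤ K0 := norm_azimuthalMean_le h0
  have bUn : ∀ y, ‖azFluct U y‖ ≤ 2 * K0 := norm_azFluct_le h0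
  have bDa : ∀ y, ‖fderiv ℝ (azimuthalMean U) y‖ ≤ K1 := norm_fderiv_azimuthalMean_le hU h1
  have bDn : ∀ y, ‖fderiv ℝ (azFluct U) y‖ ≤ 2 * K1 := norm_fderiv_azFluct_le hU h1
  have bpd : ∀ i y, ‖pd i (azFluct U) y‖ ≤ 2 * K1 := fun i y => (norm_pd_le _ i y).trans (bDn y)
  set fa : E3 → E3 := fun y => fderiv ℝ (azFluct U) y (azimuthalMean U y) with hfa
  set fb : E3 → E3 := fun y => fderiv ℝ (azimuthalMean U) y (azFluct U y) with hfb
  set fc : E3 → E3 := fun y => fderiv ℝ (azFluct U) y (azFluct U y) with hfc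
  have cfa : Continuous fa := hDnc.clm_apply hUac
  have cfb : Continuous fb := hDac.clm_apply hUnc
  have cfc : Continuous fc := hDnc.clm_apply hUnc
  have bfa : ∀ y, ‖fa y‖ ≤ 2 * K1 * K0 := fun y =>
    (ContinuousLinearMap.le_opNorm _ _).trans (mul_le_mul (bDn y) (bUa y) (norm_nonneg _) (by positivity))
  have bfb : ∀ y, ‖fb y‖ ≤ K1 * (2 * K0) := fun y =>
    (ContinuousLinearMap.le_opNorm _ _).trans (mul_le_mul (bDa y) (bUn y) (norm_nonneg _) hK1)
  have bfc : ∀ y, ‖fc y‖ ≤ 2 * K1 * (2 * K0) := fun y =>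
    (ContinuousLinearMap.le_opNorm _ _).trans (mul_le_mul (bDn y) (bUn y) (norm_nonneg _) (by positivity))
  have iFa := integrable_norm_sq_mul_gauss cfa bfa
  have iFb := integrable_norm_sq_mul_gauss cfb bfb
  have iFc := integrable_norm_sq_mul_gauss cfc bfc
  have iB := integrable_norm_sq_mul_gauss hUnc bUn
  have iPd : ∀ i, Integrable fun y => ‖pd i (azFluct U) y‖ ^ 2 * gauss y := fun i =>
    integrable_norm_sq_mul_gauss (hDnc.clm_apply continuous_const) (bpd i)
  have hV : convFluctGen U = fun y => (fa y + fb y) + fc y := rfl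
  have hVc : Continuous (convFluctGen U) := continuous_convFluctGen hU
  have bV : ∀ y, ‖convFluctGen U y‖ ≤ 2 * K1 * K0 + K1 * (2 * K0) + 2 * K1 * (2 * K0) := fun y => by
    rw [hV]
    exact (norm_add_le _ _).trans (add_le_add ((norm_add_le _ _).trans (add_le_add (bfa y) (bfb y))) (bfc y))
  have hA : ∫ y, ‖azFluct (convect U U) y‖ ^ 2 * gauss y ≤ ∫ y, ‖convFluctGen U y‖ ^ 2 * gauss y := by
    rw [azFluct_convect hU]
    have bVa : ∀ y, ‖azimuthalMean (convFluctGen U) y‖ ≤ _ := norm_azimuthalMean_le bV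
    have hP := weighted_pythagoras_azimuthal hVc measurable_gauss (fun θ y => gauss_rotZ θ y)
      (integrable_norm_sq_mul_gauss (continuous_azimuthalMean hVc) bVa)
      (integrable_norm_sq_mul_gauss (hVc.sub (continuous_azimuthalMean hVc)) (norm_azFluct_le bV))
      (integrable_inner_mul_gauss (continuous_azimuthalMean hVc) (hVc.sub (continuous_azimuthalMean hVc))
        bVa (norm_azFluct_le bV))
    have hnn : 0 ≤ ∫ y, ‖azimuthalMean (convFluctGen U) y‖ ^ 2 * gauss y :=
      integral_nonneg fun y => by have := g0 y; positivity
    simp only [azFluct_apply]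
    linarith
  have hB : Real.sqrt (∫ y, ‖convFluctGen U y‖ ^ 2 * gauss y)
      ≤ Real.sqrt (∫ y, ‖fa y‖ ^ 2 * gauss y) + Real.sqrt (∫ y, ‖fb y‖ ^ 2 * gauss y)
        + Real.sqrt (∫ y, ‖fc y‖ ^ 2 * gauss y) := by
    rw [hV]
    have iab : Integrable fun y => ‖fa y + fb y‖ ^ 2 * gauss y :=
      integrable_norm_sq_mul_gauss (cfa.add cfb) (K := 2 * K1 * K0 + K1 * (2 * K0)) fun y =>
        (norm_add_le _ _).trans (add_le_add (bfa y) (bfb y))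
    calc Real.sqrt (∫ y, ‖(fa y + fb y) + fc y‖ ^ 2 * gauss y)
        ≤ Real.sqrt (∫ y, ‖fa y + fb y‖ ^ 2 * gauss y) + Real.sqrt (∫ y, ‖fc y‖ ^ 2 * gauss y) :=
          weighted_L2_triangle (cfa.add cfb) cfc measurable_gauss g0 iab iFc
      _ ≤ _ := by
          have := weighted_L2_triangle cfa cfb measurable_gauss g0 iFa iFb
          linarith
  have hCsum : ∫ y, (∑ i, ‖pd i (azFluct U) y‖ ^ 2) * gauss y = ∑ i, ∫ y, ‖pd i (azFluct U) y‖ ^ 2 * gauss y := by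
    rw [← MeasureTheory.integral_finsetSum _ (fun i _ => iPd i)]
    refine integral_congr_ae (ae_of_all _ fun y => ?_)
    beta_reduce
    rw [Finset.sum_mul]
  have iCsum : Integrable fun y => (∑ i, ‖pd i (azFluct U) y‖ ^ 2) * gauss y := by
    have := MeasureTheory.integrable_finsetSum (Finset.univ) (fun i _ => iPd i)
    refine this.congr (ae_of_all _ fun y => ?_)
    beta_reduce
    rw [Finset.sum_mul]
  have hC0 : 0 ≤ ∑ i, ∫ y, ‖pd i (azFluct U) y‖ ^ 2 * gauss y :=
    Finset.sum_nonneg fun i _ => integral_nonneg fun y => by have := g0 y; positivity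
  have ea : Real.sqrt (∫ y, ‖fa y‖ ^ 2 * gauss y)
      ≤ K0 * Real.sqrt (∑ i, ∫ y, ‖pd i (azFluct U) y‖ ^ 2 * gauss y) := by
    have hle : ∫ y, ‖fa y‖ ^ 2 * gauss y ≤ K0 ^ 2 * ∑ i, ∫ y, ‖pd i (azFluct U) y‖ ^ 2 * gauss y := by
      rw [← hCsum, ← MeasureTheory.integral_const_mul]
      refine integral_mono_of_nonneg (ae_of_all _ fun y => by have := g0 y; positivity)
        (iCsum.const_mul _) (ae_of_all _ fun y => ?_)
      beta_reduce
      have h := norm_fderiv_apply_sq_le (azFluct U) y (azimuthalMean U y)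
      have h' : ‖azimuthalMean U y‖ ^ 2 ≤ K0 ^ 2 := pow_le_pow_left₀ (norm_nonneg _) (bUa y) 2
      have hs : 0 ≤ ∑ i, ‖pd i (azFluct U) y‖ ^ 2 := Finset.sum_nonneg fun i _ => sq_nonneg _
      have := g0 y
      calc ‖fa y‖ ^ 2 * gauss y ≤ (‖azimuthalMean U y‖ ^ 2 * ∑ i, ‖pd i (azFluct U) y‖ ^ 2) * gauss y :=
            mul_le_mul_of_nonneg_right h this
        _ ≤ (K0 ^ 2 * ∑ i, ‖pd i (azFluct U) y‖ ^ 2) * gauss y := by gcongr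
        _ = K0 ^ 2 * ((∑ i, ‖pd i (azFluct U) y‖ ^ 2) * gauss y) := by ring
    calc Real.sqrt (∫ y, ‖fa y‖ ^ 2 * gauss y)
        ≤ Real.sqrt (K0 ^ 2 * ∑ i, ∫ y, ‖pd i (azFluct U) y‖ ^ 2 * gauss y) := Real.sqrt_le_sqrt hle
      _ = K0 * Real.sqrt (∑ i, ∫ y, ‖pd i (azFluct U) y‖ ^ 2 * gauss y) := by
          rw [Real.sqrt_mul (sq_nonneg _), Real.sqrt_sq hK0]
  have eb : Real.sqrt (∫ y, ‖fb y‖ ^ 2 * gauss y) ≤ K1 * Real.sqrt (∫ y, ‖azFluct U y‖ ^ 2 * gauss y) := by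
    have hle : ∫ y, ‖fb y‖ ^ 2 * gauss y ≤ K1 ^ 2 * ∫ y, ‖azFluct U y‖ ^ 2 * gauss y := by
      rw [← MeasureTheory.integral_const_mul]
      refine integral_mono_of_nonneg (ae_of_all _ fun y => by have := g0 y; positivity)
        (iB.const_mul _) (ae_of_all _ fun y => ?_)
      beta_reduce
      have h : ‖fb y‖ ≤ K1 * ‖azFluct U y‖ :=
        (ContinuousLinearMap.le_opNorm _ _).trans (mul_le_mul_of_nonneg_right (bDa y) (norm_nonneg _))
      have := g0 y
      calc ‖fb y‖ ^ 2 * gauss y ≤ (K1 * ‖azFluct U y‖) ^ 2 * gauss y :=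
            mul_le_mul_of_nonneg_right (pow_le_pow_left₀ (norm_nonneg _) h 2) this
        _ = K1 ^ 2 * (‖azFluct U y‖ ^ 2 * gauss y) := by ring
    calc Real.sqrt (∫ y, ‖fb y‖ ^ 2 * gauss y)
        ≤ Real.sqrt (K1 ^ 2 * ∫ y, ‖azFluct U y‖ ^ 2 * gauss y) := Real.sqrt_le_sqrt hle
      _ = K1 * Real.sqrt (∫ y, ‖azFluct U y‖ ^ 2 * gauss y) := by
          rw [Real.sqrt_mul (sq_nonneg _), Real.sqrt_sq hK1]
  have ec : Real.sqrt (∫ y, ‖fc y‖ ^ 2 * gauss y)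
      ≤ 2 * K0 * Real.sqrt (∑ i, ∫ y, ‖pd i (azFluct U) y‖ ^ 2 * gauss y) := by
    have hle : ∫ y, ‖fc y‖ ^ 2 * gauss y ≤ (2 * K0) ^ 2 * ∑ i, ∫ y, ‖pd i (azFluct U) y‖ ^ 2 * gauss y := by
      rw [← hCsum, ← MeasureTheory.integral_const_mul]
      refine integral_mono_of_nonneg (ae_of_all _ fun y => by have := g0 y; positivity)
        (iCsum.const_mul _) (ae_of_all _ fun y => ?_)
      beta_reduce
      have h := norm_fderiv_apply_sq_le (azFluct U) y (azFluct U y)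
      have h' : ‖azFluct U y‖ ^ 2 ≤ (2 * K0) ^ 2 := pow_le_pow_left₀ (norm_nonneg _) (bUn y) 2
      have hs : 0 ≤ ∑ i, ‖pd i (azFluct U) y‖ ^ 2 := Finset.sum_nonneg fun i _ => sq_nonneg _
      have := g0 y
      calc ‖fc y‖ ^ 2 * gauss y ≤ (‖azFluct U y‖ ^ 2 * ∑ i, ‖pd i (azFluct U) y‖ ^ 2) * gauss y :=
            mul_le_mul_of_nonneg_right h this
        _ ≤ ((2 * K0) ^ 2 * ∑ i, ‖pd i (azFluct U) y‖ ^ 2) * gauss y := by gcongr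
        _ = (2 * K0) ^ 2 * ((∑ i, ‖pd i (azFluct U) y‖ ^ 2) * gauss y) := by ring
    calc Real.sqrt (∫ y, ‖fc y‖ ^ 2 * gauss y)
        ≤ Real.sqrt ((2 * K0) ^ 2 * ∑ i, ∫ y, ‖pd i (azFluct U) y‖ ^ 2 * gauss y) := Real.sqrt_le_sqrt hle
      _ = 2 * K0 * Real.sqrt (∑ i, ∫ y, ‖pd i (azFluct U) y‖ ^ 2 * gauss y) := by
          rw [Real.sqrt_mul (sq_nonneg _), Real.sqrt_sq (by positivity)]
  calc Real.sqrt (∫ y, ‖azFluct (convect U U) y‖ ^ 2 * gauss y)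
      ≤ Real.sqrt (∫ y, ‖convFluctGen U y‖ ^ 2 * gauss y) := Real.sqrt_le_sqrt hA
    _ ≤ _ := hB
    _ ≤ _ := by linarith

end Lemma63


/-! ### Discharging the integrability records for PV-class profiles.
`PVBounds U K`: `U ∈ C²` with `‖U‖_∞, ‖DU‖_∞, ‖D²U‖_∞ ≤ K` (PV (1.9), (2.1) at orders ≤ 2; no decay needed). Every pairing
against `γ` used above is then (polynomial of degree ≤ 2 in `‖y‖`) × Gaussian, hence integrable. -/

section Records

theorem integrable_exp_neg_mul_norm_sq {b : ℝ} (hb : 0 < b) :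
    Integrable fun y : E3 => Real.exp (-b * ‖y‖ ^ 2) := by
  have h := (GaussianFourier.integrable_cexp_neg_mul_sq_norm_add_of_euclideanSpace
    (b := (b : ℂ)) (by rw [Complex.ofReal_re]; exact hb) 0 (0 : E3)).norm
  refine h.congr (ae_of_all _ fun v => ?_)
  simp only [zero_mul, add_zero]
  have : -(b : ℂ) * (‖v‖ : ℂ) ^ 2 = ((-b * ‖v‖ ^ 2 : ℝ) : ℂ) := by push_cast; ring
  rw [this, Complex.norm_exp_ofReal]

/-- `(1 + ‖y‖²) γ(y)` is integrable (`(1+s)e^{-s/8} ≤ 8`). -/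
theorem integrable_quad_mul_gauss : Integrable fun y : E3 => (1 + ‖y‖ ^ 2) * gauss y := by
  have h8 := (integrable_exp_neg_mul_norm_sq (b := 1 / 8) (by norm_num)).const_mul 8
  refine h8.mono' (((continuous_const.add (continuous_norm.pow 2)).mul continuous_gauss).aestronglyMeasurable)
    (ae_of_all _ fun y => ?_)
  have hE : 0 < Real.exp (-(1 / 8 : ℝ) * ‖y‖ ^ 2) := Real.exp_pos _
  have hEE : Real.exp ((1 / 8 : ℝ) * ‖y‖ ^ 2) * Real.exp (-(1 / 8 : ℝ) * ‖y‖ ^ 2) = 1 := by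
    rw [← Real.exp_add]; simp
  have hγ : gauss y = Real.exp (-(1 / 8 : ℝ) * ‖y‖ ^ 2) * Real.exp (-(1 / 8 : ℝ) * ‖y‖ ^ 2) := by
    rw [gauss, ← Real.exp_add]; congr 1; ring
  have hkey : (1 + ‖y‖ ^ 2) * Real.exp (-(1 / 8 : ℝ) * ‖y‖ ^ 2) ≤ 8 := by
    have h1 : 1 + ‖y‖ ^ 2 ≤ 8 * Real.exp ((1 / 8 : ℝ) * ‖y‖ ^ 2) := by
      have := Real.add_one_le_exp ((1 / 8 : ℝ) * ‖y‖ ^ 2); nlinarith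
    calc (1 + ‖y‖ ^ 2) * Real.exp (-(1 / 8 : ℝ) * ‖y‖ ^ 2)
        ≤ 8 * Real.exp ((1 / 8 : ℝ) * ‖y‖ ^ 2) * Real.exp (-(1 / 8 : ℝ) * ‖y‖ ^ 2) :=
          mul_le_mul_of_nonneg_right h1 hE.le
      _ = 8 := by rw [mul_assoc, hEE, mul_one]
  rw [Real.norm_of_nonneg (by have := (gauss_pos y).le; positivity), hγ]
  calc (1 + ‖y‖ ^ 2) * (Real.exp (-(1 / 8 : ℝ) * ‖y‖ ^ 2) * Real.exp (-(1 / 8 : ℝ) * ‖y‖ ^ 2))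
      = ((1 + ‖y‖ ^ 2) * Real.exp (-(1 / 8 : ℝ) * ‖y‖ ^ 2)) * Real.exp (-(1 / 8 : ℝ) * ‖y‖ ^ 2) := by ring
    _ ≤ 8 * Real.exp (-(1 / 8 : ℝ) * ‖y‖ ^ 2) := mul_le_mul_of_nonneg_right hkey hE.le

/-- Anything continuous and bounded by `K (1 + ‖y‖²) γ(y)` is integrable. -/
theorem integrable_of_quad_gauss_bound {F : E3 → ℝ} (hF : Continuous F) {K : ℝ}
    (hK : ∀ y, |F y| ≤ K * (1 + ‖y‖ ^ 2) * gauss y) : Integrable F := by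
  refine (integrable_quad_mul_gauss.const_mul K).mono' hF.aestronglyMeasurable (ae_of_all _ fun y => ?_)
  rw [Real.norm_eq_abs]
  calc |F y| ≤ K * (1 + ‖y‖ ^ 2) * gauss y := hK y
    _ = K * ((1 + ‖y‖ ^ 2) * gauss y) := by ring

theorem integrable_mul_gauss_of_quad {F : E3 → ℝ} (hF : Continuous F) {K : ℝ}
    (hK : ∀ y, |F y| ≤ K * (1 + ‖y‖ ^ 2)) : Integrable fun y => F y * gauss y :=
  integrable_of_quad_gauss_bound (hF.mul continuous_gauss) (K := K) fun y => by
    rw [abs_mul, abs_of_pos (gauss_pos y)]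
    exact mul_le_mul_of_nonneg_right (hK y) (gauss_pos y).le

theorem integrable_inner_mul_gauss_of_quad {f g : E3 → E3} (hf : Continuous f) (hg : Continuous g) {K : ℝ}
    (hK : ∀ y, ‖f y‖ * ‖g y‖ ≤ K * (1 + ‖y‖ ^ 2)) : Integrable fun y => inner ℝ (f y) (g y) * gauss y :=
  integrable_mul_gauss_of_quad (hf.inner hg) fun y => (abs_real_inner_le_norm _ _).trans (hK y)

theorem integrable_inner_gauss_smul_of_quad {f g : E3 → E3} (hf : Continuous f) (hg : Continuous g) {K : ℝ}
    (hK : ∀ y, ‖f y‖ * ‖g y‖ ≤ K * (1 + ‖y‖ ^ 2)) : Integrable fun y => inner ℝ (f y) (gauss y • g y) :=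
  (integrable_inner_mul_gauss_of_quad hf hg hK).congr (ae_of_all _ fun y => by
    beta_reduce; rw [real_inner_smul_right, mul_comm])

theorem integrable_norm_sq_mul_gauss_of_quad {f : E3 → E3} (hf : Continuous f) {K : ℝ}
    (hK : ∀ y, ‖f y‖ ^ 2 ≤ K * (1 + ‖y‖ ^ 2)) : Integrable fun y => ‖f y‖ ^ 2 * gauss y :=
  integrable_mul_gauss_of_quad (hf.norm.pow 2) fun y => by rw [abs_of_nonneg (sq_nonneg _)]; exact hK y

/-- `(a t + b)(c t + d) ≤ (ac + ad + bc + bd)(1 + t²)` for nonnegative data. -/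
theorem linlin_le {a b c d t : ℝ} (ha : 0 ≤ a) (hb : 0 ≤ b) (hc : 0 ≤ c) (hd : 0 ≤ d) (ht : 0 ≤ t) :
    (a * t + b) * (c * t + d) ≤ (a * c + a * d + b * c + b * d) * (1 + t ^ 2) := by
  nlinarith [mul_nonneg (mul_nonneg ha hd) (sq_nonneg (t - 1)), mul_nonneg (mul_nonneg hb hc) (sq_nonneg (t - 1)),
    mul_nonneg (mul_nonneg hb hd) (sq_nonneg t), mul_nonneg ha hc, mul_nonneg (mul_nonneg ha hd) ht,
    mul_nonneg (mul_nonneg hb hc) ht]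

/-- Product of two linearly bounded nonnegative quantities is quadratically bounded. -/
theorem quad_of_lin {p q a b c d t : ℝ} (hp : p ≤ a * t + b) (hq : q ≤ c * t + d) (hp0 : 0 ≤ p) (hq0 : 0 ≤ q)
    (ha : 0 ≤ a) (hb : 0 ≤ b) (hc : 0 ≤ c) (hd : 0 ≤ d) (ht : 0 ≤ t) :
    p * q ≤ (a * c + a * d + b * c + b * d) * (1 + t ^ 2) :=
  (mul_le_mul hp hq hq0 (hp0.trans hp)).trans (linlin_le ha hb hc hd ht)

theorem norm_rotGen_le (v : E3) : ‖rotGen v‖ ≤ ‖v‖ := by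
  have h : ‖rotGen v‖ ^ 2 ≤ ‖v‖ ^ 2 := by
    rw [EuclideanSpace.norm_sq_eq, EuclideanSpace.norm_sq_eq, Fin.sum_univ_three, Fin.sum_univ_three]
    simp only [rotGen_apply_zero, rotGen_apply_one, rotGen_apply_two, Real.norm_eq_abs, sq_abs, norm_zero]
    nlinarith [sq_nonneg (v 2)]
  exact (pow_le_pow_iff_left₀ (norm_nonneg _) (norm_nonneg _) two_ne_zero).mp h

theorem norm_rotGenL_le : ‖rotGenL‖ ≤ 1 :=
  ContinuousLinearMap.opNorm_le_bound _ zero_le_one fun v => by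
    rw [one_mul, rotGenL_apply]; exact norm_rotGen_le v

theorem abs_apply_le_norm (y : E3) (i : Fin 3) : |y i| ≤ ‖y‖ := by
  have h := abs_real_inner_le_norm y (eI i)
  rw [inner_eI_right] at h
  have : ‖eI i‖ = 1 := by simp [eI]
  rw [this, mul_one] at h
  exact h

/-- `D(L_rot U)(y) = DU(y)∘J + D²U(y)[·](Jy) − J∘DU(y)`. -/
theorem hasFDerivAt_rotLie {U : E3 → E3} (hU : ContDiff ℝ 2 U) (y : E3) :
    HasFDerivAt (rotLie U)
      ((fderiv ℝ U y).comp rotGenL + (fderiv ℝ (fderiv ℝ U) y).flip (rotGenL y)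
        - rotGenL.comp (fderiv ℝ U y)) y := by
  have hD : ContDiff ℝ 1 (fderiv ℝ U) := hU.fderiv_right (m := 1) (by norm_num)
  have hc : HasFDerivAt (fun x => fderiv ℝ U x) (fderiv ℝ (fderiv ℝ U) y) y :=
    ((hD.differentiable one_ne_zero) y).hasFDerivAt
  have hUd : HasFDerivAt U (fderiv ℝ U y) y := ((hU.differentiable (by norm_num)) y).hasFDerivAt
  have hT1 : HasFDerivAt (fun x => (fderiv ℝ U x) (rotGenL x))
      ((fderiv ℝ U y).comp rotGenL + (fderiv ℝ (fderiv ℝ U) y).flip (rotGenL y)) y :=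
    hc.clm_apply rotGenL.hasFDerivAt
  have hT2 : HasFDerivAt (fun x => rotGenL (U x)) (rotGenL.comp (fderiv ℝ U y)) y :=
    rotGenL.hasFDerivAt.comp y hUd
  exact hT1.sub hT2

/-- A pointwise-constant bound in the linear format used by `quad_of_lin`. -/
theorem lin_of_const {q d : ℝ} (t : ℝ) (hq : q ≤ d) : q ≤ 0 * t + d := by rwa [zero_mul, zero_add]

/-- PV-class bounds at orders `≤ 2`: `U ∈ C²`, `‖U‖_∞, ‖DU‖_∞, ‖D²U‖_∞ ≤ K`. -/
structure PVBounds (U : E3 → E3) (K : ℝ) : Prop where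
  smooth : ContDiff ℝ 2 U
  b0 : ∀ y, ‖U y‖ ≤ K
  b1 : ∀ y, ‖fderiv ℝ U y‖ ≤ K
  b2 : ∀ y, ‖fderiv ℝ (fderiv ℝ U) y‖ ≤ K

namespace PVBounds

variable {U : E3 → E3} {K : ℝ} (h : PVBounds U K)
include h

theorem K_nonneg : 0 ≤ K := (norm_nonneg _).trans (h.b0 0)

theorem norm_rotLie_le (y : E3) : ‖rotLie U y‖ ≤ K * ‖y‖ + K := by
  unfold rotLie
  refine (norm_sub_le _ _).trans (add_le_add ?_ ?_)
  · exact (ContinuousLinearMap.le_opNorm _ _).trans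
      (mul_le_mul (h.b1 y) (norm_rotGen_le y) (norm_nonneg _) h.K_nonneg)
  · exact (norm_rotGen_le _).trans (h.b0 y)

theorem norm_fderiv_rotLie_le (y : E3) : ‖fderiv ℝ (rotLie U) y‖ ≤ K * ‖y‖ + 2 * K := by
  rw [(hasFDerivAt_rotLie h.smooth y).fderiv]
  have hK := h.K_nonneg
  have e1 : ‖(fderiv ℝ U y).comp rotGenL‖ ≤ K :=
    (ContinuousLinearMap.opNorm_comp_le _ _).trans (by
      calc ‖fderiv ℝ U y‖ * ‖rotGenL‖ ≤ K * 1 := mul_le_mul (h.b1 y) norm_rotGenL_le (norm_nonneg _) hK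
        _ = K := mul_one K)
  have e2 : ‖(fderiv ℝ (fderiv ℝ U) y).flip (rotGenL y)‖ ≤ K * ‖y‖ := by
    calc ‖(fderiv ℝ (fderiv ℝ U) y).flip (rotGenL y)‖
        ≤ ‖(fderiv ℝ (fderiv ℝ U) y).flip‖ * ‖rotGenL y‖ := ContinuousLinearMap.le_opNorm _ _
      _ ≤ K * ‖y‖ := by
          rw [ContinuousLinearMap.opNorm_flip, rotGenL_apply]
          exact mul_le_mul (h.b2 y) (norm_rotGen_le y) (norm_nonneg _) hK
  have e3 : ‖rotGenL.comp (fderiv ℝ U y)‖ ≤ K :=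
    (ContinuousLinearMap.opNorm_comp_le _ _).trans (by
      calc ‖rotGenL‖ * ‖fderiv ℝ U y‖ ≤ 1 * K := mul_le_mul norm_rotGenL_le (h.b1 y) (norm_nonneg _) zero_le_one
        _ = K := one_mul K)
  calc ‖(fderiv ℝ U y).comp rotGenL + (fderiv ℝ (fderiv ℝ U) y).flip (rotGenL y) - rotGenL.comp (fderiv ℝ U y)‖
      ≤ ‖(fderiv ℝ U y).comp rotGenL + (fderiv ℝ (fderiv ℝ U) y).flip (rotGenL y)‖
        + ‖rotGenL.comp (fderiv ℝ U y)‖ := norm_sub_le _ _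
    _ ≤ (K + K * ‖y‖) + K := add_le_add ((norm_add_le _ _).trans (add_le_add e1 e2)) e3
    _ = K * ‖y‖ + 2 * K := by ring

theorem norm_pd_le' (i : Fin 3) (y : E3) : ‖pd i U y‖ ≤ K := (norm_pd_le U i y).trans (h.b1 y)

theorem norm_pd_rotLie_le (i : Fin 3) (y : E3) : ‖pd i (rotLie U) y‖ ≤ K * ‖y‖ + 2 * K :=
  (norm_pd_le (rotLie U) i y).trans (h.norm_fderiv_rotLie_le y)

theorem fderiv_pd (i : Fin 3) (y : E3) : fderiv ℝ (pd i U) y = (fderiv ℝ (fderiv ℝ U) y).flip (eI i) := by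
  have hd : DifferentiableAt ℝ (fderiv ℝ U) y :=
    ((h.smooth.fderiv_right (m := 1) (by norm_num)).differentiable one_ne_zero) y
  have : pd i U = fun x => fderiv ℝ U x (eI i) := rfl
  rw [this, fderiv_clm_apply hd (differentiableAt_const _)]
  ext v j
  simp

theorem norm_fderiv_pd_le (i : Fin 3) (y : E3) : ‖fderiv ℝ (pd i U) y‖ ≤ K := by
  rw [h.fderiv_pd]
  have h1 : ‖eI i‖ = 1 := by simp [eI]
  calc ‖(fderiv ℝ (fderiv ℝ U) y).flip (eI i)‖ ≤ ‖(fderiv ℝ (fderiv ℝ U) y).flip‖ * ‖eI i‖ :=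
        ContinuousLinearMap.le_opNorm _ _
    _ ≤ K := by rw [ContinuousLinearMap.opNorm_flip, h1, mul_one]; exact h.b2 y

theorem norm_pd_pd_le (i j : Fin 3) (y : E3) : ‖pd i (pd j U) y‖ ≤ K :=
  (norm_pd_le (pd j U) i y).trans (h.norm_fderiv_pd_le j y)

theorem norm_rotLie_pd_le (i : Fin 3) (y : E3) : ‖rotLie (pd i U) y‖ ≤ K * ‖y‖ + K := by
  unfold rotLie
  refine (norm_sub_le _ _).trans (add_le_add ?_ ?_)
  · exact (ContinuousLinearMap.le_opNorm _ _).trans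
      (mul_le_mul (h.norm_fderiv_pd_le i y) (norm_rotGen_le y) (norm_nonneg _) h.K_nonneg)
  · exact (norm_rotGen_le _).trans (h.norm_pd_le' i y)

theorem norm_ouOp_le (y : E3) : ‖ouOp U y‖ ≤ (K / 2) * ‖y‖ + 3 * K := by
  unfold ouOp
  have e1 : ‖-(∑ i, pd i (pd i U) y)‖ ≤ 3 * K := by
    rw [norm_neg]
    refine (norm_sum_le _ _).trans ?_
    calc ∑ i, ‖pd i (pd i U) y‖ ≤ ∑ _i : Fin 3, K := Finset.sum_le_sum fun i _ => h.norm_pd_pd_le i i y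
      _ = 3 * K := by simp
  have e2 : ‖(1 / 2 : ℝ) • fderiv ℝ U y y‖ ≤ (K / 2) * ‖y‖ := by
    rw [norm_smul, Real.norm_of_nonneg (by norm_num : (0:ℝ) ≤ 1 / 2)]
    calc (1 / 2 : ℝ) * ‖fderiv ℝ U y y‖ ≤ (1 / 2) * (K * ‖y‖) :=
          mul_le_mul_of_nonneg_left ((ContinuousLinearMap.le_opNorm _ _).trans
            (mul_le_mul_of_nonneg_right (h.b1 y) (norm_nonneg _))) (by norm_num)
      _ = (K / 2) * ‖y‖ := by ring
  exact (norm_add_le _ _).trans (by linarith)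

theorem fderiv_gauss_smul_pd_apply (i : Fin 3) (y : E3) :
    fderiv ℝ (fun x => gauss x • pd i U x) y (eI i)
      = gauss y • pd i (pd i U) y + (-(gauss y / 2) * y i) • pd i U y := by
  have hp : HasFDerivAt (pd i U) (fderiv ℝ (pd i U) y) y :=
    (((contDiff_pd h.smooth i).differentiable one_ne_zero) y).hasFDerivAt
  have hd := (hasFDerivAt_gauss y).smul hp
  rw [show (fun x => gauss x • pd i U x) = gauss • pd i U from rfl, hd.fderiv]
  simp only [add_apply, smul_apply,
    ContinuousLinearMap.smulRight_apply, innerSL_apply_apply, smul_eq_mul, inner_eI_right]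
  simp only [pd, gauss]
  congr 1
  ring_nf

theorem norm_fderiv_gauss_smul_pd_le (i : Fin 3) (y : E3) :
    ‖fderiv ℝ (fun x => gauss x • pd i U x) y (eI i)‖ ≤ gauss y * ((K / 2) * ‖y‖ + K) := by
  rw [h.fderiv_gauss_smul_pd_apply]
  have hg := (gauss_pos y).le
  have hyi := abs_apply_le_norm y i
  refine (norm_add_le _ _).trans ?_
  rw [norm_smul, norm_smul, Real.norm_of_nonneg hg, Real.norm_eq_abs, abs_mul, abs_neg,
    abs_of_nonneg (by positivity : (0:ℝ) ≤ gauss y / 2)]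
  have e1 := h.norm_pd_pd_le i i y
  have e2 := h.norm_pd_le' i y
  have hK := h.K_nonneg
  calc gauss y * ‖pd i (pd i U) y‖ + gauss y / 2 * |y i| * ‖pd i U y‖
      ≤ gauss y * K + gauss y / 2 * ‖y‖ * K := by gcongr
    _ = gauss y * ((K / 2) * ‖y‖ + K) := by ring

/-! Continuity of the fields entering the records. -/

theorem continuous_rotLie' : Continuous (rotLie U) := (contDiff_rotLie h.smooth).continuous

theorem continuous_pd_rotLie (i : Fin 3) : Continuous (pd i (rotLie U)) :=
  ((contDiff_rotLie h.smooth).continuous_fderiv one_ne_zero).clm_apply continuous_const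

theorem continuous_pd' (i : Fin 3) : Continuous (pd i U) := (contDiff_pd h.smooth i).continuous

theorem continuous_pd_pd (i j : Fin 3) : Continuous (pd i (pd j U)) :=
  ((contDiff_pd h.smooth j).continuous_fderiv one_ne_zero).clm_apply continuous_const

theorem continuous_rotLie_pd (i : Fin 3) : Continuous (rotLie (pd i U)) := by
  unfold rotLie
  exact (((contDiff_pd h.smooth i).continuous_fderiv one_ne_zero).clm_apply rotGenL.continuous).sub
    (rotGenL.continuous.comp (h.continuous_pd' i))

theorem continuous_ouOp : Continuous (ouOp U) := by
  unfold ouOp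
  have h2 : Continuous fun y => fderiv ℝ U y y := (h.smooth.continuous_fderiv two_ne_zero).clm_apply continuous_id
  have h3 : Continuous fun y => (1 / 2 : ℝ) • fderiv ℝ U y y := by
    simpa only [Pi.smul_def] using h2.const_smul (1 / 2 : ℝ)
  exact (continuous_finsetSum _ fun i _ => h.continuous_pd_pd i i).neg.add h3

theorem continuous_fderiv_gauss_smul_pd (i : Fin 3) :
    Continuous fun y => fderiv ℝ (fun x => gauss x • pd i U x) y (eI i) := by
  have : (fun y => fderiv ℝ (fun x => gauss x • pd i U x) y (eI i))
      = fun y => gauss y • pd i (pd i U) y + (-(gauss y / 2) * inner ℝ y (eI i)) • pd i U y := by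
    funext y; rw [h.fderiv_gauss_smul_pd_apply, inner_eI_right]
  rw [this]
  exact (continuous_gauss.smul (h.continuous_pd_pd i i)).add
    (((continuous_gauss.div_const 2).neg.mul (continuous_id.inner continuous_const)).smul (h.continuous_pd' i))


/-- **The `GaussAdmissible` records hold for PV-class profiles.** -/
theorem gaussAdmissible : GaussAdmissible U := by
  have hK := h.K_nonneg
  have cL := h.continuous_rotLie'
  refine ⟨fun i => ?_, fun i => ?_, fun i => ?_, fun i => ?_, ?_, ?_⟩
  · exact integrable_inner_gauss_smul_of_quad (h.continuous_pd_rotLie i) (h.continuous_pd' i)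
      (fun y => quad_of_lin (h.norm_pd_rotLie_le i y) (lin_of_const ‖y‖ (h.norm_pd_le' i y))
        (norm_nonneg _) (norm_nonneg _) hK (by positivity) le_rfl hK (norm_nonneg y))
  · refine integrable_of_quad_gauss_bound (cL.inner (h.continuous_fderiv_gauss_smul_pd i))
      (K := K * (K / 2) + K * K + K * (K / 2) + K * K) (fun y => ?_)
    calc |inner ℝ (rotLie U y) (fderiv ℝ (fun x => gauss x • pd i U x) y (eI i))|
        ≤ ‖rotLie U y‖ * ‖fderiv ℝ (fun x => gauss x • pd i U x) y (eI i)‖ := abs_real_inner_le_norm _ _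
      _ ≤ (K * ‖y‖ + K) * (gauss y * ((K / 2) * ‖y‖ + K)) :=
          mul_le_mul (h.norm_rotLie_le y) (h.norm_fderiv_gauss_smul_pd_le i y) (norm_nonneg _) (by positivity)
      _ = ((K * ‖y‖ + K) * ((K / 2) * ‖y‖ + K)) * gauss y := by ring
      _ ≤ ((K * (K / 2) + K * K + K * (K / 2) + K * K) * (1 + ‖y‖ ^ 2)) * gauss y :=
          mul_le_mul_of_nonneg_right (linlin_le hK hK (by positivity) hK (norm_nonneg y)) (gauss_pos y).le
      _ = _ := by ring
  · exact integrable_inner_gauss_smul_of_quad cL (h.continuous_pd' i)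
      (fun y => quad_of_lin (h.norm_rotLie_le y) (lin_of_const ‖y‖ (h.norm_pd_le' i y))
        (norm_nonneg _) (norm_nonneg _) hK hK le_rfl hK (norm_nonneg y))
  · exact integrable_inner_mul_gauss_of_quad (h.continuous_rotLie_pd i) (h.continuous_pd' i)
      (fun y => quad_of_lin (h.norm_rotLie_pd_le i y) (lin_of_const ‖y‖ (h.norm_pd_le' i y))
        (norm_nonneg _) (norm_nonneg _) hK hK le_rfl hK (norm_nonneg y))
  · exact integrable_inner_mul_gauss_of_quad cL h.smooth.continuous
      (fun y => quad_of_lin (h.norm_rotLie_le y) (lin_of_const ‖y‖ (h.b0 y))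
        (norm_nonneg _) (norm_nonneg _) hK hK le_rfl hK (norm_nonneg y))
  · exact integrable_norm_sq_mul_gauss_of_quad cL (fun y => by
      rw [sq]
      exact quad_of_lin (h.norm_rotLie_le y) (h.norm_rotLie_le y) (norm_nonneg _) (norm_nonneg _)
        hK hK hK hK (norm_nonneg y))

/-- **The `FluctAdmissible` records hold for PV-class profiles** (they do not involve `N`). -/
theorem fluctAdmissible (N : E3 → E3) : FluctAdmissible U N := by
  have hK := h.K_nonneg
  have hU1 : ContDiff ℝ 1 U := h.smooth.of_le one_le_two
  have hUc : Continuous U := h.smooth.continuous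
  have cL := h.continuous_rotLie'
  have hUa1 := contDiff_one_azimuthalMean hU1
  have hUn1 := contDiff_one_azFluct hU1
  have cUa : Continuous (azimuthalMean U) := hUa1.continuous
  have cUn : Continuous (azFluct U) := hUn1.continuous
  have cUn' : Continuous fun y => U y - azimuthalMean U y := hUc.sub cUa
  have cpdn : ∀ i, Continuous (pd i (azFluct U)) := fun i =>
    (hUn1.continuous_fderiv one_ne_zero).clm_apply continuous_const
  have cpda : ∀ i, Continuous (pd i (azimuthalMean U)) := fun i =>
    (hUa1.continuous_fderiv one_ne_zero).clm_apply continuous_const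
  have bUa : ∀ y, ‖azimuthalMean U y‖ ≤ K := norm_azimuthalMean_le h.b0
  have bUn : ∀ y, ‖azFluct U y‖ ≤ 2 * K := norm_azFluct_le h.b0
  have bUn' : ∀ y, ‖U y - azimuthalMean U y‖ ≤ 2 * K := bUn
  have bpdn : ∀ i y, ‖pd i (azFluct U) y‖ ≤ 2 * K := fun i y =>
    (norm_pd_le _ i y).trans (norm_fderiv_azFluct_le hU1 h.b1 y)
  have bpda : ∀ i y, ‖pd i (azimuthalMean U) y‖ ≤ K := fun i y =>
    (norm_pd_le _ i y).trans (norm_fderiv_azimuthalMean_le hU1 h.b1 y)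
  refine ⟨?_, ?_, ?_, ?_, ?_, fun i => ?_, fun i => ?_, fun i => ?_, fun i => ?_, fun i => ?_⟩
  · exact integrable_inner_mul_gauss_of_quad cL hUc
      (fun y => quad_of_lin (h.norm_rotLie_le y) (lin_of_const ‖y‖ (h.b0 y))
        (norm_nonneg _) (norm_nonneg _) hK hK le_rfl hK (norm_nonneg y))
  · exact integrable_inner_mul_gauss_of_quad cL cUa
      (fun y => quad_of_lin (h.norm_rotLie_le y) (lin_of_const ‖y‖ (bUa y))
        (norm_nonneg _) (norm_nonneg _) hK hK le_rfl hK (norm_nonneg y))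
  · exact integrable_inner_mul_gauss cUa cUn' bUa bUn'
  · exact integrable_norm_sq_mul_gauss cUn bUn
  · exact integrable_inner_mul_gauss_of_quad h.continuous_ouOp cUn
      (fun y => quad_of_lin (h.norm_ouOp_le y) (lin_of_const ‖y‖ (bUn y))
        (norm_nonneg _) (norm_nonneg _) (by positivity) (by positivity) le_rfl (by positivity) (norm_nonneg y))
  · exact integrable_inner_gauss_smul_of_quad (cpdn i) (h.continuous_pd' i)
      (fun y => quad_of_lin (lin_of_const ‖y‖ (bpdn i y)) (lin_of_const ‖y‖ (h.norm_pd_le' i y))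
        (norm_nonneg _) (norm_nonneg _) le_rfl (by positivity) le_rfl hK (norm_nonneg y))
  · refine integrable_of_quad_gauss_bound (cUn.inner (h.continuous_fderiv_gauss_smul_pd i))
      (K := 0 * (K / 2) + 0 * K + (2 * K) * (K / 2) + (2 * K) * K) (fun y => ?_)
    calc |inner ℝ (azFluct U y) (fderiv ℝ (fun x => gauss x • pd i U x) y (eI i))|
        ≤ ‖azFluct U y‖ * ‖fderiv ℝ (fun x => gauss x • pd i U x) y (eI i)‖ := abs_real_inner_le_norm _ _
      _ ≤ (0 * ‖y‖ + 2 * K) * (gauss y * ((K / 2) * ‖y‖ + K)) :=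
          mul_le_mul (lin_of_const ‖y‖ (bUn y)) (h.norm_fderiv_gauss_smul_pd_le i y) (norm_nonneg _)
            (by positivity)
      _ = ((0 * ‖y‖ + 2 * K) * ((K / 2) * ‖y‖ + K)) * gauss y := by ring
      _ ≤ ((0 * (K / 2) + 0 * K + (2 * K) * (K / 2) + (2 * K) * K) * (1 + ‖y‖ ^ 2)) * gauss y :=
          mul_le_mul_of_nonneg_right (linlin_le le_rfl (by positivity) (by positivity) hK (norm_nonneg y))
            (gauss_pos y).le
      _ = _ := by ring
  · exact integrable_inner_gauss_smul_of_quad cUn (h.continuous_pd' i)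
      (fun y => quad_of_lin (lin_of_const ‖y‖ (bUn y)) (lin_of_const ‖y‖ (h.norm_pd_le' i y))
        (norm_nonneg _) (norm_nonneg _) le_rfl (by positivity) le_rfl hK (norm_nonneg y))
  · exact integrable_inner_mul_gauss (cpdn i) (cpda i) (bpdn i) (bpda i)
  · exact integrable_norm_sq_mul_gauss (cpdn i) (bpdn i)

/-- The size of `N` forced by the profile equation. -/
theorem norm_N_le {α : ℝ} {N : E3 → E3}
    (hEq : ∀ y, -α • rotLie U y + (1 / 2 : ℝ) • U y + ouOp U y = N y) (y : E3) :
    ‖N y‖ ≤ (|α| * K + K / 2) * ‖y‖ + (|α| * K + K / 2 + 3 * K) := by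
  rw [← hEq y]
  have e1 : ‖-α • rotLie U y‖ ≤ |α| * (K * ‖y‖ + K) := by
    rw [norm_smul, norm_neg, Real.norm_eq_abs]
    exact mul_le_mul_of_nonneg_left (h.norm_rotLie_le y) (abs_nonneg _)
  have e2 : ‖(1 / 2 : ℝ) • U y‖ ≤ (1 / 2) * K := by
    rw [norm_smul, Real.norm_of_nonneg (by norm_num : (0:ℝ) ≤ 1 / 2)]
    exact mul_le_mul_of_nonneg_left (h.b0 y) (by norm_num)
  have e3 := h.norm_ouOp_le y
  calc ‖-α • rotLie U y + (1 / 2 : ℝ) • U y + ouOp U y‖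
      ≤ ‖-α • rotLie U y‖ + ‖(1 / 2 : ℝ) • U y‖ + ‖ouOp U y‖ := norm_add₃_le
    _ ≤ |α| * (K * ‖y‖ + K) + (1 / 2) * K + ((K / 2) * ‖y‖ + 3 * K) := by linarith
    _ = _ := by ring

end PVBounds

/-- Radial sup bound for the azimuthal mean: `‖V x‖ ≤ φ(‖x‖) ⇒ ‖⟨V⟩_θ(y)‖ ≤ φ(‖y‖)`. -/
theorem norm_azimuthalMean_le_radial {V : E3 → E3} {φ : ℝ → ℝ} (hφ : ∀ x, ‖V x‖ ≤ φ ‖x‖) (y : E3) :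
    ‖azimuthalMean V y‖ ≤ φ ‖y‖ := by
  have h0 : 0 ≤ φ ‖y‖ := (norm_nonneg _).trans (hφ y)
  unfold azimuthalMean
  rw [norm_smul]
  have h1 : ‖∫ θ in (0:ℝ)..2 * Real.pi, rotZ (-θ) (V (rotZ θ y))‖ ≤ φ ‖y‖ * |2 * Real.pi - 0| :=
    intervalIntegral.norm_integral_le_of_norm_le_const fun θ _ => by
      rw [norm_rotZ]; exact (hφ _).trans (by rw [norm_rotZ])
  rw [sub_zero, abs_of_pos Real.two_pi_pos] at h1
  rw [Real.norm_of_nonneg (by positivity)]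
  calc 1 / (2 * Real.pi) * ‖∫ θ in (0:ℝ)..2 * Real.pi, rotZ (-θ) (V (rotZ θ y))‖
      ≤ 1 / (2 * Real.pi) * (φ ‖y‖ * (2 * Real.pi)) := by gcongr
    _ = φ ‖y‖ := by field_simp

/-- **PV Proposition 6.5 with the fold number for PV-class profiles** (`PVBounds U K`, all integrability records discharged):
given (6.11), `k|α| ≥ 2(2C_ε + C_ε²) ⇒ |α| ‖L_rot U‖_γ ≤ 4ε`. -/
theorem pv_prop65_kfold_of_bounds {k : ℕ} (hk : 1 ≤ k) {U N : E3 → E3} {K : ℝ} (h : PVBounds U K)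
    (hN : ContDiff ℝ 1 N) (hsym : ∀ x, U (rotZ (2 * Real.pi / k) x) = rotZ (2 * Real.pi / k) (U x)) {α : ℝ}
    (hEq : ∀ y, -α • rotLie U y + (1 / 2 : ℝ) • U y + ouOp U y = N y) {ε C : ℝ} (hC : 0 ≤ C)
    (h611 : Real.sqrt (∫ y, ‖azFluct N y‖ ^ 2 * gauss y)
      ≤ ε + C * Real.sqrt (∫ y, ‖azFluct U y‖ ^ 2 * gauss y)
          + C * Real.sqrt (∑ i, ∫ y, ‖pd i (azFluct U) y‖ ^ 2 * gauss y))
    (hα : 2 * (2 * C + C ^ 2) / k ≤ |α|) :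
    |α| * Real.sqrt (∫ y, ‖rotLie U y‖ ^ 2 * gauss y) ≤ 4 * ε := by
  have hK := h.K_nonneg
  have hU1 : ContDiff ℝ 1 U := h.smooth.of_le one_le_two
  have hUc : Continuous U := h.smooth.continuous
  have hNc : Continuous N := hN.continuous
  have cL := h.continuous_rotLie'
  have cNa : Continuous (azimuthalMean N) := continuous_azimuthalMean hNc
  have cNn : Continuous (azFluct N) := hNc.sub cNa
  have cUa : Continuous (azimuthalMean U) := continuous_azimuthalMean hUc
  have cUn : Continuous (azFluct U) := hUc.sub cUa
  set a := |α| * K + K / 2 with ha_def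
  set b := |α| * K + K / 2 + 3 * K with hb_def
  have ha : 0 ≤ a := by positivity
  have hb : 0 ≤ b := by positivity
  have bN : ∀ y, ‖N y‖ ≤ a * ‖y‖ + b := h.norm_N_le hEq
  have bNa : ∀ y, ‖azimuthalMean N y‖ ≤ a * ‖y‖ + b :=
    norm_azimuthalMean_le_radial (φ := fun r => a * r + b) bN
  have bNn : ∀ y, ‖azFluct N y‖ ≤ (2 * a) * ‖y‖ + 2 * b := fun y => by
    rw [azFluct_apply]
    exact (norm_sub_le _ _).trans (by have := bN y; have := bNa y; linarith)
  have bUn : ∀ y, ‖U y - azimuthalMean U y‖ ≤ 2 * K := norm_azFluct_le h.b0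
  have iNa : Integrable fun y => inner ℝ (rotLie U y) (azimuthalMean N y) * gauss y :=
    integrable_inner_mul_gauss_of_quad cL cNa (fun y => quad_of_lin (h.norm_rotLie_le y) (bNa y)
      (norm_nonneg _) (norm_nonneg _) hK hK ha hb (norm_nonneg y))
  have iNn : Integrable fun y => inner ℝ (azFluct N y) (rotLie U y) * gauss y :=
    integrable_inner_mul_gauss_of_quad cNn cL (fun y => quad_of_lin (bNn y) (h.norm_rotLie_le y)
      (norm_nonneg _) (norm_nonneg _) (by positivity) (by positivity) hK hK (norm_nonneg y))
  have iNa' : Integrable fun y => inner ℝ (azimuthalMean N y) (U y - azimuthalMean U y) * gauss y :=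
    integrable_inner_mul_gauss_of_quad cNa (hUc.sub cUa) (fun y => quad_of_lin (bNa y) (lin_of_const ‖y‖ (bUn y))
      (norm_nonneg _) (norm_nonneg _) ha hb le_rfl (by positivity) (norm_nonneg y))
  have iNn' : Integrable fun y => inner ℝ (azFluct N y) (azFluct U y) * gauss y :=
    integrable_inner_mul_gauss_of_quad cNn cUn (fun y => quad_of_lin (bNn y) (lin_of_const ‖y‖ (bUn y))
      (norm_nonneg _) (norm_nonneg _) (by positivity) (by positivity) le_rfl (by positivity) (norm_nonneg y))
  have iM : Integrable fun y => ‖azFluct N y‖ ^ 2 * gauss y :=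
    integrable_norm_sq_mul_gauss_of_quad cNn (fun y => by
      rw [sq]
      exact quad_of_lin (bNn y) (bNn y) (norm_nonneg _) (norm_nonneg _)
        (by positivity) (by positivity) (by positivity) (by positivity) (norm_nonneg y))
  exact pv_prop65_kfold hk h.smooth hN hsym hEq h.gaussAdmissible (h.fluctAdmissible N) iNa iNn iNa' iNn' iM
    hC h611 hα


end Records

/-! ### Dictionary to the route statement `CoriolisHead.NoCoRotatingCore` (ν = 1, a = ½ normalisation):
Mathlib's Laplacian on `E3` is the coordinate one, `ouOp = −Δ + ½ y·∇`, the Coriolis term for `B = β J` is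
`−β L_rot U`, and the defect functional `Σ_l (B ∂_l U)_l` is `−β ω_z`. -/

section Dictionary

/-- On `ℝ³ = EuclideanSpace ℝ (Fin 3)`, Mathlib's Laplacian of a `C²` field is `Σ_i ∂_i∂_i`. -/
theorem laplacian_eq_sum_pd_pd {U : E3 → E3} (hU : ContDiff ℝ 2 U) (y : E3) :
    Laplacian.laplacian U y = ∑ i, pd i (pd i U) y := by
  rw [InnerProductSpace.laplacian_eq_iteratedFDeriv_orthonormalBasis U (EuclideanSpace.basisFun (Fin 3) ℝ)]
  simp only [iteratedFDeriv_two_apply, EuclideanSpace.basisFun_apply, Matrix.cons_val_zero, Matrix.cons_val_one]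
  refine Finset.sum_congr rfl fun i _ => ?_
  have hd : DifferentiableAt ℝ (fderiv ℝ U) y :=
    ((hU.fderiv_right (m := 1) (by norm_num)).differentiable one_ne_zero) y
  have hpd : pd i (pd i U) y = fderiv ℝ (fun x => fderiv ℝ U x (eI i)) y (eI i) := rfl
  rw [hpd, fderiv_clm_apply hd (differentiableAt_const _)]
  simp [eI]

/-- `ouOp U = −ΔU + ½ (y·∇)U` with Mathlib's Laplacian. -/
theorem ouOp_eq_laplacian {U : E3 → E3} (hU : ContDiff ℝ 2 U) (y : E3) :
    ouOp U y = -(Laplacian.laplacian U y) + (1 / 2 : ℝ) • fderiv ℝ U y y := by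
  rw [laplacian_eq_sum_pd_pd hU]; rfl

/-- For the frame rotation `B = β J` the Coriolis term of `NoCoRotatingCore` is `−β L_rot U`. -/
theorem coriolis_term_eq (β : ℝ) (U : E3 → E3) (y : E3) :
    (β • rotGenL) (U y) - fderiv ℝ U y ((β • rotGenL) y) = -β • rotLie U y := by
  simp only [FunLike.coe_smul, Pi.smul_apply, rotGenL_apply, map_smul, rotLie]
  rw [smul_sub, neg_smul, neg_smul]
  abel

/-- `B = β J` is skew. -/
theorem inner_smul_rotGenL_self (β : ℝ) (x : E3) : inner ℝ ((β • rotGenL) x) x = 0 := by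
  simp only [FunLike.coe_smul, Pi.smul_apply, rotGenL_apply, real_inner_smul_left,
    inner_rotGen_left]
  ring

/-- The defect functional of `NoCoRotatingCore` for `B = β J` is `−β ω_z = β (∂₁U₀ − ∂₀U₁)`. -/
theorem defect_eq_vorticity (β : ℝ) (U : E3 → E3) (y : E3) :
    ∑ l, ((β • rotGenL) (fderiv ℝ U y (EuclideanSpace.single l 1))) l
      = β * ((pd 1 U y) 0 - (pd 0 U y) 1) := by
  simp only [Fin.sum_univ_three, FunLike.coe_smul, Pi.smul_apply, rotGenL_apply,
    PiLp.smul_apply, smul_eq_mul, pd, eI, rotGen_apply_zero, rotGen_apply_one, rotGen_apply_two]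
  ring

/-- The `NoCoRotatingCore` equation with `ν = 1`, `a = ½`, `B = β J` is PV's (6.16a) in our notation:
`−β L_rot U + ½U + ouOp U = −(U·∇U + ∇P)`. -/
theorem noCoRotatingCore_eq_iff {U : E3 → E3} (hU : ContDiff ℝ 2 U) (β : ℝ) (P : E3 → ℝ) (y : E3) :
    (-((1 : ℝ) • Laplacian.laplacian U y) + (1 / 2 : ℝ) • U y + (1 / 2 : ℝ) • fderiv ℝ U y y
        + ((β • rotGenL) (U y) - fderiv ℝ U y ((β • rotGenL) y)) + convect U U y + gradient P y = 0)
      ↔ (-β • rotLie U y + (1 / 2 : ℝ) • U y + ouOp U y = -(convect U U y + gradient P y)) := by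
  rw [coriolis_term_eq, ouOp_eq_laplacian hU, one_smul]
  constructor
  · intro h
    have := eq_neg_of_add_eq_zero_left (by
      calc (-β • rotLie U y + (1 / 2 : ℝ) • U y + (-(Laplacian.laplacian U y) + (1 / 2 : ℝ) • fderiv ℝ U y y))
            + (convect U U y + gradient P y)
          = -(Laplacian.laplacian U y) + (1 / 2 : ℝ) • U y + (1 / 2 : ℝ) • fderiv ℝ U y y
            + -β • rotLie U y + convect U U y + gradient P y := by abel
        _ = 0 := h)
    exact this
  · intro h
    calc -(Laplacian.laplacian U y) + (1 / 2 : ℝ) • U y + (1 / 2 : ℝ) • fderiv ℝ U y y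
          + -β • rotLie U y + convect U U y + gradient P y
        = (-β • rotLie U y + (1 / 2 : ℝ) • U y + (-(Laplacian.laplacian U y) + (1 / 2 : ℝ) • fderiv ℝ U y y))
          + (convect U U y + gradient P y) := by abel
      _ = 0 := by rw [h]; abel

end Dictionary




end TwistedCircle


/-! ### Skeleton (UNREGISTERED; NOT a line): the open inputs of RUNG K(k) typed faithfully to PV and α-uniformly, and the
kernel-checked compositions to the (restated) rung `KFoldExtremeRotationPV`. See the module header and `AlphaMShiftRungs.md`. -/

section SkeletonSection

open Literature.Analysis.FluidPDE

namespace Skeleton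

/-- Verbatim restatement of `AlphaMShiftRungs.lean`'s `IsPVProfile` (the Pineau–Vicol-frame profile system at
rate `α`, shape of `hPV` in `Theorems.CoriolisHead.decayingRotatedLiouville_of_pineauVicolFrame`). -/
def IsPVProfile (α : ℝ) (U : E3 → E3) (P : E3 → ℝ) : Prop :=
  ContDiff ℝ (⊤ : ℕ∞) U ∧ ContDiff ℝ 2 P ∧ Literature.Analysis.FluidPDE.VectorCalculus.IsDivFree U ∧
    ∀ y, α • (rotGen (U y) - fderiv ℝ U y (rotGen y)) + (1 / 2 : ℝ) • U y
      + (1 / 2 : ℝ) • fderiv ℝ U y y - Laplacian.laplacian U y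
      + Literature.Analysis.FluidPDE.convect U U y + gradient P y = 0

/-- Verbatim restatement of `AlphaMShiftRungs.lean`'s `IsKFoldSymmetric`. -/
def IsKFoldSymmetric (k : ℕ) (U : E3 → E3) : Prop :=
  ∀ y, U (rotZ (2 * Real.pi / k) y) = rotZ (2 * Real.pi / k) (U y)

/-- Verbatim restatement of `AlphaMShiftRungs.lean`'s `KFoldExtremeRotationPV` (RUNG K(k)) — PROVED in the tree since 2026-08-28T17:22Z
(p652397, `Theorems.CoriolisHead.kFoldExtremeRotation_liouville`, prover ns-ffc-k1 g4: a k-fold symmetric α-RSS field is c-DSS with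
c = e^{π/(k|α|)}, then Chae–Wolf 2017 Thm 1.3; none of the PV §6 inputs below is used) — see `kFoldExtremeRotationPV_holds`. -/
def KFoldExtremeRotationPV : Prop :=
  ∀ K : ℝ, 0 < K → ∃ A : ℝ, 0 < A ∧
    ∀ (k : ℕ) (α : ℝ) (U : E3 → E3) (P : E3 → ℝ), 1 ≤ k →
      IsPVProfile α U P → (∀ y, ‖U y‖ ≤ K / (1 + ‖y‖)) → IsKFoldSymmetric k U →
      A ≤ k * |α| → ∀ y, U y = 0

/-- PV's nonlinearity (6.10)/(6.16a): `N = −((U·∇)U + ∇P)`. -/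
noncomputable def pvN (U : E3 → E3) (P : E3 → ℝ) : E3 → E3 := fun y => -(convect U U y + gradient P y)

/-- PV (2.1): Type-I bounds for the first two derivatives. -/
def PVDecay12 (K₁ K₂ : ℝ) (U : E3 → E3) : Prop :=
  ∀ y, ‖fderiv ℝ U y‖ ≤ K₁ / (1 + ‖y‖ ^ 2) ∧ ‖fderiv ℝ (fderiv ℝ U) y‖ ≤ K₂ / (1 + ‖y‖ ^ 3)

/-- **[d] PV Lemma 2.1, (2.1), in the profile frame, α-uniform (OPEN INPUT):** ∀K ∃K₁K₂ (depending on K only) bounding ∇U, ∇²U of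
EVERY profile at EVERY α with (1.9)_K [arXiv:2607.09619 Lemma 2.1: ansatz (1.7) + NS ε-regularity; heavy in Lean]. -/
def PVLemma21 : Prop :=
  ∀ K : ℝ, 0 < K → ∃ K₁ K₂ : ℝ, ∀ (α : ℝ) (U : E3 → E3) (P : E3 → ℝ),
    IsPVProfile α U P → (∀ y, ‖U y‖ ≤ K / (1 + ‖y‖)) → PVDecay12 K₁ K₂ U

/-- **[a] PV Lemma 6.3, (6.11), in L²_γ** (∀(K,K₁,K₂) ∀ε∈(0,1] ∃C_ε ∀(α,U,P)): `‖(N)_a‖_γ ≤ ε + C_ε(‖(U)_a‖_γ + ‖∇(U)_a‖_γ)`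
[arXiv:2607.09619 Lemma 6.3]; PROVED below from [a-p] (`pvLemma63_of_pressure`, convective half = `pv612_convective`). -/
def PVLemma63 : Prop :=
  ∀ K K₁ K₂ : ℝ, 0 < K → ∀ ε : ℝ, 0 < ε → ε ≤ 1 → ∃ C : ℝ, 0 ≤ C ∧
    ∀ (α : ℝ) (U : E3 → E3) (P : E3 → ℝ), IsPVProfile α U P → (∀ y, ‖U y‖ ≤ K / (1 + ‖y‖)) →
      PVDecay12 K₁ K₂ U →
      Real.sqrt (∫ y, ‖azFluct (pvN U P) y‖ ^ 2 * gauss y)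
        ≤ ε + C * Real.sqrt (∫ y, ‖azFluct U y‖ ^ 2 * gauss y)
            + C * Real.sqrt (∑ i, ∫ y, ‖pd i (azFluct U) y‖ ^ 2 * gauss y)

/-- **[b] PV §6.5 endgame:** `∃ ε₀(K,K₁,K₂) > 0`, `|α| ‖L_rot U‖_γ ≤ ε₀ ⇒ U ≡ 0` for profiles with (1.9), (2.1)
[arXiv:2607.09619 §6.5]; PROVED below from [b1] + [b2] (`pvEndgame_of`); α = 0 is inside (Tsai). -/
def PVEndgame : Prop :=
  ∀ K K₁ K₂ : ℝ, 0 < K → ∃ ε₀ : ℝ, 0 < ε₀ ∧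
    ∀ (α : ℝ) (U : E3 → E3) (P : E3 → ℝ), IsPVProfile α U P → (∀ y, ‖U y‖ ≤ K / (1 + ‖y‖)) →
      PVDecay12 K₁ K₂ U →
      |α| * Real.sqrt (∫ y, ‖rotLie U y‖ ^ 2 * gauss y) ≤ ε₀ → ∀ y, U y = 0

/-- `C³ ⇒ AU ∈ C¹`. -/
theorem contDiff_ouOp {U : E3 → E3} (hU : ContDiff ℝ 3 U) : ContDiff ℝ 1 (ouOp U) := by
  have h2 : ContDiff ℝ 2 (fderiv ℝ U) := hU.fderiv_right (m := 2) (by norm_num)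
  have hpd : ∀ i, ContDiff ℝ 2 (pd i U) := fun i => h2.clm_apply contDiff_const
  have hpdpd : ∀ i j, ContDiff ℝ 1 (pd i (pd j U)) := fun i j =>
    ((hpd j).fderiv_right (m := 1) (by norm_num)).clm_apply contDiff_const
  have hyy : ContDiff ℝ 1 (fun y => fderiv ℝ U y y) := (h2.of_le (by norm_num)).clm_apply contDiff_id
  have hs : ContDiff ℝ 1 (fun y => ∑ i, pd i (pd i U) y) := ContDiff.sum fun i _ => hpdpd i i
  have hsm : ContDiff ℝ 1 (fun y => (1 / 2 : ℝ) • fderiv ℝ U y y) := by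
    simpa only [Pi.smul_def] using hyy.const_smul (1 / 2 : ℝ)
  have : ouOp U = fun y => -(∑ i, pd i (pd i U) y) + (1 / 2 : ℝ) • fderiv ℝ U y y := rfl
  rw [this]
  exact hs.neg.add hsm

/-- The profile equation in the form (6.16a) used by the toolkit. -/
theorem pv_eq_of_isPVProfile {α : ℝ} {U : E3 → E3} {P : E3 → ℝ} (h : IsPVProfile α U P) (y : E3) :
    -α • rotLie U y + (1 / 2 : ℝ) • U y + ouOp U y = pvN U P y := by
  obtain ⟨hU, -, -, heq⟩ := h
  have hU2 : ContDiff ℝ 2 U := hU.of_le (by norm_cast)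
  have e := heq y
  have hr : -α • rotLie U y = α • (rotGen (U y) - fderiv ℝ U y (rotGen y)) := by
    rw [rotLie, smul_sub, smul_sub, neg_smul, neg_smul]; abel
  rw [ouOp_eq_laplacian hU2, hr]
  simp only [pvN]
  rw [eq_neg_iff_add_eq_zero, ← e]
  abel

/-- Sup bounds from the Type-I bounds: `PVBounds U (max K (max K₁ K₂))`. -/
theorem pvBounds_of_decay {α : ℝ} {U : E3 → E3} {P : E3 → ℝ} (h : IsPVProfile α U P) {K K₁ K₂ : ℝ} (hK : 0 < K)
    (h0 : ∀ y, ‖U y‖ ≤ K / (1 + ‖y‖)) (h12 : PVDecay12 K₁ K₂ U) : PVBounds U (max K (max K₁ K₂)) := by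
  have hU2 : ContDiff ℝ 2 U := h.1.of_le (by norm_cast)
  have hK₁ : 0 ≤ K₁ := by
    have := (h12 0).1; rw [norm_zero] at this; norm_num at this
    exact (norm_nonneg (fderiv ℝ U 0)).trans this
  have hK₂ : 0 ≤ K₂ := by
    have := (h12 0).2; rw [norm_zero] at this; norm_num at this
    exact (norm_nonneg (fderiv ℝ (fderiv ℝ U) 0)).trans this
  refine ⟨hU2, fun y => ?_, fun y => ?_, fun y => ?_⟩
  · exact ((h0 y).trans (div_le_self hK.le (by linarith [norm_nonneg y]))).trans (le_max_left _ _)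
  · exact (((h12 y).1).trans (div_le_self hK₁ (by nlinarith [norm_nonneg y]))).trans
      ((le_max_left _ _).trans (le_max_right _ _))
  · exact (((h12 y).2).trans (div_le_self hK₂ (by nlinarith [norm_nonneg y, sq_nonneg ‖y‖]))).trans
      ((le_max_right _ _).trans (le_max_right _ _))

/-- **The composition (kernel-checked): [d] + [a] + [b] ⇒ RUNG K(k)**, via `pv_prop65_kfold_of_bounds`. -/
theorem kFoldExtremeRotationPV_of (hd : PVLemma21) (ha : PVLemma63) (hb : PVEndgame) :
    KFoldExtremeRotationPV := by
  intro K hK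
  obtain ⟨K₁, K₂, h21⟩ := hd K hK
  obtain ⟨ε₀, hε₀, hend⟩ := hb K K₁ K₂ hK
  set ε : ℝ := min 1 (ε₀ / 4) with hε_def
  have hε : 0 < ε := lt_min one_pos (by linarith)
  have hε1 : ε ≤ 1 := min_le_left _ _
  have hε4 : 4 * ε ≤ ε₀ := by have := min_le_right 1 (ε₀ / 4); linarith
  obtain ⟨C, hC, h63⟩ := ha K K₁ K₂ hK ε hε hε1
  refine ⟨max 1 (2 * (2 * C + C ^ 2)), lt_max_of_lt_left one_pos, ?_⟩
  intro k α U P hk hprof hdec hsym hA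
  have hk0 : (0 : ℝ) < k := by exact_mod_cast hk
  have h12 : PVDecay12 K₁ K₂ U := h21 α U P hprof hdec
  have hPVB := pvBounds_of_decay hprof hK hdec h12
  have hEq : ∀ y, -α • rotLie U y + (1 / 2 : ℝ) • U y + ouOp U y = pvN U P y :=
    pv_eq_of_isPVProfile hprof
  have hU3 : ContDiff ℝ 3 U := hprof.1.of_le (by norm_cast)
  have hN : ContDiff ℝ 1 (pvN U P) := by
    have : pvN U P = fun y => -α • rotLie U y + (1 / 2 : ℝ) • U y + ouOp U y := funext fun y => (hEq y).symm
    rw [this]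
    have h1 : ContDiff ℝ 1 (rotLie U) := contDiff_rotLie (hU3.of_le (by norm_num))
    have h1' : ContDiff ℝ 1 (fun y => -α • rotLie U y) := by
      simpa only [Pi.smul_def] using h1.const_smul (-α)
    have h2' : ContDiff ℝ 1 (fun y => (1 / 2 : ℝ) • U y) := by
      simpa only [Pi.smul_def] using (hU3.of_le (by norm_num) : ContDiff ℝ 1 U).const_smul (1 / 2 : ℝ)
    exact (h1'.add h2').add (contDiff_ouOp hU3)
  have h611 := h63 α U P hprof hdec h12
  have hα : 2 * (2 * C + C ^ 2) / k ≤ |α| := by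
    rw [div_le_iff₀ hk0, mul_comm |α|]
    exact (le_max_right _ _).trans hA
  have hmain := pv_prop65_kfold_of_bounds hk hPVB hN (fun x => hsym x) hEq hC h611 hα
  exact hend α U P hprof hdec h12 (hmain.trans hε4)


/-! #### Sharpening [a] to its pressure half. -/

theorem rotZ_neg_vec (θ : ℝ) (x : E3) : rotZ θ (-x) = -rotZ θ x := by
  rw [← neg_one_smul ℝ x, rotZ_smul_vec, neg_one_smul]

theorem azimuthalMean_neg (V : E3 → E3) (y : E3) : azimuthalMean (fun x => -V x) y = -azimuthalMean V y := by
  unfold azimuthalMean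
  simp_rw [rotZ_neg_vec]
  rw [intervalIntegral.integral_neg, smul_neg]

theorem azFluct_neg (V : E3 → E3) (y : E3) : azFluct (fun x => -V x) y = -azFluct V y := by
  rw [azFluct_apply, azFluct_apply, azimuthalMean_neg]; abel

theorem azFluct_add {V W : E3 → E3} (hV : Continuous V) (hW : Continuous W) (y : E3) :
    azFluct (fun x => V x + W x) y = azFluct V y + azFluct W y := by
  rw [azFluct_apply, azFluct_apply, azFluct_apply, azimuthalMean_add hV hW]; abel

theorem continuous_gradient {P : E3 → ℝ} (hP : ContDiff ℝ 2 P) : Continuous (gradient P) := by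
  have : gradient P = fun y => (InnerProductSpace.toDual ℝ E3).symm (fderiv ℝ P y) := rfl
  rw [this]
  exact (InnerProductSpace.toDual ℝ E3).symm.continuous.comp (hP.continuous_fderiv (by norm_num))

/-- **[a-p] The pressure half of PV Lemma 6.3, (6.13)–(6.15):** `‖(∇P)_a‖_γ ≤ ε + C_ε(‖(U)_a‖_γ + ‖∇(U)_a‖_γ)` for profiles
with (1.9), (2.1) [arXiv:2607.09619 (6.13)–(6.15)]; PROVED below from [a-r] (`pvPressure63_of_riesz`). -/
def PVPressure63 : Prop :=
  ∀ K K₁ K₂ : ℝ, 0 < K → ∀ ε : ℝ, 0 < ε → ε ≤ 1 → ∃ C : ℝ, 0 ≤ C ∧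
    ∀ (α : ℝ) (U : E3 → E3) (P : E3 → ℝ), IsPVProfile α U P → (∀ y, ‖U y‖ ≤ K / (1 + ‖y‖)) →
      PVDecay12 K₁ K₂ U →
      Real.sqrt (∫ y, ‖azFluct (gradient P) y‖ ^ 2 * gauss y)
        ≤ ε + C * Real.sqrt (∫ y, ‖azFluct U y‖ ^ 2 * gauss y)
            + C * Real.sqrt (∑ i, ∫ y, ‖pd i (azFluct U) y‖ ^ 2 * gauss y)

/-- **[a] = (6.12) (proved: `pv612_convective`) + [a-p]:** `PVPressure63 → PVLemma63`, with `C_ε ↦ C_ε + K₁ + 3K`. -/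
theorem pvLemma63_of_pressure (hp : PVPressure63) : PVLemma63 := by
  intro K K₁ K₂ hK ε hε hε1
  obtain ⟨C, hC, h⟩ := hp K K₁ K₂ hK ε hε hε1
  refine ⟨C + max K₁ 0 + 3 * K, by positivity, ?_⟩
  intro α U P hprof hdec h12
  have hPVB := pvBounds_of_decay hprof hK hdec h12
  have hK'0 : 0 ≤ max K (max K₁ K₂) := hPVB.K_nonneg
  have hU1 : ContDiff ℝ 1 U := hprof.1.of_le (by norm_cast)
  have hUc : Continuous U := hU1.continuous
  have hK₁ : 0 ≤ K₁ := by
    have := (h12 0).1; rw [norm_zero] at this; norm_num at this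
    exact (norm_nonneg (fderiv ℝ U 0)).trans this
  have b0 : ∀ y, ‖U y‖ ≤ K := fun y => (hdec y).trans (div_le_self hK.le (by linarith [norm_nonneg y]))
  have b1 : ∀ y, ‖fderiv ℝ U y‖ ≤ K₁ := fun y =>
    ((h12 y).1).trans (div_le_self hK₁ (by nlinarith [norm_nonneg y]))
  have conv := pv612_convective hU1 b0 b1
  have press := h α U P hprof hdec h12
  have hEq := pv_eq_of_isPVProfile hprof
  have cconv : Continuous (convect U U) := continuous_convect_of_contDiff hUc hU1
  have cgrad : Continuous (gradient P) := continuous_gradient hprof.2.1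
  have hsplit : ∀ y, azFluct (pvN U P) y = -(azFluct (convect U U) y + azFluct (gradient P) y) := by
    intro y
    have : pvN U P = fun x => -((fun z => convect U U z + gradient P z) x) := rfl
    rw [this, azFluct_neg, azFluct_add cconv cgrad]
  have cf : Continuous (azFluct (convect U U)) := cconv.sub (continuous_azimuthalMean cconv)
  have cg : Continuous (azFluct (gradient P)) := cgrad.sub (continuous_azimuthalMean cgrad)
  have bconv : ∀ y, ‖convect U U y‖ ≤ K₁ * K := fun y =>
    (ContinuousLinearMap.le_opNorm _ _).trans (mul_le_mul (b1 y) (b0 y) (norm_nonneg _) hK₁)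
  have bf : ∀ y, ‖azFluct (convect U U) y‖ ≤ 2 * (K₁ * K) := norm_azFluct_le bconv
  have iF : Integrable fun y => ‖azFluct (convect U U) y‖ ^ 2 * gauss y := integrable_norm_sq_mul_gauss cf bf
  set K' := max K (max K₁ K₂) with hK'
  have bgrad : ∀ y, ‖gradient P y‖
      ≤ (|α| * K' + K' / 2) * ‖y‖ + (|α| * K' + K' / 2 + 3 * K' + K₁ * K) := by
    intro y
    have e : gradient P y = -(pvN U P y) - convect U U y := by simp only [pvN]; abel
    rw [e]
    have h1 := hPVB.norm_N_le hEq y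
    have h2 := bconv y
    calc ‖-(pvN U P y) - convect U U y‖ ≤ ‖-(pvN U P y)‖ + ‖convect U U y‖ := norm_sub_le _ _
      _ ≤ _ := by rw [norm_neg]; linarith
  have bg : ∀ y, ‖azFluct (gradient P) y‖
      ≤ (2 * (|α| * K' + K' / 2)) * ‖y‖ + 2 * (|α| * K' + K' / 2 + 3 * K' + K₁ * K) := by
    intro y
    have hm := norm_azimuthalMean_le_radial
      (φ := fun r => (|α| * K' + K' / 2) * r + (|α| * K' + K' / 2 + 3 * K' + K₁ * K)) bgrad y
    beta_reduce at hm
    rw [azFluct_apply]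
    exact (norm_sub_le _ _).trans (by have := bgrad y; linarith)
  have iG : Integrable fun y => ‖azFluct (gradient P) y‖ ^ 2 * gauss y :=
    integrable_norm_sq_mul_gauss_of_quad cg (fun y => by
      rw [sq]
      exact quad_of_lin (bg y) (bg y) (norm_nonneg _) (norm_nonneg _) (by positivity) (by positivity)
        (by positivity) (by positivity) (norm_nonneg y))
  have htri := weighted_L2_triangle cf cg continuous_gauss.measurable (fun y => (gauss_pos y).le) iF iG
  have hN : (fun y => ‖azFluct (pvN U P) y‖ ^ 2 * gauss y)
      = fun y => ‖azFluct (convect U U) y + azFluct (gradient P) y‖ ^ 2 * gauss y := by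
    funext y; rw [hsplit y, norm_neg]
  rw [hN]
  have hb : 0 ≤ Real.sqrt (∫ y, ‖azFluct U y‖ ^ 2 * gauss y) := Real.sqrt_nonneg _
  have hc : 0 ≤ Real.sqrt (∑ i, ∫ y, ‖pd i (azFluct U) y‖ ^ 2 * gauss y) := Real.sqrt_nonneg _
  have m1 : K₁ * Real.sqrt (∫ y, ‖azFluct U y‖ ^ 2 * gauss y)
      ≤ max K₁ 0 * Real.sqrt (∫ y, ‖azFluct U y‖ ^ 2 * gauss y) := mul_le_mul_of_nonneg_right (le_max_left _ _) hb
  have m2 : 0 ≤ max K₁ 0 * Real.sqrt (∑ i, ∫ y, ‖pd i (azFluct U) y‖ ^ 2 * gauss y) :=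
    mul_nonneg (le_max_right _ _) hc
  have m3 : 0 ≤ 3 * K * Real.sqrt (∫ y, ‖azFluct U y‖ ^ 2 * gauss y) := by positivity
  calc Real.sqrt (∫ y, ‖azFluct (convect U U) y + azFluct (gradient P) y‖ ^ 2 * gauss y)
      ≤ Real.sqrt (∫ y, ‖azFluct (convect U U) y‖ ^ 2 * gauss y)
          + Real.sqrt (∫ y, ‖azFluct (gradient P) y‖ ^ 2 * gauss y) := htri
    _ ≤ (K₁ * Real.sqrt (∫ y, ‖azFluct U y‖ ^ 2 * gauss y)
          + 3 * K * Real.sqrt (∑ i, ∫ y, ‖pd i (azFluct U) y‖ ^ 2 * gauss y))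
        + (ε + C * Real.sqrt (∫ y, ‖azFluct U y‖ ^ 2 * gauss y)
          + C * Real.sqrt (∑ i, ∫ y, ‖pd i (azFluct U) y‖ ^ 2 * gauss y)) := add_le_add conv press
    _ ≤ _ := by nlinarith [m1, m2, m3, hb, hc, hK.le, hC]

/-- **RUNG K(k) from the three genuinely open inputs: PV Lemma 2.1, the PRESSURE half of Lemma 6.3, and the §6.5
endgame** (everything else — (6.9)_k, (6.12), (6.17)_k–(6.19), Prop. 6.5_k, the records — is proved in this file). -/
theorem kFoldExtremeRotationPV_of_pressure (hd : PVLemma21) (hp : PVPressure63) (hb : PVEndgame) :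
    KFoldExtremeRotationPV :=
  kFoldExtremeRotationPV_of hd (pvLemma63_of_pressure hp) hb


/-! #### Sharpening [a-p] to its Calderón–Zygmund kernel: PV (6.14)–(6.15) are elementary given (6.13). -/

/-- `(1 + |y|)^{-4}` is integrable on `ℝ³`. -/
theorem integrable_one_add_norm_pow_four_inv :
    Integrable (fun y : E3 => ((1 + ‖y‖) ^ 4)⁻¹) volume := by
  have h : Integrable (fun y : E3 => (1 + ‖y‖) ^ (-(4 : ℝ))) volume :=
    integrable_one_add_norm (by rw [finrank_euclideanSpace_fin]; norm_num)
  refine h.congr (Filter.Eventually.of_forall fun y => ?_)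
  show (1 + ‖y‖) ^ (-(4 : ℝ)) = ((1 + ‖y‖) ^ 4)⁻¹
  rw [Real.rpow_neg (by positivity), ← Real.rpow_natCast]
  norm_num

theorem sqrt_le_of_sq_bound {A x b z : ℝ} (hx : 0 ≤ x) (hb : 0 ≤ b) (hz : 0 ≤ z)
    (h : A ≤ x ^ 2 * b + z ^ 2) : Real.sqrt A ≤ x * Real.sqrt b + z := by
  have hs : 0 ≤ x * Real.sqrt b + z := by positivity
  have hsb := Real.sq_sqrt hb
  have h2 : x ^ 2 * b + z ^ 2 ≤ (x * Real.sqrt b + z) ^ 2 := by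
    nlinarith [Real.sqrt_nonneg b, mul_nonneg (mul_nonneg hx (Real.sqrt_nonneg b)) hz]
  calc Real.sqrt A ≤ Real.sqrt ((x * Real.sqrt b + z) ^ 2) := Real.sqrt_le_sqrt (h.trans h2)
    _ = x * Real.sqrt b + z := Real.sqrt_sq hs

/-- **[a-r] The Calderón–Zygmund kernel of the pressure estimate (OPEN INPUT):** PV (6.13) + `R_iR_j` bounded on L²(ℝ³) + μ ≤ 1:
`‖(∇P)_a‖_{L²_γ} ≤ ‖((U·∇)U)_a‖_{L²(ℝ³)}` for profiles with (1.9), (2.1) (P = R_iR_j(U_iU_j) + c, PV Lemma 2.1 / (2.2)); no Riesz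
transforms in Mathlib. -/
def PVRieszPressure : Prop :=
  ∀ (K K₁ K₂ α : ℝ) (U : E3 → E3) (P : E3 → ℝ), IsPVProfile α U P → (∀ y, ‖U y‖ ≤ K / (1 + ‖y‖)) →
    PVDecay12 K₁ K₂ U →
    Real.sqrt (∫ y, ‖azFluct (gradient P) y‖ ^ 2 * gauss y) ≤ Real.sqrt (∫ y, ‖azFluct (convect U U) y‖ ^ 2)

set_option maxHeartbeats 1600000 in
/-- **PV (6.14)–(6.15) proved: `PVRieszPressure → PVPressure63`** (V = ((U·∇)U)_a, |V| ≤ 4KK₁(1+|y|)⁻³; pointwise split at |y| = L: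
‖V‖²_{L²} ≤ e^{L²/4}‖V‖²_{L²_γ} + 16K²K₁²L⁻²∫(1+|y|)⁻⁴; then (6.12) and L = L_ε). -/
theorem pvPressure63_of_riesz (hr : PVRieszPressure) : PVPressure63 := by
  intro K K₁ K₂ hK ε hε hε1
  obtain ⟨I4, hI4⟩ : ∃ I : ℝ, I = ∫ y : E3, ((1 + ‖y‖) ^ 4)⁻¹ := ⟨_, rfl⟩
  have hI4_nn : 0 ≤ I4 := by rw [hI4]; exact integral_nonneg fun y => by positivity
  obtain ⟨T, hT⟩ : ∃ T : ℝ, T = 4 * K * max K₁ 0 * Real.sqrt I4 := ⟨_, rfl⟩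
  have hT0 : 0 ≤ T := by rw [hT]; positivity
  obtain ⟨L, hL⟩ : ∃ L : ℝ, L = max 1 (T / ε) := ⟨_, rfl⟩
  have hL1 : 1 ≤ L := hL ▸ le_max_left _ _
  have hL0 : 0 < L := by linarith
  have hTL : T / L ≤ ε := by
    rw [div_le_iff₀ hL0]
    have h1 : T / ε ≤ L := hL ▸ le_max_right _ _
    rw [div_le_iff₀ hε] at h1
    linarith [mul_comm L ε]
  refine ⟨Real.exp (L ^ 2 / 8) * max K₁ (3 * K), by positivity, ?_⟩
  intro α U P hprof hdec h12
  have hU1 : ContDiff ℝ 1 U := hprof.1.of_le (by norm_cast)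
  have hUc : Continuous U := hU1.continuous
  have hK₁ : 0 ≤ K₁ := by
    have := (h12 0).1; rw [norm_zero] at this; norm_num at this
    exact (norm_nonneg (fderiv ℝ U 0)).trans this
  have hmax : max K₁ 0 = K₁ := max_eq_left hK₁
  have b0 : ∀ y, ‖U y‖ ≤ K := fun y => (hdec y).trans (div_le_self hK.le (by linarith [norm_nonneg y]))
  have b1 : ∀ y, ‖fderiv ℝ U y‖ ≤ K₁ := fun y =>
    ((h12 y).1).trans (div_le_self hK₁ (by nlinarith [norm_nonneg y]))
  have conv := pv612_convective hU1 b0 b1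
  have hR := hr K K₁ K₂ α U P hprof hdec h12
  have cconv : Continuous (convect U U) := continuous_convect_of_contDiff hUc hU1
  have cf : Continuous (azFluct (convect U U)) := cconv.sub (continuous_azimuthalMean cconv)
  have bC : ∀ y, ‖convect U U y‖ ≤ K * K₁ / ((1 + ‖y‖) * (1 + ‖y‖ ^ 2)) := by
    intro y
    have h1 := (h12 y).1
    have h0 := hdec y
    calc ‖convect U U y‖ ≤ ‖fderiv ℝ U y‖ * ‖U y‖ := ContinuousLinearMap.le_opNorm _ _
      _ ≤ (K₁ / (1 + ‖y‖ ^ 2)) * (K / (1 + ‖y‖)) := mul_le_mul h1 h0 (norm_nonneg _) (by positivity)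
      _ = K * K₁ / ((1 + ‖y‖) * (1 + ‖y‖ ^ 2)) := by
          rw [div_mul_div_comm, mul_comm K₁ K, mul_comm (1 + ‖y‖ ^ 2) (1 + ‖y‖)]
  have bV : ∀ y, ‖azFluct (convect U U) y‖ ≤ 2 * (K * K₁) / ((1 + ‖y‖) * (1 + ‖y‖ ^ 2)) := by
    intro y
    have hm := norm_azimuthalMean_le_radial (φ := fun r => K * K₁ / ((1 + r) * (1 + r ^ 2))) bC y
    beta_reduce at hm
    rw [azFluct_apply]
    have := bC y
    calc ‖convect U U y - azimuthalMean (convect U U) y‖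
        ≤ ‖convect U U y‖ + ‖azimuthalMean (convect U U) y‖ := norm_sub_le _ _
      _ ≤ _ := by rw [mul_div_assoc]; linarith
  have P2 : ∀ y, ‖azFluct (convect U U) y‖ ^ 2 ≤ 16 * K ^ 2 * K₁ ^ 2 * ((1 + ‖y‖) ^ 4)⁻¹ := by
    intro y
    set t := ‖y‖ with ht
    have ht0 : 0 ≤ t := norm_nonneg _
    have hD : 0 < (1 + t) * (1 + t ^ 2) := by positivity
    have hV2 : ‖azFluct (convect U U) y‖ ^ 2 ≤ (2 * (K * K₁)) ^ 2 / ((1 + t) * (1 + t ^ 2)) ^ 2 := by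
      rw [← div_pow]; exact pow_le_pow_left₀ (norm_nonneg _) (bV y) 2
    have hq : (1 + t) ^ 2 ≤ 2 * (1 + t ^ 2) := by nlinarith [sq_nonneg (1 - t)]
    have h1 : (1 + t) ^ 2 ≤ 4 * (1 + t ^ 2) ^ 2 := by nlinarith [sq_nonneg t]
    have hpoly : 4 * (1 + t) ^ 4 ≤ 16 * ((1 + t) * (1 + t ^ 2)) ^ 2 := by
      calc 4 * (1 + t) ^ 4 = 4 * (1 + t) ^ 2 * (1 + t) ^ 2 := by ring
        _ ≤ 4 * (1 + t) ^ 2 * (4 * (1 + t ^ 2) ^ 2) := mul_le_mul_of_nonneg_left h1 (by positivity)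
        _ = 16 * ((1 + t) * (1 + t ^ 2)) ^ 2 := by ring
    refine hV2.trans ?_
    rw [← div_eq_mul_inv, div_le_div_iff₀ (by positivity) (by positivity)]
    nlinarith [mul_nonneg (sq_nonneg K) (sq_nonneg K₁), hpoly]
  have P3 : ∀ y, ‖azFluct (convect U U) y‖ ^ 2
      ≤ Real.exp (L ^ 2 / 4) * (‖azFluct (convect U U) y‖ ^ 2 * gauss y)
        + 16 * K ^ 2 * K₁ ^ 2 / L ^ 2 * ((1 + ‖y‖) ^ 4)⁻¹ := by
    intro y
    set t := ‖y‖ with ht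
    have ht0 : 0 ≤ t := norm_nonneg _
    by_cases hle : t ≤ L
    · have hg1 : 1 ≤ Real.exp (L ^ 2 / 4) * gauss y := by
        rw [gauss, ← ht, ← Real.exp_add]
        refine Real.one_le_exp ?_
        nlinarith [pow_le_pow_left₀ ht0 hle 2]
      have hnn : 0 ≤ 16 * K ^ 2 * K₁ ^ 2 / L ^ 2 * ((1 + t) ^ 4)⁻¹ := by positivity
      have := sq_nonneg ‖azFluct (convect U U) y‖
      nlinarith
    · replace hle : L < t := not_le.mp hle
      have hV2 : ‖azFluct (convect U U) y‖ ^ 2 ≤ (2 * (K * K₁)) ^ 2 / ((1 + t) * (1 + t ^ 2)) ^ 2 := by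
        rw [← div_pow]; exact pow_le_pow_left₀ (norm_nonneg _) (bV y) 2
      have hq : (1 + t) ^ 2 ≤ 2 * (1 + t ^ 2) := by nlinarith [sq_nonneg (1 - t)]
      have h4 : (1 + t) ^ 4 ≤ 4 * (1 + t ^ 2) ^ 2 := by nlinarith [hq, sq_nonneg (1 + t)]
      have hL2 : L ^ 2 ≤ (1 + t) ^ 2 := pow_le_pow_left₀ hL0.le (by linarith) 2
      have hDL : L ^ 2 * (1 + t) ^ 4 ≤ 4 * ((1 + t) * (1 + t ^ 2)) ^ 2 := by
        calc L ^ 2 * (1 + t) ^ 4 ≤ (1 + t) ^ 2 * (4 * (1 + t ^ 2) ^ 2) :=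
              mul_le_mul hL2 h4 (by positivity) (by positivity)
          _ = 4 * ((1 + t) * (1 + t ^ 2)) ^ 2 := by ring
      have hfirst : 0 ≤ Real.exp (L ^ 2 / 4) * (‖azFluct (convect U U) y‖ ^ 2 * gauss y) := by
        have := gauss_pos y; positivity
      have hsecond : (2 * (K * K₁)) ^ 2 / ((1 + t) * (1 + t ^ 2)) ^ 2
          ≤ 16 * K ^ 2 * K₁ ^ 2 / L ^ 2 * ((1 + t) ^ 4)⁻¹ := by
        rw [← div_eq_mul_inv, div_div, div_le_div_iff₀ (by positivity) (by positivity)]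
        nlinarith [mul_nonneg (sq_nonneg K) (sq_nonneg K₁), hDL]
      linarith [hV2.trans hsecond]
  have ig4 := integrable_one_add_norm_pow_four_inv
  have iV2 : Integrable fun y => ‖azFluct (convect U U) y‖ ^ 2 :=
    (ig4.const_mul (16 * K ^ 2 * K₁ ^ 2)).mono' (cf.norm.pow 2).aestronglyMeasurable
      (ae_of_all _ fun y => by
        rw [Real.norm_eq_abs, abs_of_nonneg (sq_nonneg _)]; exact P2 y)
  have bf : ∀ y, ‖azFluct (convect U U) y‖ ≤ 2 * (K₁ * K) := norm_azFluct_le (fun y =>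
    (ContinuousLinearMap.le_opNorm _ _).trans (mul_le_mul (b1 y) (b0 y) (norm_nonneg _) hK₁))
  have iV2g : Integrable fun y => ‖azFluct (convect U U) y‖ ^ 2 * gauss y := integrable_norm_sq_mul_gauss cf bf
  have hInt : ∫ y, ‖azFluct (convect U U) y‖ ^ 2
      ≤ Real.exp (L ^ 2 / 4) * (∫ y, ‖azFluct (convect U U) y‖ ^ 2 * gauss y)
        + 16 * K ^ 2 * K₁ ^ 2 / L ^ 2 * I4 := by
    have iR : Integrable fun y => Real.exp (L ^ 2 / 4) * (‖azFluct (convect U U) y‖ ^ 2 * gauss y)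
        + 16 * K ^ 2 * K₁ ^ 2 / L ^ 2 * ((1 + ‖y‖) ^ 4)⁻¹ := (iV2g.const_mul _).add (ig4.const_mul _)
    have := integral_mono iV2 iR P3
    rw [integral_add (iV2g.const_mul _) (ig4.const_mul _), MeasureTheory.integral_const_mul,
      MeasureTheory.integral_const_mul] at this
    rw [hI4]; exact this
  have hx2 : Real.exp (L ^ 2 / 8) ^ 2 = Real.exp (L ^ 2 / 4) := by
    rw [sq, ← Real.exp_add, show L ^ 2 / 8 + L ^ 2 / 8 = L ^ 2 / 4 by ring]
  have hz2 : (4 * K * K₁ * Real.sqrt I4 / L) ^ 2 = 16 * K ^ 2 * K₁ ^ 2 / L ^ 2 * I4 := by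
    calc (4 * K * K₁ * Real.sqrt I4 / L) ^ 2 = 16 * K ^ 2 * K₁ ^ 2 / L ^ 2 * Real.sqrt I4 ^ 2 := by ring
      _ = _ := by rw [Real.sq_sqrt hI4_nn]
  have hB : 0 ≤ ∫ y, ‖azFluct (convect U U) y‖ ^ 2 * gauss y :=
    integral_nonneg fun y => mul_nonneg (sq_nonneg _) (gauss_pos y).le
  have hz0 : 0 ≤ 4 * K * K₁ * Real.sqrt I4 / L :=
    div_nonneg (mul_nonneg (mul_nonneg (mul_nonneg (by norm_num) hK.le) hK₁) (Real.sqrt_nonneg _)) hL0.le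
  have hInt' : ∫ y, ‖azFluct (convect U U) y‖ ^ 2
      ≤ Real.exp (L ^ 2 / 8) ^ 2 * (∫ y, ‖azFluct (convect U U) y‖ ^ 2 * gauss y)
        + (4 * K * K₁ * Real.sqrt I4 / L) ^ 2 := hInt.trans (le_of_eq (by rw [hx2, hz2]))
  have hsq := sqrt_le_of_sq_bound (Real.exp_pos (L ^ 2 / 8)).le hB hz0 hInt'
  have hb : 0 ≤ Real.sqrt (∫ y, ‖azFluct U y‖ ^ 2 * gauss y) := Real.sqrt_nonneg _
  have hc : 0 ≤ Real.sqrt (∑ i, ∫ y, ‖pd i (azFluct U) y‖ ^ 2 * gauss y) := Real.sqrt_nonneg _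
  have hexp : 0 ≤ Real.exp (L ^ 2 / 8) := (Real.exp_pos _).le
  have htail : 4 * K * K₁ * Real.sqrt I4 / L ≤ ε := by rw [hT, hmax] at hTL; exact hTL
  have m1 : Real.exp (L ^ 2 / 8) * K₁ * Real.sqrt (∫ y, ‖azFluct U y‖ ^ 2 * gauss y)
      ≤ Real.exp (L ^ 2 / 8) * max K₁ (3 * K) * Real.sqrt (∫ y, ‖azFluct U y‖ ^ 2 * gauss y) :=
    mul_le_mul_of_nonneg_right (mul_le_mul_of_nonneg_left (le_max_left _ _) hexp) hb
  have m2 : Real.exp (L ^ 2 / 8) * (3 * K) * Real.sqrt (∑ i, ∫ y, ‖pd i (azFluct U) y‖ ^ 2 * gauss y)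
      ≤ Real.exp (L ^ 2 / 8) * max K₁ (3 * K) * Real.sqrt (∑ i, ∫ y, ‖pd i (azFluct U) y‖ ^ 2 * gauss y) :=
    mul_le_mul_of_nonneg_right (mul_le_mul_of_nonneg_left (le_max_right _ _) hexp) hc
  have hmid : Real.exp (L ^ 2 / 8) * Real.sqrt (∫ y, ‖azFluct (convect U U) y‖ ^ 2 * gauss y)
      ≤ Real.exp (L ^ 2 / 8) * (K₁ * Real.sqrt (∫ y, ‖azFluct U y‖ ^ 2 * gauss y)
          + 3 * K * Real.sqrt (∑ i, ∫ y, ‖pd i (azFluct U) y‖ ^ 2 * gauss y)) :=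
    mul_le_mul_of_nonneg_left conv hexp
  calc Real.sqrt (∫ y, ‖azFluct (gradient P) y‖ ^ 2 * gauss y)
      ≤ Real.sqrt (∫ y, ‖azFluct (convect U U) y‖ ^ 2) := hR
    _ ≤ Real.exp (L ^ 2 / 8) * Real.sqrt (∫ y, ‖azFluct (convect U U) y‖ ^ 2 * gauss y)
          + 4 * K * K₁ * Real.sqrt I4 / L := hsq
    _ ≤ _ := by nlinarith [hmid, m1, m2, htail]

/-- RUNG K(k) from PV Lemma 2.1, the Riesz kernel [a-r], and the §6.5 endgame. -/
theorem kFoldExtremeRotationPV_of_riesz (hd : PVLemma21) (hr : PVRieszPressure) (hb : PVEndgame) :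
    KFoldExtremeRotationPV :=
  kFoldExtremeRotationPV_of_pressure hd (pvPressure63_of_riesz hr) hb


/-! #### Sharpening [b]: PV §6.5 is elementary given Prop. 5.1 + identity (5.4) and Prop. 3.1 (both α-INDEPENDENT R1 machinery). -/

/-- **[b1] PV Prop. 5.1 (ε = 1/4) + the weighted enstrophy identity (5.4) (OPEN INPUT):** for a profile with (1.9), (2.1) there is a
continuous weight `m e^{−5|y|²/16} ≤ w ≤ M e^{−3|y|²/16}` (m, M from the constants only, NOT α; PV: `L*w = 0`, §5) with
`∫ |Ω|² w = α ∫ ⟨U + ½y, L_rot U⟩ w` (Ω = curl U; by PV (4.3)/(4.4) the error term is exactly E = (U + ½y)·L_rot U). -/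
def PVWeightedEnstrophy : Prop :=
  ∀ K K₁ K₂ : ℝ, 0 < K → ∃ m M : ℝ, 0 < m ∧ 0 < M ∧
    ∀ (α : ℝ) (U : E3 → E3) (P : E3 → ℝ), IsPVProfile α U P → (∀ y, ‖U y‖ ≤ K / (1 + ‖y‖)) →
      PVDecay12 K₁ K₂ U →
      ∃ w : E3 → ℝ, Continuous w ∧
        (∀ y, m * Real.exp (-(5 / 16 : ℝ) * ‖y‖ ^ 2) ≤ w y ∧ w y ≤ M * Real.exp (-(3 / 16 : ℝ) * ‖y‖ ^ 2)) ∧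
        Integrable (fun y => ‖curl U y‖ ^ 2 * w y) ∧
        ∫ y, ‖curl U y‖ ^ 2 * w y = α * ∫ y, inner ℝ (U y + (1 / 2 : ℝ) • y) (rotLie U y) * w y

/-- **[b2] PV Prop. 3.1 (OPEN INPUT):** small enstrophy on a ball forces triviality — `‖Ω‖²_{L²(B_R̄)} < c ⇒ U ≡ 0` with
R̄ = √(8C_{U,1}) and c = C_Ω⁻² universal (both α-independent). -/
def PVProp31 : Prop :=
  ∀ K K₁ K₂ : ℝ, 0 < K → ∃ R c : ℝ, 0 < c ∧
    ∀ (α : ℝ) (U : E3 → E3) (P : E3 → ℝ), IsPVProfile α U P → (∀ y, ‖U y‖ ≤ K / (1 + ‖y‖)) →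
      PVDecay12 K₁ K₂ U → (∫ y in Metric.closedBall (0 : E3) R, ‖curl U y‖ ^ 2) < c → ∀ y, U y = 0

/-- The Gaussian moment `(K + ½|y|)² e^{−|y|²/8}` is integrable on `ℝ³`. -/
theorem integrable_moment_gauss8 (K : ℝ) :
    Integrable fun y : E3 => (K + (1 / 2 : ℝ) * ‖y‖) ^ 2 * Real.exp (-(1 / 8 : ℝ) * ‖y‖ ^ 2) := by
  have h := (integrable_exp_neg_mul_norm_sq (b := 1 / 16) (by norm_num)).const_mul (2 * K ^ 2 + 8)
  refine h.mono' (((continuous_const.add (continuous_const.mul continuous_norm)).pow 2).mul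
    (Real.continuous_exp.comp (continuous_const.mul (continuous_norm.pow 2)))).aestronglyMeasurable
    (ae_of_all _ fun y => ?_)
  have hs : 0 ≤ ‖y‖ ^ 2 := sq_nonneg _
  have he := Real.add_one_le_exp ((1 / 16 : ℝ) * ‖y‖ ^ 2)
  have hE : 0 < Real.exp ((1 / 16 : ℝ) * ‖y‖ ^ 2) := Real.exp_pos _
  have hsq : (K + (1 / 2 : ℝ) * ‖y‖) ^ 2 ≤ 2 * K ^ 2 + (1 / 2 : ℝ) * ‖y‖ ^ 2 := by
    nlinarith [sq_nonneg (K - (1 / 2 : ℝ) * ‖y‖)]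
  have hkey : (K + (1 / 2 : ℝ) * ‖y‖) ^ 2 ≤ (2 * K ^ 2 + 8) * Real.exp ((1 / 16 : ℝ) * ‖y‖ ^ 2) := by
    nlinarith [sq_nonneg K, hE]
  rw [Real.norm_eq_abs, abs_of_nonneg (by positivity)]
  have hprod : Real.exp ((1 / 16 : ℝ) * ‖y‖ ^ 2) * Real.exp (-(1 / 16 : ℝ) * ‖y‖ ^ 2) = 1 := by
    rw [← Real.exp_add, show (1 / 16 : ℝ) * ‖y‖ ^ 2 + -(1 / 16 : ℝ) * ‖y‖ ^ 2 = 0 by ring, Real.exp_zero]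
  have hsplit : Real.exp (-(1 / 8 : ℝ) * ‖y‖ ^ 2) = Real.exp (-(1 / 16 : ℝ) * ‖y‖ ^ 2) * Real.exp (-(1 / 16 : ℝ) * ‖y‖ ^ 2) := by
    rw [← Real.exp_add]; ring_nf
  have hE' : 0 ≤ Real.exp (-(1 / 16 : ℝ) * ‖y‖ ^ 2) := (Real.exp_pos _).le
  calc (K + (1 / 2 : ℝ) * ‖y‖) ^ 2 * Real.exp (-(1 / 8 : ℝ) * ‖y‖ ^ 2)
      = (K + (1 / 2 : ℝ) * ‖y‖) ^ 2 * Real.exp (-(1 / 16 : ℝ) * ‖y‖ ^ 2) * Real.exp (-(1 / 16 : ℝ) * ‖y‖ ^ 2) := by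
        rw [hsplit, mul_assoc]
    _ ≤ (2 * K ^ 2 + 8) * Real.exp ((1 / 16 : ℝ) * ‖y‖ ^ 2) * Real.exp (-(1 / 16 : ℝ) * ‖y‖ ^ 2)
          * Real.exp (-(1 / 16 : ℝ) * ‖y‖ ^ 2) :=
        mul_le_mul_of_nonneg_right (mul_le_mul_of_nonneg_right hkey hE') hE'
    _ = (2 * K ^ 2 + 8) * Real.exp (-(1 / 16 : ℝ) * ‖y‖ ^ 2) := by rw [mul_assoc (2 * K ^ 2 + 8), hprod, mul_one]

set_option maxHeartbeats 1600000 in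
/-- **PV §6.5 proved from its two inputs: `PVWeightedEnstrophy → PVProp31 → PVEndgame`.**  (6.21): by Cauchy–Schwarz in L²_γ,
`∫|Ω|²w ≤ |α| M (∫(K+½|y|)²e^{−|y|²/8})^{1/2} ‖L_rot U‖_γ`; on B_R̄, `w ≥ m e^{−5R̄²/16}`, so `‖Ω‖²_{L²(B_R̄)} ≤ D·|α|‖L_rot U‖_γ < c`
once `|α|‖L_rot U‖_γ ≤ ε₀ := c/(2(D+1))`; then Prop. 3.1. -/
theorem pvEndgame_of (h51 : PVWeightedEnstrophy) (h31 : PVProp31) : PVEndgame := by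
  intro K K₁ K₂ hK
  obtain ⟨m, M, hm, hM, h51'⟩ := h51 K K₁ K₂ hK
  obtain ⟨R, c, hc, h31'⟩ := h31 K K₁ K₂ hK
  obtain ⟨I, hI⟩ : ∃ I : ℝ, I = ∫ y : E3, (K + (1 / 2 : ℝ) * ‖y‖) ^ 2 * Real.exp (-(1 / 8 : ℝ) * ‖y‖ ^ 2) :=
    ⟨_, rfl⟩
  have hI0 : 0 ≤ I := by rw [hI]; exact integral_nonneg fun y => by positivity
  obtain ⟨D, hD⟩ : ∃ D : ℝ, D = Real.exp ((5 / 16 : ℝ) * R ^ 2) / m * (M * Real.sqrt I) := ⟨_, rfl⟩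
  have hD0 : 0 ≤ D := by rw [hD]; positivity
  refine ⟨c / (2 * (D + 1)), by positivity, ?_⟩
  intro α U P hprof hdec h12 hsmall
  obtain ⟨w, hwc, hwb, hIw, hId⟩ := h51' α U P hprof hdec h12
  apply h31' α U P hprof hdec h12
  have hPVB := pvBounds_of_decay hprof hK hdec h12
  have hK'0 : 0 ≤ max K (max K₁ K₂) := hPVB.K_nonneg
  have hU1 : ContDiff ℝ 1 U := hprof.1.of_le (by norm_cast)
  have hUc : Continuous U := hU1.continuous
  have hLc : Continuous (rotLie U) := hPVB.continuous_rotLie'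
  have hΩc : Continuous (curl U) := (contDiff_curl (n := 0) (by exact_mod_cast hU1)).continuous
  have b0 : ∀ y, ‖U y‖ ≤ K := fun y => (hdec y).trans (div_le_self hK.le (by linarith [norm_nonneg y]))
  have hw0 : ∀ y, 0 ≤ w y := fun y => le_trans (by have := Real.exp_pos (-(5 / 16 : ℝ) * ‖y‖ ^ 2); positivity) (hwb y).1
  have g0 : ∀ y, 0 < gauss y := gauss_pos
  have cf : Continuous fun y => (w y / gauss y) • (U y + (1 / 2 : ℝ) • y) :=
    (hwc.div continuous_gauss fun y => (g0 y).ne').smul (hUc.add (continuous_id.const_smul (1 / 2 : ℝ)))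
  have bf : ∀ y, ‖(w y / gauss y) • (U y + (1 / 2 : ℝ) • y)‖ ^ 2 * gauss y
      ≤ M ^ 2 * ((K + (1 / 2 : ℝ) * ‖y‖) ^ 2 * Real.exp (-(1 / 8 : ℝ) * ‖y‖ ^ 2)) := by
    intro y
    have hv : ‖U y + (1 / 2 : ℝ) • y‖ ≤ K + (1 / 2 : ℝ) * ‖y‖ := by
      refine (norm_add_le _ _).trans ?_
      rw [norm_smul, Real.norm_eq_abs, abs_of_nonneg (by norm_num : (0 : ℝ) ≤ 1 / 2)]
      linarith [b0 y]
    have hv0 : 0 ≤ K + (1 / 2 : ℝ) * ‖y‖ := by positivity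
    have e1 : ‖(w y / gauss y) • (U y + (1 / 2 : ℝ) • y)‖ ^ 2 * gauss y
        = w y ^ 2 / gauss y * ‖U y + (1 / 2 : ℝ) • y‖ ^ 2 := by
      rw [norm_smul, Real.norm_eq_abs, abs_of_nonneg (div_nonneg (hw0 y) (g0 y).le)]
      field_simp
    rw [e1]
    have hw2 : w y ^ 2 ≤ (M * Real.exp (-(3 / 16 : ℝ) * ‖y‖ ^ 2)) ^ 2 := pow_le_pow_left₀ (hw0 y) (hwb y).2 2
    have hexp : (M * Real.exp (-(3 / 16 : ℝ) * ‖y‖ ^ 2)) ^ 2 / gauss y = M ^ 2 * Real.exp (-(1 / 8 : ℝ) * ‖y‖ ^ 2) := by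
      rw [gauss, mul_pow, sq (Real.exp _), ← Real.exp_add, mul_div_assoc, ← Real.exp_sub]
      ring_nf
    have h1 : w y ^ 2 / gauss y ≤ M ^ 2 * Real.exp (-(1 / 8 : ℝ) * ‖y‖ ^ 2) := by
      rw [← hexp]; exact div_le_div_of_nonneg_right hw2 (g0 y).le
    have h2 : ‖U y + (1 / 2 : ℝ) • y‖ ^ 2 ≤ (K + (1 / 2 : ℝ) * ‖y‖) ^ 2 := pow_le_pow_left₀ (norm_nonneg _) hv 2
    calc w y ^ 2 / gauss y * ‖U y + (1 / 2 : ℝ) • y‖ ^ 2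
        ≤ (M ^ 2 * Real.exp (-(1 / 8 : ℝ) * ‖y‖ ^ 2)) * (K + (1 / 2 : ℝ) * ‖y‖) ^ 2 :=
          mul_le_mul h1 h2 (sq_nonneg _) (by positivity)
      _ = _ := by ring
  have iMom := integrable_moment_gauss8 K
  have iF : Integrable fun y => ‖(w y / gauss y) • (U y + (1 / 2 : ℝ) • y)‖ ^ 2 * gauss y :=
    (iMom.const_mul (M ^ 2)).mono' ((cf.norm.pow 2).mul continuous_gauss).aestronglyMeasurable
      (ae_of_all _ fun y => by
        rw [Real.norm_eq_abs, abs_of_nonneg (mul_nonneg (sq_nonneg _) (g0 y).le)]; exact bf y)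
  have bL : ∀ y, ‖rotLie U y‖ ≤ max K (max K₁ K₂) * ‖y‖ + max K (max K₁ K₂) := hPVB.norm_rotLie_le
  have iG : Integrable fun y => ‖rotLie U y‖ ^ 2 * gauss y :=
    integrable_norm_sq_mul_gauss_of_quad hLc (fun y => by
      rw [sq]
      exact quad_of_lin (bL y) (bL y) (norm_nonneg _) (norm_nonneg _) hK'0 hK'0 hK'0 hK'0 (norm_nonneg y))
  have cs := weighted_cauchy_schwarz cf hLc continuous_gauss.measurable (fun y => (g0 y).le) iF iG
  have hpt : (fun y => inner ℝ ((w y / gauss y) • (U y + (1 / 2 : ℝ) • y)) (rotLie U y) * gauss y)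
      = fun y => inner ℝ (U y + (1 / 2 : ℝ) • y) (rotLie U y) * w y := by
    funext y
    rw [real_inner_smul_left]
    have hg : gauss y ≠ 0 := (g0 y).ne'
    field_simp
  rw [hpt] at cs
  have hF : Real.sqrt (∫ y, ‖(w y / gauss y) • (U y + (1 / 2 : ℝ) • y)‖ ^ 2 * gauss y) ≤ M * Real.sqrt I := by
    have hle : ∫ y, ‖(w y / gauss y) • (U y + (1 / 2 : ℝ) • y)‖ ^ 2 * gauss y ≤ M ^ 2 * I := by
      have := integral_mono iF (iMom.const_mul (M ^ 2)) bf
      rw [MeasureTheory.integral_const_mul] at this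
      rw [hI]; exact this
    calc Real.sqrt (∫ y, ‖(w y / gauss y) • (U y + (1 / 2 : ℝ) • y)‖ ^ 2 * gauss y)
        ≤ Real.sqrt (M ^ 2 * I) := Real.sqrt_le_sqrt hle
      _ = M * Real.sqrt I := by rw [Real.sqrt_mul' _ hI0, Real.sqrt_sq hM.le]
  have hJ : ∫ y, ‖curl U y‖ ^ 2 * w y
      ≤ |α| * (M * Real.sqrt I) * Real.sqrt (∫ y, ‖rotLie U y‖ ^ 2 * gauss y) := by
    rw [hId]
    have hX := cs.trans (mul_le_mul_of_nonneg_right hF (Real.sqrt_nonneg _))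
    calc α * ∫ y, inner ℝ (U y + (1 / 2 : ℝ) • y) (rotLie U y) * w y
        ≤ |α| * |∫ y, inner ℝ (U y + (1 / 2 : ℝ) • y) (rotLie U y) * w y| := by
          rw [← abs_mul]; exact le_abs_self _
      _ ≤ |α| * ((M * Real.sqrt I) * Real.sqrt (∫ y, ‖rotLie U y‖ ^ 2 * gauss y)) :=
          mul_le_mul_of_nonneg_left hX (abs_nonneg _)
      _ = _ := by ring
  have hball : ∀ y ∈ Metric.closedBall (0 : E3) R,
      ‖curl U y‖ ^ 2 ≤ Real.exp ((5 / 16 : ℝ) * R ^ 2) / m * (‖curl U y‖ ^ 2 * w y) := by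
    intro y hy
    rw [Metric.mem_closedBall, dist_zero_right] at hy
    have hwl := (hwb y).1
    have hR : Real.exp (-(5 / 16 : ℝ) * R ^ 2) ≤ Real.exp (-(5 / 16 : ℝ) * ‖y‖ ^ 2) :=
      Real.exp_le_exp.2 (by nlinarith [pow_le_pow_left₀ (norm_nonneg y) hy 2])
    have h1 : 1 ≤ Real.exp ((5 / 16 : ℝ) * R ^ 2) / m * w y := by
      rw [div_mul_eq_mul_div, le_div_iff₀ hm, one_mul]
      have : m * Real.exp (-(5 / 16 : ℝ) * R ^ 2) ≤ w y := (mul_le_mul_of_nonneg_left hR hm.le).trans hwl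
      calc m = Real.exp ((5 / 16 : ℝ) * R ^ 2) * (m * Real.exp (-(5 / 16 : ℝ) * R ^ 2)) := by
            rw [mul_left_comm, ← Real.exp_add]; ring_nf; rw [Real.exp_zero, mul_one]
        _ ≤ Real.exp ((5 / 16 : ℝ) * R ^ 2) * w y := mul_le_mul_of_nonneg_left this (Real.exp_pos _).le
    have h0 : 0 ≤ ‖curl U y‖ ^ 2 := sq_nonneg _
    calc ‖curl U y‖ ^ 2 = ‖curl U y‖ ^ 2 * 1 := (mul_one _).symm
      _ ≤ ‖curl U y‖ ^ 2 * (Real.exp ((5 / 16 : ℝ) * R ^ 2) / m * w y) := mul_le_mul_of_nonneg_left h1 h0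
      _ = _ := by ring
  have iΩball : IntegrableOn (fun y => ‖curl U y‖ ^ 2) (Metric.closedBall (0 : E3) R) :=
    (hΩc.norm.pow 2).continuousOn.integrableOn_compact (isCompact_closedBall _ _)
  have hB1 : ∫ y in Metric.closedBall (0 : E3) R, ‖curl U y‖ ^ 2
      ≤ ∫ y in Metric.closedBall (0 : E3) R, Real.exp ((5 / 16 : ℝ) * R ^ 2) / m * (‖curl U y‖ ^ 2 * w y) :=
    setIntegral_mono_on iΩball (hIw.const_mul _).integrableOn measurableSet_closedBall hball
  have hB2 : ∫ y in Metric.closedBall (0 : E3) R, Real.exp ((5 / 16 : ℝ) * R ^ 2) / m * (‖curl U y‖ ^ 2 * w y)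
      ≤ Real.exp ((5 / 16 : ℝ) * R ^ 2) / m * ∫ y, ‖curl U y‖ ^ 2 * w y := by
    rw [MeasureTheory.integral_const_mul]
    refine mul_le_mul_of_nonneg_left ?_ (by positivity)
    exact setIntegral_le_integral hIw (ae_of_all _ fun y => mul_nonneg (sq_nonneg _) (hw0 y))
  have hLn : 0 ≤ Real.sqrt (∫ y, ‖rotLie U y‖ ^ 2 * gauss y) := Real.sqrt_nonneg _
  have hsm : |α| * Real.sqrt (∫ y, ‖rotLie U y‖ ^ 2 * gauss y) ≤ c / (2 * (D + 1)) := hsmall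
  have hkey : ∫ y in Metric.closedBall (0 : E3) R, ‖curl U y‖ ^ 2
      ≤ D * (|α| * Real.sqrt (∫ y, ‖rotLie U y‖ ^ 2 * gauss y)) := by
    refine (hB1.trans hB2).trans ?_
    rw [hD]
    have := mul_le_mul_of_nonneg_left hJ (by positivity : 0 ≤ Real.exp ((5 / 16 : ℝ) * R ^ 2) / m)
    refine this.trans (le_of_eq ?_)
    ring
  have hfrac : D * (c / (2 * (D + 1))) < c := by
    rw [mul_div_assoc', div_lt_iff₀ (by positivity)]
    nlinarith
  calc ∫ y in Metric.closedBall (0 : E3) R, ‖curl U y‖ ^ 2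
      ≤ D * (|α| * Real.sqrt (∫ y, ‖rotLie U y‖ ^ 2 * gauss y)) := hkey
    _ ≤ D * (c / (2 * (D + 1))) := mul_le_mul_of_nonneg_left hsm hD0
    _ < c := hfrac

/-- **RUNG K(k) from four α-uniform published inputs**: PV Lemma 2.1, the Riesz kernel (6.13), Prop. 5.1 + (5.4), and Prop. 3.1 —
the rest of PV §6 and §6.5 is proved in this file. -/
theorem kFoldExtremeRotationPV_of_inputs (hd : PVLemma21) (hr : PVRieszPressure) (h51 : PVWeightedEnstrophy)
    (h31 : PVProp31) : KFoldExtremeRotationPV :=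
  kFoldExtremeRotationPV_of_riesz hd hr (pvEndgame_of h51 h31)


/-- **RUNG K(k) is a theorem of the tree** (p652397, DSS road, not this toolkit): recorded so that no LEAD registers the DRAFT line
«pv_kfold_threshold» (born closed). The compositions above remain a second, PV-§6 path to the same statement. -/
theorem kFoldExtremeRotationPV_holds : KFoldExtremeRotationPV :=
  Summit.NavierStokesRegularity.NavierStokesRegularity.Theorems.CoriolisHead.kFoldExtremeRotation_liouville

end Skeleton

end SkeletonSection

end Summit.NavierStokesRegularity.NavierStokesRegularity.Cruxes.NoCoRotatingCore.AlphaMShift
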